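import Summits.QuantumFields.YangMills.Theorems.BalabanUVNodesK2CornerRoadSign
import Literature.MathematicalPhysics.QuantumFieldTheory.Balaban1983to89.FlowStepRuns
import Summits.QuantumFields.BalabanUV.Gaps.EndDrawdownEverySlope
import Summits.QuantumFields.YangMills.Theorems.BalabanUVNodesK2R8Holds
import Summits.QuantumFields.YangMills.Theorems.BalabanUVNodesN18CornerBandOfKernelLetters
import Literature.MathematicalPhysics.QuantumFieldTheory.Balaban1983to89.T4BetaStationary
import Summits.QuantumFields.YangMills.Theorems.BalabanUVNodesK2CornerRoadRows
import Summits.QuantumFields.YangMills.Theorems.BalabanUVNodesK2V7Defs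

/-!
# Crux K2⁷ `EndpointGivenBR13SepCoPH` (stmt-QuantumFields-20543) — idea-7 (lens INVERSION), g10: THE REGISTERED CORNER STUB 2ᶜᴰ (skeleton v7c) READ BACKWARDS —
# NECESSITY kernel (crux workfile; 0 `sorry`; conditional implications between HYPOTHESIS SHAPES only)

Cell `ym-nodeO-ideate`, IDEATOR seat `ym-nodeO-idea-7` gen 10 (planner-ym-nodeO-idea-7-g10-0), lens «run the dependency backwards from 20543»; count-neutral
(no proposal, no route, no claim, no kit, no lit).  Card of record: `Cruxes/EndpointGivenBR13SepCoPH/Ideas/corner-limit-sign.md` (ED.5.1; ED.6 keys it to v7c).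
ROUND-5 object for CRIT-2 g3 (replaces the `Idea7V7Transport.lean` offer of my 07:04Z WORD V2, MOOTED by the corner keying — the registered texts never read `θ.v₀`;
CRIT-2 `Crit2V0BlindProbe.lean` 2e37afc7524afa41 + S. 07:15:59Z already hold the honest list of `v₀`-reading prefix conjuncts {`SlotsNondegenerate₁₃`, `Provisos₁₃SepCoPH`}).

SETTING (plan g84 `[YMPLAN-G84-K2V7-WINDOW-OUTCOME + CORNER RE-KEY]`, bus pub-ymgap l.30600; skeleton v7 CORNER EDITION `K2Skeleton13SepCoPHv7c.lean`
REGISTERED 795c9e8285fed415 (`[YMPLAN-G84-K2V7-REGISTERED 795c9e8285fed415]` bus l.31245, 07:45:59Z; texts = draft 39189bf31904f7f3's verbatim): 2ᶜᴰ `CornerDriftPos` :542 «prefix → ∃ b s A,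
ScaleAnchor D.βfun b ∧ 0 < s ∧ OneLoopDrift s A b», 1ᶜᴿ `RunChain190AtCornerDriftSlope` :558, composition `EndpointGivenBR13SepCoPH_of_cornerDriftKeyed` :573, stubs :911 ∕ :918).  U3ᴷ := K3⁷-TYPE END-FREE letters on the datum's β
(N17 `ScaleShiftRate c ρ θ.γ`, `0 < ρ < 1`; history moduli `HistLipschitz Λ θ.γ`; `FadingMemory`) — the `hU3` text of PORT-1's p609637 `EndpointGivenBR13SepCoPH_of_u3K_cornerSignK`
VERBATIM; the history moduli are UNPRINTED (tree docstring of `HistLipschitz` ∕ `FadingMemory`: GAPS G-t4-U2-2; CRIT-2 E-CRIT2-1 S. 07:25:21Z) and N17's rate is K3⁷'s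
unprinted NE4∕NE9 content — U3ᴷ is a hypothesis SHAPE, never print-backed.  NOTE: the necessity theorems T5∕T6 consume ONLY U3ᴷ's N17 conjunct (given an anchoring b);
the moduli enter T0∕T7 alone, through p609637 `exists_scaleAnchor_of_histLipschitz` (existence of b).  The SUFFICIENCY side on these letters («modulo U3ᴷ, 2ᶜᴰ ⟺ the κ-free sign bit, and {U3ᴷ, 2ᶜᴰ} closes K2⁷ by name without 1ᶜᴿ») is PORT-1 g2's INTENT-3
`Theorems/BalabanUVNodesK2CornerDriftOfU3.lean` (bus 07:19:42Z) — NOT restated here.  THIS FILE is the other direction: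

* §1 (generic, `β : HBeta`, `b : ℕ → ℝ`): N17 + an anchor make the corner values DRIFT at their limit slope with bounded deviation — SIGN-FREE (T0's kernel); the drift slope IS
  the corner limit (Cesàro, p599976); and **AN EVENTUALLY NEGATIVE β REFUTES END** for every forward-generated construction ((0.20) solved forward: `1∕g_k² ≥ 1∕g²_{k₁} + n·e → ∞`
  uniformly along in-interval runs), whence **END ⟹ `0 ≤ b_∞` ⟹ `0 ≤ s`** for every anchoring corner sequence and every drift slope (ed.4 sketch :748–:822 re-based on DEF-1's
  `ScaleAnchor`, with p599976's every-height constant remainder in place of my `CornerAnchor` lemmas).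
* §2 (at the record, texts VERBATIM): **T7 ★★ K2⁷'s OWN CONSEQUENT + U3ᴷ ⟹ 2ᶜᴰ WITH `0 < s` RELAXED TO `0 ≤ s`** (`CornerDriftNonnegGivenEnd`), with T5 (limit form `0 ≤ b_∞`),
  T6 (slope form) and T0 (the anchor-and-drift part of 2ᶜᴰ is FREE from U3ᴷ).  Read with PORT-1's sufficiency: modulo U3ᴷ the registered 2ᶜᴰ sits between END's necessary
  condition and END's sufficient condition, the two differing by the BOUNDARY `{b_∞ = 0}` = `{s = 0}` ONLY — the corner keying has NO junk surplus (contrast CRIT-2 (P2) on the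
  fill keying `bOwn`), and 2ᶜᴰ's entire END-surplus is the strictness of one inequality.
* §3: the boundary is INHABITED WITH END (TOY A, β ≡ 0: all U3 letters, anchored drift at slope 0, END by the tree's `FlowStepRuns.endpointExistence_modelOf`) — so T6/T7's `0 ≤ s`
  cannot be sharpened to 2ᶜᴰ's `0 < s` from END + letters; TOY B (`β_k = −g_k`, ed.4 sketch :952) inhabits it WITHOUT END: on the boundary the letters decide nothing.

NEAREST IN-TREE PRIOR (split currency, β sub-cell gaps seat g1-p3 — cited, not imported): `Gaps.EndDrawdownEverySlope.endpointExistence_sign_sandwich_of_oneLoopDrift`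
(«`0 < L ⟹ E`, `E ⟹ 0 ≤ L`» for a `OneLoopSplit` with `EverySlope` remainder control) ∕ `slope_nonneg_of_endpointExistence_everySlope`, its boundary toys
`everySlope_boundary_undecided` (`betaN`), and `Gaps.CapTailEndNecessity.binf_nonneg_of_endpointExistence`.  THIS file is that sandwich's END ⟹ side in the
REGISTERED stub's SPLIT-FREE corner letters — `ScaleAnchor` + N17 on the datum's β, no `B12Beta.OneLoopSplit` object (whose `vanish` field an arbitrary datum β
need not admit), remainder control DERIVED at every height from N17 + anchor (p599976) instead of posited as `EverySlope` — and keyed at K2⁷'s prefix with U3ᴷ.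

EDITION 2 (same session, CRIT-2 g3 ROUND-5 verdict S. 07:55:29Z «CONFIRMED … SURVIVES priced; NEXT CF: TOY B in-file; one line on (B)»; insert-only over ed.1 749038ca7da7c449 ∕ commit
13282c8bc333 — one import `Gaps.EndDrawdownEverySlope` + this paragraph + §4): §4 puts TOY B IN THIS FILE with the gaps cell's own toy `betaN` (`β_{k+1}(g_0,…,g_k) = −g_k`): it carries ALL the
U3 letters (N17 with `c = 0`; moduli `Λ k i = [i = k]`, fading with `C = 1`), is ANCHORED to `b ≡ 0`, DRIFTS at slope `0`, and has NO END (`Gaps.EndDrawdownEverySlope.not_endpointExistence_betaN`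
BY NAME) — so with TOY A the boundary `{b_∞ = 0}` is UNDECIDED BY THE LETTERS in one file (`boundary_undecided_by_letters`).  ON (B): `B16.EndStatementBPrinted C := Thm1Printed C ∧ Cor3_250 C`
(B16.lean :419) reads the B16 construction `D.C` ONLY — no β-letter occurs in it — so at the generic level of §1∕§3∕§4 (β and the construction independent objects, linked only by
`ForwardGenerated`) it is SILENT on the corner sign; whether (B) ∧ the rest of the prefix AT THE RECORD (where `D.C` and `D.βfun` are both functions of θ) excludes `b_∞ = 0` is record
content (NODE O ∕ def-T), undecided here — hence «2ᶜᴰ's END-surplus mod U3ᴷ ∧ (B) is nil» is NOT known, and the honest statement stays «mod U3ᴷ, up to the boundary, at the generic level».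

EDITION 3 (seat gen 11, planner-ym-nodeO-idea-7-g11-0, 2026-08-28; TRIGGER (β) of g10's handoff FIRED: route rev 26ᴿ∕27, plan g84 `[YMPLAN-G84-REV26R-LANDED]` bus pub-ymgap l.31700 —
K2⁷ stmt-20543 is `aside` (supplier road), the DECIDING crux is K1⁸ `StabilityBRunRowsAtRecordR13SepCoPH` stmt-26907 (∃ witness θ carrying unity ∧ slots, admissibility, (B), the window
AND the run rows (i) ∕ (iv) ∕ (C) for `β_θ`), K2⁸ `EndpointGivenRunRowsR13SepCoPH` stmt-26908 is born CLOSED by `BalabanUVNodesK2R8Holds.endpointGivenRunRowsR13SepCoPH_holds`; insert-only over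
ed.2 da154ffa1cbc2a54 ∕ commit b3d74b5595d7 — one import `…Theorems.BalabanUVNodesK2R8Holds`, this paragraph, §5, §6): §5 RE-KEYS the inversion to the rows — `RunRowsShape β` (K1⁸'s
last conjunct VERBATIM for a generic β; = DEF-1's `RunConstRemainder` ∧ run-wise (PS) ∧ `SurvCont`, `Iff.rfl`), ROWS ⟹ END (node n24 BY NAME) ⟹ `0 ≤ b_∞` ∕ `0 ≤ s` generically and AT
THE RECORD (T8 ∕ T8′: K2⁸'s closer BY NAME + T5 ∕ T6), and AT K1⁸'s WITNESS (T9: K1⁸ + U3ᴷ ⟹ a witnessing tuple with END and all anchoring corner limits ∕ drift slopes `≥ 0`); TOY A has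
the rows, TOY B has them not (`rows_boundary_undecided_by_letters`).  §6 LOCATES THE PRICE of displaying the rows for ONE row: TOY C♭ `betaFr` (`β_1(g_0) = 2 − fract(1∕g_0²)`, `β_{k+1} = 1`
for `k ≥ 1`) has END for `modelOf betaFr` (explicit shooting through the downward staircase, no continuity used), rows (i) ∧ (iv) at EVERY window, and survivor continuity (C) at NO window
(`runRows_not_necessary_for_end`, `runRows_strictly_stronger_than_end`): K1⁸'s rows conjunct is STRICTLY STRONGER than R4's END binder at the witness, in its (C) row, unrepairably
by the choice of window — the plan's banked «K1⁸ STRONGER than END» made kernel-certain and located ((iv)'s surplus is the gaps cell's AF-1 §12 HOME model, cited not re-typed).  §7 (ed.3.1, same session; + imports `…Theorems.BalabanUVNodesN18CornerBandOfKernelLetters`,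
`Literature.….T4BetaStationary`) is the LETTER-COLLAPSE: modulo node U2∕U3's history letters `HistLipschitz` + `FadingMemory` (two of U3ᴷ's three) rows (i) and (C) hold at EVERY small window
relative to the corner numbers (dag-n18-w1's band + `betaContH_of_histLipschitz` BY NAME), so `RunRowsShape β` ⟺ «some window carries (iv)» (T10); 2ᶜᴰ ALONE buys the rows (T11, no
(190)-chain stub, no N17); K-keyed U3ᴷ + 2ᶜᴰ ⟹ the ∀θ rows programme (T12) and {K1⁷ (aside, stmt-20542), U3ᴷ, 2ᶜᴰ} ⟹ K1⁸ BY NAME (T13 `k1R8_of_k1R7_u3K_cornerDriftPos`) — an4 INTENT-4's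
bridge with 1ᶜᴿ replaced by K3⁷'s letters; T14: on letter tuples `0 < s` ⟹ ROWS ⟹ END ⟹ `0 ≤ s`, so K1⁸'s displayed rows cost beyond END at most the boundary `{s = 0}`, and §6's
(C)-surplus is exactly the non-letter part.
§8 (ed.3.2, same session; NO new imports; insert-only over ed.3.1 7a8ba3b4ca6ea07e ∕ commit e21c2aae581f): (8a) T15 `cont13All_of_histLipschitzAll13` — the U2∕U3 history-Lipschitz
letter at every provisos-admissible tuple ⟹ plan g84's ∀θ letter `Cont13All` (text verbatim; v7ᴿ's `stubCont13_of_cont13All` then gives `stub_cont13`), so of v7ᴿ's three registered stubs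
the (C)-stub is LETTER-COVERED; (8b) TOY D `betaOsc` (`β_{k+1}(g_0,…,g_k) = g_k·sin(π log g_k)`): ALL THREE U3 letters (N17 rate `c = 0`, moduli `5·δ_{ik}` fading at rate 1∕2), anchor
`b ≡ 0`, drift slope `s = 0`, AND END (`endpointExistence_betaOsc`: backward shooting below the zeros `e^{−n}` by the intermediate value theorem) — and NO rows (`not_runRowsShape_betaOsc`:
in every window the forward run from the top of a deep negative band accumulates `Σ β < −M`): the card's cheapest falsifier F0(a) RUN IN-LEAN with outcome «on letter tuples (iv) is NOT
implied by END» (`not_rows_of_letters_end`); T14's boundary `{s = 0}` carries END ∧ rows (TOY A), ¬END (TOY B) and END ∧ ¬rows (TOY D), so T11's `0 < s` cannot be weakened to `0 ≤ s`.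

§9 (ed.3.3, seat gen 12, planner-ym-nodeO-idea-7-g12-0, 2026-08-28; + imports `…Theorems.BalabanUVNodesK2CornerRoadRows` (PORT-1 p620216; brings DEF-1's `…K1R8RowsDefs`), `…Theorems.BalabanUVNodesK2V7Defs`;
insert-only over ed.3.2 2d7f7282d814dd7a ∕ commit fc427c33cd1f; answers CRIT-2 g3 ROUND-6 nits N-a∕N-b, CRIT-1 g6 O-1 and idea-5 g12 BN-N) — THE MEMORY-LETTER INVERSION: T11∕T13 read BACKWARDS
through U3ᴷ consume of `FadingMemory` only the k-uniform ROW SUM `Σ_i |Λ k i| ≤ L` and of N17's rate NOTHING (T10♭∕T11♭∕T12♭∕T13♭ over the re-cut U3ᴷ♭ = «moduli with bounded row sums»,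
`u3KFlat_of_u3K`, T13 = T13♭ ∘ it; T13♭ also keyed by the TREE names `K2V7Defs.CornerDriftPos` (N-a, `Iff.rfl`) and T15 for `K1R8RowsDefs.Cont13All` (N-b, `Iff.rfl`, proof = p620216's
`cont13All_of_histModuliK`)); ★★ `geomRigid_of_firstEntryOnly_scaleShiftRate`: modulo first-entry-only β, N17's `ScaleShiftRate c ρ γ` ALONE forces `|β_k(p) − β_k(q)| ≤ 2cρ^k` on the box
(it compares adjacent scales at INDEPENDENT arguments `w 0`, `w 1`) — N17's letter inherits idea-5's BN-N exactly as the fading pair does, so CRIT-1 O-1's U3ᴷ⁻ = {ScaleShiftRate,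
HistLipschitz} is no safer than U3ᴷ; TOY F `betaMT` (`1 + g_0²∕(1+kg_0²)`, the marginal-transport factor as a β): U3ᴷ♭ + anchor `1` + drift slope `1` + (C) + ROWS (by T11♭) + END, and
NEITHER `ScaleShiftRate c ρ γ` (any `c`, `ρ < 1`) NOR fading-compatible moduli (T17 `recut_inhabited_rateLetters_fail`, T17′); TOY E `betaSq` (`1 + (k+1)²g_0`): `HistLipschitz` (row sums
unbounded) + anchor + drift + (C) and NO rows (explicit in-window runs from `1∕(k+1)`, `1∕(k+1)²` read `k+2` and `2` at level `k`) — the row-sum letter is LOAD-BEARING in T11♭ (T18, T18′).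

HONEST FRAMING.  Elementary real analysis + the tree's hypothesis-form roads (p599976, p609637) BY NAME; NOTHING of Bałaban's analysis is asserted or discharged; U3ᴷ and
2ᶜᴰ are HYPOTHESIS SHAPES inhabited at no θ here; no stub of any skeleton is proved; K2⁷ (20543) `aside` ∕ not closed, K1⁸ (26907) and K3⁷ ∕ NODE O NOT proved; counts unmoved.  [Balaban1987RG1] Thm 2
(CMP 109, p.259, first sentence) and (0.31) p.259 are UNPROVED IN PRINT; route R4 (`route-QuantumFields-BalabanUVNodes`) closes ONLY the CONDITIONAL finite-𝕋⁴ rung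
`BalabanLadder.UV` — NOT the continuum limit, NOT ℝ⁴, NOT OS, NOT the Yang–Mills mass gap; the Clay problem is NOT proved by any of this.
EDITION 3.4 (g12, same day) — §9c ATTRIBUTION + §10 THE MASS-BAND ROAD READ BACKWARDS.  (§9c) §9(a)'s re-cut letter U3ᴷ♭ and T11♭–T13♭ are, respectively, CRIT-2 g3's
located repair R-BM (HOME STATUS S.2003) and crux-workfile twins of PORT-1 g3's p622247 `…Theorems.BalabanUVNodesK2CornerRoadRowsMassBand` (landed before ed.3.3): `U3LiteK` (PORT-1's
text verbatim), `u3KFlat_iff_u3LiteK`, `k1R8_of_k1R7_u3LiteK_cornerDriftPosInline` (PORT-1's ★ as a TYPE, proved by §9's chain) certify the identity; §9b's rate-letter sentence is on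
record in prose (CRIT-2 S.2003 E-CRIT2-2, CRIT-1 S.2022 (1)); this file's own §9 content = the generic Lean certificates + TOY E∕F + T10♭.  (§10, the inversion lens on the live road,
N17-FREE and MASS-FREE) `deepRun_exists` (forward runs below any `δ` to any level, from per-scale upper bounds on the boxes); T8♭ ★★ `cornerFloor_of_histLipschitz_runwiseFloor`:
history moduli + an anchor `b` + K1⁸'s row (iv) at ANY window ⟹ `∀ k ≤ n, −M ≤ Σ_{[k,n)} b_j` (the corner sequence itself is floored; McShane supplies the anchor:
`cornerFloor_of_histLipschitz_runwiseFloor'`); T9♭ `lim_nonneg_of_windowFloor` ∕ `lim_nonneg_of_histLipschitz_anchor_runwiseFloor` ∕ `limJs_nonneg_of_histLipschitz_anchorJets_runwiseFloor`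
(a convergent anchor — e.g. `θ.cβ·beta0OfJs F κ`, convergent hypothesis-free — has limit `≥ 0`: ed.2∕ed.6's sign necessity WITHOUT N17 on the β side); T9♭ʳ `cornerFloor_at_witness_of_K1R8` ∕ T9♭ʳⱽ `cornerFloor_at_witness_of_K1R9`
(K1⁸, resp. the rev-28∕29 deciding crux K1⁹ stmt-QuantumFields-27364, BY NAME floors every anchoring sequence at its witness, given only moduli there); T14♭ `massBand_bracket` («drift `s > 0` ⟹ rows ⟹ floor on `b` ⟸ drift `s ≥ 0`») with
`massBand_seam_undecided` (TOY A with rows ∕ TOY D with END and no rows, both U3ᴷ-lite and anchored at `0`).  0 sorry · 0 new axioms; nothing of Bałaban asserted; Clay NOT proved.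
Sources (context only): [I] = Balaban1987RG1: (0.17)–(0.20) pp.255–256, Thm 2 p.259, (1.3) p.260, (1.20)–(1.22) p.264, (2.12)–(2.14) p.268, (5.10) p.293.
-/
noncomputable section

namespace Summit.QuantumFields.YangMills.Cruxes.EndpointGivenBR13SepCoPH.Idea7V7cCornerNecessity

open Filter Topology Finset
open Literature.MathematicalPhysics.QuantumFieldTheory.Balaban1983to89
open Literature.MathematicalPhysics.QuantumFieldTheory.Balaban1983to89.FlowStep
open Literature.MathematicalPhysics.QuantumFieldTheory.Balaban1983to89.DagBinding (EndpointExistence ForwardGenerated)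
open Literature.MathematicalPhysics.QuantumFieldTheory.Balaban1983to89.T4Continuum (T4Family)
open Literature.MathematicalPhysics.QuantumFieldTheory.Balaban1983to89.T4CouplingMatching (ScaleShiftRate HistLipschitz FadingMemory)
open Literature.MathematicalPhysics.QuantumFieldTheory.Balaban1983to89.Beta.Drift (OneLoopDrift)
open Literature.MathematicalPhysics.QuantumFieldTheory.Balaban1983to89.B12Beta (HistBox)
open Summit.QuantumFields.YangMills.Theorems.BalabanUVNodesK2NamedJetsRemAt (ScaleAnchor ConstRemainder)
open Summit.QuantumFields.YangMills.Theorems.BalabanUVNodesK2V6Defs (Window13)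
open Summit.QuantumFields.YangMills.Theorems.BalabanUVNodesK2CornerRoad (tendsto_of_scaleShiftRate_scaleAnchor constRemainder_of_scaleShiftRate_scaleAnchor
  oneLoopDrift_of_geometric tendsto_of_scaleAnchor_drift)
open Summit.QuantumFields.YangMills.Theorems.BalabanUVNodesK2CornerRoadSign (exists_scaleAnchor_of_histLipschitz)

/-! ## §1 Generic (β : HBeta, b : ℕ → ℝ): the sign-free drift of the corner values, the slope IS the corner limit, NECESSITY — END forces `0 ≤ b_∞`, `0 ≤ s` -/

section Generic

variable {β : HBeta} {b : ℕ → ℝ}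

/-- **T0 (THE FREE PART)**: N17 + an anchor ⟹ the corner values DRIFT at their limit slope with SOME bounded deviation — no sign needed (geometric convergence
`|b_k − b_∞| ≤ c∕(1−ρ)·ρ^k`, p599976, summed: `oneLoopDrift_of_geometric`).  So of 2ᶜᴰ's three conjuncts only `0 < s` is not manufactured by K3-type letters. [folklore] -/
theorem anchoredDrift_of_scaleShiftRate_scaleAnchor {c ρ γ : ℝ} (hγ : 0 < γ) (hρ0 : 0 ≤ ρ) (hρ1 : ρ < 1)
    (h : ScaleShiftRate c ρ γ β) (hb : ScaleAnchor β b) :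
    ∃ s A : ℝ, Tendsto b atTop (𝓝 s) ∧ OneLoopDrift s A b := by
  have hc : 0 ≤ c := T4BetaStationary.constant_nonneg_of_scaleShiftRate h hγ
  obtain ⟨binf, hlim, hrate⟩ := tendsto_of_scaleShiftRate_scaleAnchor hγ hρ1 hb h
  have hC : 0 ≤ c / (1 - ρ) := div_nonneg hc (by linarith)
  exact ⟨binf, c / (1 - ρ) * (1 - ρ)⁻¹, hlim, oneLoopDrift_of_geometric hρ0 hρ1 hC hrate⟩

/-- **THE SLOPE IS THE CORNER LIMIT**: N17 + anchor + a drift at slope `s` ⟹ `b_k → s` (p599976's Cesàro junction at `cβ := 1`). [folklore] -/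
theorem tendsto_slope_of_scaleShiftRate_scaleAnchor_drift {c ρ γ s A : ℝ} (hγ : 0 < γ) (hρ1 : ρ < 1)
    (h : ScaleShiftRate c ρ γ β) (hb : ScaleAnchor β b) (hdrift : OneLoopDrift s A b) : Tendsto b atTop (𝓝 s) := by
  have hb1 : ScaleAnchor β (fun k => (1 : ℝ) * b k) := by simpa only [one_mul] using hb
  exact tendsto_of_scaleAnchor_drift hγ hρ1 h one_pos hb1 hdrift

/-! ### Necessity: an eventually negative β refutes END; END ⟹ `0 ≤ b_∞` ⟹ `0 ≤ s` (ported from the ed.4 sketch §«INVERSION» :748–:822, re-based on DEF-1's `ScaleAnchor`) -/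

/-- HYPOTHESIS SHAPE — β EVENTUALLY NEGATIVE on small boxes: `β_k ≤ −e` (`e > 0`) on `]0,γ']^{k+1}` for `k ≥ k₁`, some `0 < γ' ≤ γ`. [folklore] -/
def EventualNegOnBoxes (γ : ℝ) (β : HBeta) : Prop :=
  ∃ e : ℝ, 0 < e ∧ ∃ k₁ : ℕ, ∃ γ' : ℝ, 0 < γ' ∧ γ' ≤ γ ∧ ∀ k, k₁ ≤ k → ∀ v ∈ Box γ' k, β k v ≤ -e

/-- ONE RUN: along an in-interval run of a forward-generated construction whose β is `≤ −e` (`0 ≤ e`) on the boxes from depth `k₁` on,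
`1/g²_{k₁} + n·e ≤ 1/g²_{k₁+n}` — (0.20) solved forward. [cite: Balaban1987RG1, (0.20) p.256] -/
theorem inv_sq_growth_of_neg {Cn : B12.Construction} (hgen : ForwardGenerated Cn β) {γ' e : ℝ} (he : 0 ≤ e) {k₁ : ℕ}
    (hN : ∀ k, k₁ ≤ k → ∀ v ∈ Box γ' k, β k v ≤ -e) (P : B12.RunParams) (hI : (Cn P).flow.InInterval γ' P.K) :
    ∀ n, k₁ + n ≤ P.K → 1 / ((Cn P).flow.g k₁) ^ 2 + n * e ≤ 1 / ((Cn P).flow.g (k₁ + n)) ^ 2 := by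
  intro n
  induction n with
  | zero => intro; simp
  | succ n ih =>
    intro hn
    have hk : k₁ + n < P.K := by omega
    have hposAll : ∀ i, i ≤ k₁ + n → 0 < (Cn P).flow.g i := fun i hi => (hI i (by omega)).1
    have hmem : prefixOf (Cn P).flow.g (k₁ + n) ∈ Box γ' (k₁ + n) :=
      mem_box.mpr fun i => by
        have hi := i.2
        exact hI i (by omega)
    have hβ := hN (k₁ + n) (by omega) _ hmem
    have hsq : 0 < 1 / ((Cn P).flow.g (k₁ + n)) ^ 2 := by
      have := hposAll (k₁ + n) le_rfl
      positivity
    have hrhs : 0 < 1 / ((Cn P).flow.g (k₁ + n)) ^ 2 - β (k₁ + n) (prefixOf (Cn P).flow.g (k₁ + n)) := by linarith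
    obtain ⟨-, heq⟩ := hgen.2 P (k₁ + n) hk hposAll hrhs
    have ih' := ih (by omega)
    have e1 : k₁ + (n + 1) = k₁ + n + 1 := by omega
    rw [e1]
    push_cast
    linarith

/-- **AN EVENTUALLY NEGATIVE β REFUTES END** for every forward-generated construction (letter-free). [cite: Balaban1987RG1, (0.17)-(0.20) pp.255-256] -/
theorem not_endpointExistence_of_eventualNeg {Cn : B12.Construction} (hgen : ForwardGenerated Cn β) {γ : ℝ}
    (hneg : EventualNegOnBoxes γ β) : ¬ EndpointExistence Cn := by
  intro hE
  obtain ⟨e, he, k₁, γ', hγ', -, hN⟩ := hneg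
  obtain ⟨γ₂, hγ₂, hE2⟩ := hE 0
  have hγ₀ : 0 < min γ₂ γ' := lt_min hγ₂ hγ'
  obtain ⟨gstar, hgstar, hE3⟩ := hE2 (min γ₂ γ') hγ₀ (min_le_left _ _)
  obtain ⟨N, hNgt⟩ := exists_nat_gt (1 / gstar ^ 2 / e)
  obtain ⟨g0, hI, hK⟩ := hE3 gstar hgstar le_rfl (k₁ + N)
  have hI' : (Cn ⟨k₁ + N, 0, g0⟩).flow.InInterval γ' (k₁ + N) :=
    fun i hi => ⟨(hI i hi).1, (hI i hi).2.trans (min_le_right _ _)⟩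
  have hgrow := inv_sq_growth_of_neg hgen he.le hN ⟨k₁ + N, 0, g0⟩ hI' N le_rfl
  have hKe : (Cn ⟨k₁ + N, 0, g0⟩).flow.g (k₁ + N) = gstar := hK
  rw [hKe] at hgrow
  have h1 : 0 < 1 / ((Cn ⟨k₁ + N, 0, g0⟩).flow.g k₁) ^ 2 := by
    have := (hI k₁ (by omega)).1
    positivity
  have h2 : 1 / gstar ^ 2 < N * e := (div_lt_iff₀ he).mp hNgt
  linarith

/-- N17 + an anchoring sequence `b → b_∞ < 0` ⟹ β is EVENTUALLY NEGATIVE on small boxes (constant remainder at height `−b_∞∕3` on some `]0,γ_s]`, p599976's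
`constRemainder_of_scaleShiftRate_scaleAnchor`, plus the geometric rate). [folklore] -/
theorem eventualNeg_of_scaleAnchor_lim_neg {c ρ γ binf : ℝ} (hγ : 0 < γ) (hρ0 : 0 ≤ ρ) (hρ1 : ρ < 1)
    (h : ScaleShiftRate c ρ γ β) (hb : ScaleAnchor β b) (hlim : Tendsto b atTop (𝓝 binf)) (hneg : binf < 0) :
    EventualNegOnBoxes γ β := by
  obtain ⟨binf', hlim', hrate⟩ := tendsto_of_scaleShiftRate_scaleAnchor hγ hρ1 hb h
  have hbb : binf' = binf := tendsto_nhds_unique hlim' hlim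
  subst hbb
  have hs : 0 < -binf' / 3 := by linarith
  obtain ⟨γs, hγs, hγsle, hrem⟩ := constRemainder_of_scaleShiftRate_scaleAnchor hγ hρ0 hρ1 hb h hs
  have htail : Tendsto (fun k : ℕ => c / (1 - ρ) * ρ ^ k) atTop (𝓝 0) := by
    simpa using (tendsto_pow_atTop_nhds_zero_of_lt_one hρ0 hρ1).const_mul (c / (1 - ρ))
  obtain ⟨k₁, hk₁⟩ := Filter.eventually_atTop.mp (htail.eventually (eventually_le_nhds hs))
  refine ⟨-binf' / 3, hs, k₁, γs, hγs, hγsle, fun k hk v hv => ?_⟩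
  have hv' : v ∈ HistBox γs k := by rw [histBox_eq_box]; exact hv
  have e1 := (abs_sub_le_iff.mp (hrem k v hv')).1
  have e2 := (abs_sub_le_iff.mp ((hrate k).trans (hk₁ k hk))).1
  linarith

/-- **NECESSITY — END FORCES `0 ≤ b_∞`** for every construction forward-generated by a β with N17 and an anchoring corner sequence `b → b_∞`.
[cite: Balaban1987RG1, (0.17)-(0.20) pp.255-256 and (2.13)-(2.14) p.268] -/
theorem cornerLim_nonneg_of_endpointExistence {Cn : B12.Construction} (hgen : ForwardGenerated Cn β) {c ρ γ binf : ℝ}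
    (hγ : 0 < γ) (hρ0 : 0 ≤ ρ) (hρ1 : ρ < 1) (h : ScaleShiftRate c ρ γ β) (hb : ScaleAnchor β b)
    (hlim : Tendsto b atTop (𝓝 binf)) (hE : EndpointExistence Cn) : 0 ≤ binf := by
  by_contra hneg
  exact not_endpointExistence_of_eventualNeg hgen (eventualNeg_of_scaleAnchor_lim_neg hγ hρ0 hρ1 h hb hlim (not_le.mp hneg)) hE

/-- **… and END FORCES `0 ≤ s` for every drift slope `s` of the anchoring corner sequence** (the slope is the limit).  2ᶜᴰ's `0 < s` exceeds what K2⁷'s conclusion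
forces by the boundary `s = 0` only. [cite: Balaban1987RG1, (0.17)-(0.20) pp.255-256 and (1.3) p.260] -/
theorem slope_nonneg_of_endpointExistence {Cn : B12.Construction} (hgen : ForwardGenerated Cn β) {c ρ γ s A : ℝ}
    (hγ : 0 < γ) (hρ0 : 0 ≤ ρ) (hρ1 : ρ < 1) (h : ScaleShiftRate c ρ γ β) (hb : ScaleAnchor β b)
    (hdrift : OneLoopDrift s A b) (hE : EndpointExistence Cn) : 0 ≤ s :=
  cornerLim_nonneg_of_endpointExistence hgen hγ hρ0 hρ1 h hb (tendsto_slope_of_scaleShiftRate_scaleAnchor_drift hγ hρ1 h hb hdrift) hE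

end Generic

/-! ## §2 At NODE 00's Stage-13 record (`N = 2`): the texts (VERBATIM) and the necessity junctions T0, T5–T7 -/

section Record

/-- HYPOTHESIS SHAPE U3ᴷ — K3⁷-TYPE END-FREE LETTERS on the datum's β at every tuple of the crux's prefix: N17 `ScaleShiftRate c ρ θ.γ` (`0 ≤ c`, `0 < ρ < 1`), the
history moduli `HistLipschitz Λ θ.γ`, `FadingMemory C ρ Λ` — the `hU3` text of p609637 `EndpointGivenBR13SepCoPH_of_u3K_cornerSignK` VERBATIM.  Never a fact. [folklore] -/
def U3K : Prop :=
  ∀ (F : T4Family) (θ : Node00.Stage13HParams F 2) (hP : θ.Provisos₁₃SepCoPH F 2), (θ.ZhUnity F 2 ∧ θ.SlotsNondegenerate₁₃ F 2) → θ.Admissible F 2 →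
    B16.EndStatementBPrinted (Node00.datumOfRecord₁₃SepCoPH F 2 θ hP).C → Window13 F θ hP →
    ∃ (c C ρ : ℝ) (Λ : ℕ → ℕ → ℝ), 0 ≤ c ∧ 0 < ρ ∧ ρ < 1 ∧ ScaleShiftRate c ρ θ.γ (Node00.datumOfRecord₁₃SepCoPH F 2 θ hP).βfun ∧
      HistLipschitz Λ θ.γ (Node00.datumOfRecord₁₃SepCoPH F 2 θ hP).βfun ∧ FadingMemory C ρ Λ

/-- **THE REGISTERED STUB 2ᶜᴰ's TEXT — the body of `…Theses.BalabanUVNodes.K2Skeleton13SepCoPH.CornerDriftPos` (skeleton v7c REGISTERED 795c9e8285fed415 :542; = draft 39189bf31904f7f3 :535) VERBATIM** (the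
skeleton lives in the plan's pub folder and is not importable here; a port replaces this def by the registered name).  Never a fact.
[cite: Balaban1987RG1, (1.3) p.260, (1.22) p.264 and (2.12)-(2.13) p.268] -/
def CornerDriftPos : Prop :=
  ∀ (F : T4Family) (θ : Node00.Stage13HParams F 2) (hP : θ.Provisos₁₃SepCoPH F 2), (θ.ZhUnity F 2 ∧ θ.SlotsNondegenerate₁₃ F 2) → θ.Admissible F 2 →
    B16.EndStatementBPrinted (Node00.datumOfRecord₁₃SepCoPH F 2 θ hP).C → Window13 F θ hP →
    ∃ (b : ℕ → ℝ) (s A : ℝ), ScaleAnchor (Node00.datumOfRecord₁₃SepCoPH F 2 θ hP).βfun b ∧ 0 < s ∧ OneLoopDrift s A b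

/-- 2ᶜᴰ WITH THE ANCHOR-AND-DRIFT PART ONLY, the slope NAMED as the corner limit (sign free).  Never a fact. [folklore] -/
def CornerAnchoredDrift : Prop :=
  ∀ (F : T4Family) (θ : Node00.Stage13HParams F 2) (hP : θ.Provisos₁₃SepCoPH F 2), (θ.ZhUnity F 2 ∧ θ.SlotsNondegenerate₁₃ F 2) → θ.Admissible F 2 →
    B16.EndStatementBPrinted (Node00.datumOfRecord₁₃SepCoPH F 2 θ hP).C → Window13 F θ hP →
    ∃ (b : ℕ → ℝ) (s A : ℝ), ScaleAnchor (Node00.datumOfRecord₁₃SepCoPH F 2 θ hP).βfun b ∧ Tendsto b atTop (𝓝 s) ∧ OneLoopDrift s A b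

/-- **2ᶜᴰ's TEXT WITH `0 < s` RELAXED TO `0 ≤ s`, UNDER K2⁷'s OWN CONSEQUENT** `EndpointExistence D.C.toB12` as an extra antecedent — the necessity shape T7 inhabits from U3ᴷ.
Never a fact. [folklore] -/
def CornerDriftNonnegGivenEnd : Prop :=
  ∀ (F : T4Family) (θ : Node00.Stage13HParams F 2) (hP : θ.Provisos₁₃SepCoPH F 2), (θ.ZhUnity F 2 ∧ θ.SlotsNondegenerate₁₃ F 2) → θ.Admissible F 2 →
    B16.EndStatementBPrinted (Node00.datumOfRecord₁₃SepCoPH F 2 θ hP).C → Window13 F θ hP →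
    EndpointExistence (Node00.datumOfRecord₁₃SepCoPH F 2 θ hP).C.toB12 →
    ∃ (b : ℕ → ℝ) (s A : ℝ), ScaleAnchor (Node00.datumOfRecord₁₃SepCoPH F 2 θ hP).βfun b ∧ 0 ≤ s ∧ OneLoopDrift s A b

/-- NECESSITY SHAPE (limit form): at a prefixed tuple, K2⁷'s CONSEQUENT forces the NON-STRICT sign of the limit of every anchoring corner sequence. Never a fact. [folklore] -/
def CornerLimNonnegGivenEnd : Prop :=
  ∀ (F : T4Family) (θ : Node00.Stage13HParams F 2) (hP : θ.Provisos₁₃SepCoPH F 2), (θ.ZhUnity F 2 ∧ θ.SlotsNondegenerate₁₃ F 2) → θ.Admissible F 2 →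
    B16.EndStatementBPrinted (Node00.datumOfRecord₁₃SepCoPH F 2 θ hP).C → Window13 F θ hP →
    EndpointExistence (Node00.datumOfRecord₁₃SepCoPH F 2 θ hP).C.toB12 →
    ∀ b : ℕ → ℝ, ScaleAnchor (Node00.datumOfRecord₁₃SepCoPH F 2 θ hP).βfun b → ∀ binf : ℝ, Tendsto b atTop (𝓝 binf) → 0 ≤ binf

/-- NECESSITY SHAPE (slope form): at a prefixed tuple, K2⁷'s CONSEQUENT forces `0 ≤ s` for EVERY drift slope `s` of an anchoring corner sequence — 1ᶜᴿ's antecedent triple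
`(ScaleAnchor, 0 < s, OneLoopDrift s A b)` minus its strictness is END-necessary. Never a fact. [folklore] -/
def SlopeNonnegGivenEnd : Prop :=
  ∀ (F : T4Family) (θ : Node00.Stage13HParams F 2) (hP : θ.Provisos₁₃SepCoPH F 2), (θ.ZhUnity F 2 ∧ θ.SlotsNondegenerate₁₃ F 2) → θ.Admissible F 2 →
    B16.EndStatementBPrinted (Node00.datumOfRecord₁₃SepCoPH F 2 θ hP).C → Window13 F θ hP →
    EndpointExistence (Node00.datumOfRecord₁₃SepCoPH F 2 θ hP).C.toB12 →
    ∀ (b : ℕ → ℝ) (s A : ℝ), ScaleAnchor (Node00.datumOfRecord₁₃SepCoPH F 2 θ hP).βfun b → OneLoopDrift s A b → 0 ≤ s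

/-- **T0 — 2ᶜᴰ's ANCHOR-AND-DRIFT PART IS FREE FROM U3ᴷ, sign and END aside** (corner values by McShane from the moduli, p609637 `exists_scaleAnchor_of_histLipschitz`; drift at
the limit slope from N17, §1).  CONDITIONAL on U3ᴷ; nothing of Bałaban asserted. [cite: Balaban1987RG1, (1.20)-(1.22) p.264 and (2.13) p.268] -/
theorem cornerAnchoredDrift_of_u3K (hU3 : U3K) : CornerAnchoredDrift := by
  intro F θ hP hU hθ hB hwin
  obtain ⟨c, -, ρ, Λ, -, hρ0, hρ1, hss, hL, -⟩ := hU3 F θ hP hU hθ hB hwin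
  have hγ : 0 < θ.γ := hθ.toStage12.toStage9.gamma_pos
  obtain ⟨b, hb⟩ := exists_scaleAnchor_of_histLipschitz hγ hL
  obtain ⟨s, A, hlim, hdrift⟩ := anchoredDrift_of_scaleShiftRate_scaleAnchor hγ hρ0.le hρ1 hss hb
  exact ⟨b, s, A, hb, hlim, hdrift⟩

/-- The trivial direction of the sandwich: 2ᶜᴰ ⟹ its `0 ≤ s` relaxation (END unused). [folklore] -/
theorem cornerDriftNonnegGivenEnd_of_cornerDriftPos (h2 : CornerDriftPos) : CornerDriftNonnegGivenEnd := by
  intro F θ hP hU hθ hB hwin _hE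
  obtain ⟨b, s, A, hb, hs, hdrift⟩ := h2 F θ hP hU hθ hB hwin
  exact ⟨b, s, A, hb, hs.le, hdrift⟩

/-- **T5 ★★ — THE INVERSION AT THE RECORD (limit form): modulo U3ᴷ's N17 letter, K2⁷'s CONSEQUENT forces `0 ≤ b_∞` for every anchoring corner sequence** (the datum is
forward-generated by its β: `(datumOfRecord₁₃SepCoPH …).fwd`).  CONDITIONAL; nothing of Bałaban asserted. [cite: Balaban1987RG1, (0.17)-(0.20) pp.255-256 and (2.13)-(2.14) p.268] -/
theorem cornerLimNonnegGivenEnd_of_u3K (hU3 : U3K) : CornerLimNonnegGivenEnd := by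
  intro F θ hP hU hθ hB hwin hE b hb binf hlim
  obtain ⟨c, -, ρ, Λ, -, hρ0, hρ1, hss, -, -⟩ := hU3 F θ hP hU hθ hB hwin
  exact cornerLim_nonneg_of_endpointExistence (Node00.datumOfRecord₁₃SepCoPH F 2 θ hP).fwd hθ.toStage12.toStage9.gamma_pos hρ0.le hρ1 hss hb hlim hE

/-- **T6 — slope form: modulo U3ᴷ's N17 letter, K2⁷'s CONSEQUENT forces `0 ≤ s` for every drift slope of an anchoring corner sequence.**  CONDITIONAL.
[cite: Balaban1987RG1, (0.17)-(0.20) pp.255-256 and (1.3) p.260] -/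
theorem slopeNonnegGivenEnd_of_u3K (hU3 : U3K) : SlopeNonnegGivenEnd := by
  intro F θ hP hU hθ hB hwin hE b s A hb hdrift
  obtain ⟨c, -, ρ, Λ, -, hρ0, hρ1, hss, -, -⟩ := hU3 F θ hP hU hθ hB hwin
  exact slope_nonneg_of_endpointExistence (Node00.datumOfRecord₁₃SepCoPH F 2 θ hP).fwd hθ.toStage12.toStage9.gamma_pos hρ0.le hρ1 hss hb hdrift hE

/-- **T7 ★★ — K2⁷'s OWN CONSEQUENT + U3ᴷ ⟹ THE REGISTERED 2ᶜᴰ WITH `0 < s` RELAXED TO `0 ≤ s`**: existence of the anchored drifting corner sequence is letter-made (T0), the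
non-strict sign is END-made (T6).  With PORT-1's sufficiency (U3ᴷ → 2ᶜᴰ → K2⁷, INTENT-3) this brackets the registered stub: modulo U3ᴷ its END-surplus is EXACTLY the
strictness `0 < s` vs `0 ≤ s` — the boundary §3 shows END cannot pay.  CONDITIONAL on U3ᴷ; no stub proved; K2⁷ NOT closed; nothing of Bałaban asserted.
[cite: Balaban1987RG1, (0.17)-(0.20) pp.255-256, (1.3) p.260, (1.20)-(1.22) p.264 and (2.12)-(2.13) p.268] -/
theorem cornerDriftNonnegGivenEnd_of_u3K (hU3 : U3K) : CornerDriftNonnegGivenEnd := by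
  intro F θ hP hU hθ hB hwin hE
  obtain ⟨b, s, A, hb, -, hdrift⟩ := cornerAnchoredDrift_of_u3K hU3 F θ hP hU hθ hB hwin
  exact ⟨b, s, A, hb, slopeNonnegGivenEnd_of_u3K hU3 F θ hP hU hθ hB hwin hE b s A hb hdrift, hdrift⟩

end Record

/-! ## §3 The boundary `{b_∞ = 0}` is inhabited WITH END (TOY A, β ≡ 0): `0 ≤ s` in T6 ∕ T7 cannot be sharpened to 2ᶜᴰ's `0 < s` from END + the letters alone -/

section Boundary

/-- TOY A: β ≡ 0. [folklore] -/
def betaZero : HBeta := fun _ _ => 0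

/-- TOY A carries N17 (`c = 0`), the moduli (`Λ ≡ 0`), `FadingMemory`, is ANCHORED to the zero sequence, DRIFTS at slope `0` with deviation `0`, and HAS END (the tree's
`FlowStepRuns.endpointExistence_modelOf` with `β' = 0`, constant runs): every hypothesis of T6 ∕ T7 holds with `s = 0` AND END.  (TOY B `β_k = −g_k`, ed.4 sketch :952, carries the same
letters with `b_∞ = 0` and NO END.) [folklore] -/
theorem boundary_inhabited_with_end (γ : ℝ) :
    ScaleShiftRate 0 (1 / 2) γ betaZero ∧ HistLipschitz (fun _ _ => 0) γ betaZero ∧ FadingMemory 0 (1 / 2) (fun _ _ => 0) ∧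
      ScaleAnchor betaZero (fun _ => 0) ∧ OneLoopDrift 0 0 (fun _ => (0 : ℝ)) ∧ EndpointExistence (FlowStepRuns.modelOf betaZero) := by
  refine ⟨fun k w _ => by simp [betaZero], fun k p q _ _ => by simp [betaZero], fun k i _ => by simp,
    fun k δ hδ => ⟨1, one_pos, fun p _ => by simp [betaZero, hδ.le]⟩, fun k => by simp, ?_⟩
  exact FlowStepRuns.endpointExistence_modelOf betaZero one_pos le_rfl (fun _ => continuousOn_const) (fun _ _ _ => le_rfl)
    (fun _ _ _ => le_rfl)

end Boundary

/-! ## §4 (EDITION 2) TOY B in-file: the gaps cell's `betaN` carries every U3 letter, the anchor `b ≡ 0` and the drift at slope `0`, and has NO END — with §3 the boundary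
`{b_∞ = 0}` is undecided by the letters -/

section BoundaryB

open Summit.QuantumFields.BalabanUV.Gaps.EndDrawdownEverySlope (betaN betaN_of_pos not_endpointExistence_betaN)

/-- The moduli of TOY B: only the last coupling matters, with weight `1`. [folklore] -/
def lambdaLast : ℕ → ℕ → ℝ := fun k i => if i = k then 1 else 0

/-- TOY B (`β_{k+1}(g_0,…,g_k) = −g_k` on the box; the gaps cell's `betaN`) carries N17 (`c = 0`), the moduli `lambdaLast` with `FadingMemory 1 (1∕2)`, is ANCHORED to the zero sequence,
DRIFTS at slope `0` with deviation `0` — every hypothesis of T6 ∕ T7 except END, with `s = 0` — and has NO END (`not_endpointExistence_betaN`: along a run `1∕g²_{k+1} = 1∕g²_k + g_k`, so no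
bare coupling reaches a fixed target at every cutoff). [folklore] -/
theorem boundary_inhabited_without_end (γ : ℝ) :
    ScaleShiftRate 0 (1 / 2) γ betaN ∧ HistLipschitz lambdaLast γ betaN ∧ FadingMemory 1 (1 / 2) lambdaLast ∧
      ScaleAnchor betaN (fun _ => 0) ∧ OneLoopDrift 0 0 (fun _ => (0 : ℝ)) ∧ ¬ EndpointExistence (FlowStepRuns.modelOf betaN) := by
  refine ⟨?_, ?_, ?_, ?_, fun k => by simp, not_endpointExistence_betaN⟩
  · intro k w hw
    have h1 : 0 < w (Fin.last (k + 1)) := ((FlowStep.mem_box.mp hw) (Fin.last (k + 1))).1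
    have h2 : Fin.tail w (Fin.last k) = w (Fin.last (k + 1)) := by
      simp only [Fin.tail, Fin.succ_last]
    have h1' : 0 < Fin.tail w (Fin.last k) := h2 ▸ h1
    rw [betaN_of_pos (k + 1) h1, betaN_of_pos k h1', h2]
    simp
  · intro k p q hp hq
    have hp1 : 0 < p (Fin.last k) := ((FlowStep.mem_box.mp hp) (Fin.last k)).1
    have hq1 : 0 < q (Fin.last k) := ((FlowStep.mem_box.mp hq) (Fin.last k)).1
    rw [betaN_of_pos k hp1, betaN_of_pos k hq1, Finset.sum_eq_single (Fin.last k)]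
    · have h : -(p (Fin.last k)) - -(q (Fin.last k)) = -(p (Fin.last k) - q (Fin.last k)) := by ring
      rw [h, abs_neg]
      simp [lambdaLast]
    · intro i _ hi
      have hne : (i : ℕ) ≠ k := fun h => hi (Fin.ext (by simp [h]))
      simp [lambdaLast, hne]
    · intro h
      exact absurd (Finset.mem_univ _) h
  · intro k i _
    by_cases h : i = k
    · subst h
      simp [lambdaLast]
    · refine ⟨by simp [lambdaLast, h], ?_⟩
      simp only [lambdaLast, h, if_false]
      positivity
  · intro k δ hδ
    refine ⟨δ, hδ, fun p hp => ?_⟩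
    have hp1 : 0 < p (Fin.last k) := (hp (Fin.last k)).1
    rw [betaN_of_pos k hp1]
    simpa [abs_of_pos hp1] using (hp (Fin.last k)).2

/-- **THE BOUNDARY IS UNDECIDED BY THE LETTERS (one file)**: two β's carrying every U3 letter, anchored to the SAME corner sequence `b ≡ 0` with the SAME drift `(s, A) = (0, 0)` — one WITH
END (TOY A, §3), one WITHOUT (TOY B).  So T6 ∕ T7's `0 ≤ s` is the most END can force from the letters, and 2ᶜᴰ's `0 < s` is the least that suffices (PORT-1 p613914): on `{s = 0}` the
content is 1ᶜᴿ's ∕ NODE O's, not the letters'.  Generic level; (B) is silent here (header, EDITION 2). [folklore] -/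
theorem boundary_undecided_by_letters (γ : ℝ) :
    (∃ β : HBeta, (∃ (c C ρ : ℝ) (Λ : ℕ → ℕ → ℝ), 0 ≤ c ∧ 0 < ρ ∧ ρ < 1 ∧ ScaleShiftRate c ρ γ β ∧ HistLipschitz Λ γ β ∧ FadingMemory C ρ Λ) ∧
        ScaleAnchor β (fun _ => 0) ∧ OneLoopDrift 0 0 (fun _ => (0 : ℝ)) ∧ EndpointExistence (FlowStepRuns.modelOf β)) ∧
      (∃ β : HBeta, (∃ (c C ρ : ℝ) (Λ : ℕ → ℕ → ℝ), 0 ≤ c ∧ 0 < ρ ∧ ρ < 1 ∧ ScaleShiftRate c ρ γ β ∧ HistLipschitz Λ γ β ∧ FadingMemory C ρ Λ) ∧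
        ScaleAnchor β (fun _ => 0) ∧ OneLoopDrift 0 0 (fun _ => (0 : ℝ)) ∧ ¬ EndpointExistence (FlowStepRuns.modelOf β)) := by
  obtain ⟨hA1, hA2, hA3, hA4, hA5, hA6⟩ := boundary_inhabited_with_end γ
  obtain ⟨hB1, hB2, hB3, hB4, hB5, hB6⟩ := boundary_inhabited_without_end γ
  exact ⟨⟨betaZero, ⟨0, 0, 1 / 2, fun _ _ => 0, le_rfl, by norm_num, by norm_num, hA1, hA2, hA3⟩, hA4, hA5, hA6⟩,
    ⟨betaN, ⟨0, 1, 1 / 2, lambdaLast, le_rfl, by norm_num, by norm_num, hB1, hB2, hB3⟩, hB4, hB5, hB6⟩⟩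

end BoundaryB

/-! ## §5 (EDITION 3 — route rev 26ᴿ∕27 RE-KEY) K2⁷ is `aside`; the DECIDING crux K1⁸ `StabilityBRunRowsAtRecordR13SepCoPH` (stmt-QuantumFields-26907, `Theses/BalabanUVNodes.lean` :296)
OWES THE RUN ROWS (i) ∕ (iv) ∕ (C) at its witness, and the born-closed K2⁸ `EndpointGivenRunRowsR13SepCoPH` (stmt-QuantumFields-26908, CLOSED by
`…Theorems.BalabanUVNodesK2R8Holds.endpointGivenRunRowsR13SepCoPH_holds`, itself node n24's END by name) turns them into END.  The inversion RE-KEYED: ROWS ⟹ END ⟹ `0 ≤ b_∞` for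
every anchoring corner sequence — now AT K1⁸'s WITNESS (T8 ∕ T9); and the boundary `{b_∞ = 0}` is undecided by the letters FOR THE ROWS as it was for END (TOY A has the rows,
TOY B has them not). -/

section RunRows

open Summit.QuantumFields.YangMills.Theorems.BalabanUVNodesK2NamedJetsRunRemAt (RunConstRemainder SurvCont Survivors)
open Summit.QuantumFields.YangMills.Theorems.BalabanUVNodesK1WindowKOfRunRowsSurvivors (endpointExistence_of_runConstRemainder_runwisePS_survCont)
open Summit.QuantumFields.YangMills.Theorems.BalabanUVNodesK2R8Holds (endpointGivenRunRowsR13SepCoPH_holds)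
open Summit.QuantumFields.BalabanUV.Gaps.EndDrawdownEverySlope (betaN not_endpointExistence_betaN)

variable {β : HBeta} {b : ℕ → ℝ}

/-- HYPOTHESIS SHAPE (never a fact): **THE RUN-ROWS CONJUNCT OF K1⁸ for a generic β** — the body of the last conjunct of `…Theses.BalabanUVNodes.StabilityBRunRowsAtRecordR13SepCoPH`
(:296; = the rows antecedent of K2⁸ :867) VERBATIM with `β` for `Node00.betaOfRecord₁₃ F 2 θ.toStage13Params`: SOME window `γ₀ > 0`, reference sequence `b`, radius `r` and floor `M`
with (i) the run-wise constant remainder, (iv) the run-wise partial-sum floor, (C) run-wise survivor continuity at level `γ₀`.  A predicate of `β` ALONE (it does not read the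
construction). [cite: Balaban1987RG1, Thm 3 p.264, (5.10) p.293 and section 1 pp.263-264] -/
def RunRowsShape (β : HBeta) : Prop :=
  ∃ (b : ℕ → ℝ) (r γ₀ M : ℝ), 0 < γ₀ ∧
    (∀ (n : ℕ) (gs : ℕ → ℝ), RGEqH n β gs → Step.InInterval γ₀ n gs → ∀ k, k ≤ n → |β k (prefixOf gs k) - b k| ≤ r) ∧
    (∀ (n : ℕ) (gs : ℕ → ℝ), RGEqH n β gs → Step.InInterval γ₀ n gs → ∀ k, k ≤ n → -M ≤ ∑ j ∈ Finset.Ico k n, β j (prefixOf gs j)) ∧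
    ∀ k : ℕ, ContinuousOn (fun x : ℝ => β k (clampPrefix β γ₀ k x)) {x : ℝ | 0 < x ∧ x ≤ γ₀ ∧ ∀ j, j ≤ k → 1 / γ₀ ^ 2 ≤ Y β γ₀ j x}

/-- The shape IS «∃ window: DEF-1's `RunConstRemainder` ∧ run-wise (PS) ∧ `SurvCont`» — definitionally (the route inlines the bodies; cf. plan g84 `Sketch26R.k2R8ItemText_iff`). [folklore] -/
theorem runRowsShape_iff (β : HBeta) :
    RunRowsShape β ↔ ∃ (b : ℕ → ℝ) (r γ₀ M : ℝ), 0 < γ₀ ∧ RunConstRemainder β b r γ₀ ∧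
      (∀ (n : ℕ) (gs : ℕ → ℝ), RGEqH n β gs → Step.InInterval γ₀ n gs → ∀ k, k ≤ n → -M ≤ ∑ j ∈ Finset.Ico k n, β j (prefixOf gs j)) ∧ SurvCont β γ₀ :=
  Iff.rfl

/-- ROWS ⟹ END for EVERY construction forward-generated by `β` — node n24's `BalabanUVNodesK1WindowKOfRunRowsSurvivors.endpointExistence_of_runConstRemainder_runwisePS_survCont` BY NAME
(the road behind K2⁸'s closer).  CONDITIONAL; nothing of Bałaban asserted. [cite: Balaban1987RG1, Thm 2 p.259 (first sentence) and Thm 3 p.264] -/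
theorem endpointExistence_of_runRowsShape {Cn : B12.Construction} (hgen : ForwardGenerated Cn β) (h : RunRowsShape β) : EndpointExistence Cn := by
  obtain ⟨b, r, γ₀, M, hγ₀, hrem, hps, hsc⟩ := h
  exact endpointExistence_of_runConstRemainder_runwisePS_survCont hgen hγ₀ hrem hps hsc

/-- **GENERIC NECESSITY BEHIND THE ROWS**: the run rows + N17 + an anchoring corner sequence `b → b_∞` ⟹ `0 ≤ b_∞` — §1's END-necessity read through the rows' END, at the CANONICAL
construction `modelOf β` (the rows are a property of `β` alone, so no construction needs to be named: `FlowStepRuns.modelOf_forwardGenerated`).  CONDITIONAL on hypothesis shapes.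
[cite: Balaban1987RG1, (0.17)-(0.20) pp.255-256 and (2.13)-(2.14) p.268] -/
theorem cornerLim_nonneg_of_runRowsShape {c ρ γ binf : ℝ} (hγ : 0 < γ) (hρ0 : 0 ≤ ρ) (hρ1 : ρ < 1) (h : ScaleShiftRate c ρ γ β) (hb : ScaleAnchor β b)
    (hlim : Tendsto b atTop (𝓝 binf)) (hrows : RunRowsShape β) : 0 ≤ binf :=
  cornerLim_nonneg_of_endpointExistence (FlowStepRuns.modelOf_forwardGenerated β) hγ hρ0 hρ1 h hb hlim
    (endpointExistence_of_runRowsShape (FlowStepRuns.modelOf_forwardGenerated β) hrows)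

/-- … slope form: the run rows + N17 + an anchoring corner sequence drifting at slope `s` ⟹ `0 ≤ s`. CONDITIONAL. [cite: Balaban1987RG1, (0.17)-(0.20) pp.255-256 and (1.3) p.260] -/
theorem slope_nonneg_of_runRowsShape {c ρ γ s A : ℝ} (hγ : 0 < γ) (hρ0 : 0 ≤ ρ) (hρ1 : ρ < 1) (h : ScaleShiftRate c ρ γ β) (hb : ScaleAnchor β b)
    (hdrift : OneLoopDrift s A b) (hrows : RunRowsShape β) : 0 ≤ s :=
  cornerLim_nonneg_of_runRowsShape hγ hρ0 hρ1 h hb (tendsto_slope_of_scaleShiftRate_scaleAnchor_drift hγ hρ1 h hb hdrift) hrows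

/-- **T8 ★★ — THE INVERSION RE-KEYED TO K1⁸'s ROWS (limit form)**: at a prefixed Stage-13 tuple carrying the window, K1⁸'s RUN-ROWS CONJUNCT (its text with the tuple's
`β_θ = Node00.betaOfRecord₁₃ F 2 θ.toStage13Params`, = K2⁸'s rows antecedent VERBATIM) + U3ᴷ's N17 letter force `0 ≤ b_∞` for EVERY corner sequence anchoring the datum's β —
K2⁸'s closer `endpointGivenRunRowsR13SepCoPH_holds` (stmt-26908, CLOSED) BY NAME, then T5.  CONDITIONAL on U3ᴷ; nothing of Bałaban asserted; K1⁸ NOT proved.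
[cite: Balaban1987RG1, Thm 2 p.259 (first sentence), (0.17)-(0.20) pp.255-256 and (2.13)-(2.14) p.268] -/
theorem cornerLimNonneg_of_runRows_u3K (hU3 : U3K) :
    ∀ (F : T4Family) (θ : Node00.Stage13HParams F 2) (hP : θ.Provisos₁₃SepCoPH F 2), (θ.ZhUnity F 2 ∧ θ.SlotsNondegenerate₁₃ F 2) → θ.Admissible F 2 →
      B16.EndStatementBPrinted (Node00.datumOfRecord₁₃SepCoPH F 2 θ hP).C → Window13 F θ hP →
      RunRowsShape (Node00.betaOfRecord₁₃ F 2 θ.toStage13Params) →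
      ∀ b : ℕ → ℝ, ScaleAnchor (Node00.datumOfRecord₁₃SepCoPH F 2 θ hP).βfun b → ∀ binf : ℝ, Tendsto b atTop (𝓝 binf) → 0 ≤ binf := by
  intro F θ hP hU hθ hB hwin hrows b hb binf hlim
  exact cornerLimNonnegGivenEnd_of_u3K hU3 F θ hP hU hθ hB hwin (endpointGivenRunRowsR13SepCoPH_holds F θ hP hU hθ hB hrows hwin) b hb binf hlim

/-- **T8′ — slope form**: at a prefixed tuple, K1⁸'s run rows + U3ᴷ force `0 ≤ s` for EVERY drift slope `s` of an anchoring corner sequence — i.e. 2ᶜᴰ with `0 < s` relaxed to `0 ≤ s`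
is ROWS-necessary mod U3ᴷ (T0 supplies the anchored drifting sequence).  CONDITIONAL on U3ᴷ; nothing of Bałaban asserted. [cite: Balaban1987RG1, (1.3) p.260 and (1.20)-(1.22) p.264] -/
theorem slopeNonneg_of_runRows_u3K (hU3 : U3K) :
    ∀ (F : T4Family) (θ : Node00.Stage13HParams F 2) (hP : θ.Provisos₁₃SepCoPH F 2), (θ.ZhUnity F 2 ∧ θ.SlotsNondegenerate₁₃ F 2) → θ.Admissible F 2 →
      B16.EndStatementBPrinted (Node00.datumOfRecord₁₃SepCoPH F 2 θ hP).C → Window13 F θ hP →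
      RunRowsShape (Node00.betaOfRecord₁₃ F 2 θ.toStage13Params) →
      ∀ (b : ℕ → ℝ) (s A : ℝ), ScaleAnchor (Node00.datumOfRecord₁₃SepCoPH F 2 θ hP).βfun b → OneLoopDrift s A b → 0 ≤ s := by
  intro F θ hP hU hθ hB hwin hrows b s A hb hdrift
  exact slopeNonnegGivenEnd_of_u3K hU3 F θ hP hU hθ hB hwin (endpointGivenRunRowsR13SepCoPH_holds F θ hP hU hθ hB hrows hwin) b s A hb hdrift

/-- **T9 ★★ — AT K1⁸'s WITNESS**: K1⁸ (`StabilityBRunRowsAtRecordR13SepCoPH`, the ∃-form deciding crux) + U3ᴷ ⟹ every family with an inhabited prefix has a WITNESSING Stage-13 tuple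
carrying END (K2⁸'s closer) at which EVERY corner sequence anchoring the datum's β has limit `≥ 0` and every drift slope is `≥ 0`: under rev 26ᴿ∕27 the inversion bites AT THE WITNESS
(the ∃-side), where the corner line (2ᶜᴰ's `0 < s`, an4 INTENT-4's rows-of-corner bridge) must supply the strict sign.  CONDITIONAL on BOTH hypothesis shapes; K1⁸ is OPEN (crux r3,
stmt-26907) and is NOT proved here; nothing of Bałaban asserted. [cite: Balaban1987RG1, Thm 2 p.259 (first sentence), (1.3) p.260 and (2.13)-(2.14) p.268] -/
theorem cornerSignsNonneg_at_witness_of_K1R8_u3K (hU3 : U3K) (hK1 : Summit.QuantumFields.YangMills.Theses.BalabanUVNodes.StabilityBRunRowsAtRecordR13SepCoPH) :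
    ∀ F : T4Family, (∃ θ : Node00.Stage13HParams F 2, θ.Provisos₁₃SepCoPH F 2 ∧ (θ.ZhUnity F 2 ∧ θ.SlotsNondegenerate₁₃ F 2) ∧ θ.Admissible F 2) →
      ∃ (θ : Node00.Stage13HParams F 2) (hP : θ.Provisos₁₃SepCoPH F 2),
        EndpointExistence (Node00.datumOfRecord₁₃SepCoPH F 2 θ hP).C.toB12 ∧
        (∀ b : ℕ → ℝ, ScaleAnchor (Node00.datumOfRecord₁₃SepCoPH F 2 θ hP).βfun b → ∀ binf : ℝ, Tendsto b atTop (𝓝 binf) → 0 ≤ binf) ∧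
        ∀ (b : ℕ → ℝ) (s A : ℝ), ScaleAnchor (Node00.datumOfRecord₁₃SepCoPH F 2 θ hP).βfun b → OneLoopDrift s A b → 0 ≤ s := by
  intro F hF
  obtain ⟨θ, hP, hU, hθ, hB, hwin, hrows⟩ := hK1 F hF
  exact ⟨θ, hP, endpointGivenRunRowsR13SepCoPH_holds F θ hP hU hθ hB hrows hwin, cornerLimNonneg_of_runRows_u3K hU3 F θ hP hU hθ hB hwin hrows,
    slopeNonneg_of_runRows_u3K hU3 F θ hP hU hθ hB hwin hrows⟩

/-- TOY A (β ≡ 0) HAS THE RUN ROWS (reference `b ≡ 0`, radius `0`, window `1`, floor `0`; constant traces). [folklore] -/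
theorem runRowsShape_betaZero : RunRowsShape betaZero :=
  ⟨fun _ => 0, 0, 1, 0, one_pos, fun n gs _ _ k _ => by simp [betaZero], fun n gs _ _ k _ => by simp [betaZero], fun k => continuousOn_const⟩

/-- TOY B (the gaps cell's `betaN`, `β_{k+1} = −g_k`) HAS NO RUN ROWS at any window: rows would give END for `modelOf betaN` (node n24 by name), which `not_endpointExistence_betaN` refutes.
[folklore] -/
theorem not_runRowsShape_betaN : ¬ RunRowsShape betaN := fun h =>
  not_endpointExistence_betaN (endpointExistence_of_runRowsShape (FlowStepRuns.modelOf_forwardGenerated betaN) h)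

/-- **THE BOUNDARY IS UNDECIDED BY THE LETTERS — FOR THE ROWS AS FOR END**: TOY A and TOY B carry every U3 letter, the SAME anchor `b ≡ 0` and the SAME drift `(s, A) = (0, 0)`; A has the
run rows AND END, B has NEITHER.  So under rev 26ᴿ∕27, exactly as under rev 24: from the letters, the rows (hence K1⁸'s last conjunct at a witness) force `0 ≤ s` (T8′) and no more, and
on `{s = 0}` they decide nothing — the strict corner sign `0 < s` (2ᶜᴰ) remains the least letter-side input that pays (PORT-1 p613914 + an4's rows-of-corner bridge).  Generic level;
nothing about Bałaban's β. [folklore] -/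
theorem rows_boundary_undecided_by_letters (γ : ℝ) :
    (∃ β : HBeta, (∃ (c C ρ : ℝ) (Λ : ℕ → ℕ → ℝ), 0 ≤ c ∧ 0 < ρ ∧ ρ < 1 ∧ ScaleShiftRate c ρ γ β ∧ HistLipschitz Λ γ β ∧ FadingMemory C ρ Λ) ∧
        ScaleAnchor β (fun _ => 0) ∧ OneLoopDrift 0 0 (fun _ => (0 : ℝ)) ∧ RunRowsShape β ∧ EndpointExistence (FlowStepRuns.modelOf β)) ∧
      (∃ β : HBeta, (∃ (c C ρ : ℝ) (Λ : ℕ → ℕ → ℝ), 0 ≤ c ∧ 0 < ρ ∧ ρ < 1 ∧ ScaleShiftRate c ρ γ β ∧ HistLipschitz Λ γ β ∧ FadingMemory C ρ Λ) ∧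
        ScaleAnchor β (fun _ => 0) ∧ OneLoopDrift 0 0 (fun _ => (0 : ℝ)) ∧ ¬ RunRowsShape β ∧ ¬ EndpointExistence (FlowStepRuns.modelOf β)) := by
  obtain ⟨hA1, hA2, hA3, hA4, hA5, hA6⟩ := boundary_inhabited_with_end γ
  obtain ⟨hB1, hB2, hB3, hB4, hB5, hB6⟩ := boundary_inhabited_without_end γ
  exact ⟨⟨betaZero, ⟨0, 0, 1 / 2, fun _ _ => 0, le_rfl, by norm_num, by norm_num, hA1, hA2, hA3⟩, hA4, hA5, runRowsShape_betaZero, hA6⟩,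
    ⟨betaN, ⟨0, 1, 1 / 2, lambdaLast, le_rfl, by norm_num, by norm_num, hB1, hB2, hB3⟩, hB4, hB5, not_runRowsShape_betaN, hB6⟩⟩

end RunRows

/-! ## §6 (EDITION 3) THE PRICE OF DISPLAYING THE ROWS, located for one row: K1⁸'s run-rows conjunct is END-SURPLUS IN ITS (C) ROW AT EVERY LEVEL — TOY C♭ has END, rows (i) and
(iv) at every window, and survivor continuity at NO window (so no shrinking of the rows' window repairs it) -/

section RowsSurplus

open Summit.QuantumFields.YangMills.Theorems.BalabanUVNodesK2NamedJetsRunRemAt (RunConstRemainder SurvCont Survivors)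

/-- TOY C♭: `β_1(g_0) = 2 − fract(1∕g_0²)` reads the BARE coupling only — a staircase of DOWNWARD unit jumps (as the bare coupling increases through `1∕√m`, `m ∈ ℕ`) recovered
continuously in between — and `β_{k+1} = 1` for `k ≥ 1`.  NOT Bałaban's β; a kernel witness about hypothesis SHAPES. [folklore] -/
def betaFr : HBeta := fun k p => if k = 0 then 2 - Int.fract (1 / (p 0) ^ 2) else 1

/-- Row (i)'s reference sequence for TOY C♭: `3∕2, 1, 1, …`. [folklore] -/
def bFr : ℕ → ℝ := fun k => if k = 0 then 3 / 2 else 1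

/-- Unfolding at level `0`. [folklore] -/
theorem betaFr_zero (p : Fin (0 + 1) → ℝ) : betaFr 0 p = 2 - Int.fract (1 / (p 0) ^ 2) := by
  simp [betaFr]

/-- Unfolding at levels `≥ 1`. [folklore] -/
theorem betaFr_succ (k : ℕ) (p : Fin (k + 1 + 1) → ℝ) : betaFr (k + 1) p = 1 := by
  simp [betaFr]

/-- TOY C♭ stays within `1∕2` of `bFr` EVERYWHERE (no run structure needed). [folklore] -/
theorem abs_betaFr_sub_bFr_le (k : ℕ) (p : Fin (k + 1) → ℝ) : |betaFr k p - bFr k| ≤ 1 / 2 := by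
  rcases k with _ | k
  · rw [betaFr_zero]
    have h0 := Int.fract_nonneg (1 / (p 0) ^ 2)
    have h1 := Int.fract_lt_one (1 / (p 0) ^ 2)
    have hb : bFr 0 = 3 / 2 := by simp [bFr]
    rw [hb, abs_le]
    constructor <;> linarith
  · rw [betaFr_succ]
    have hb : bFr (k + 1) = 1 := by simp [bFr]
    rw [hb]
    norm_num

/-- TOY C♭ is NON-NEGATIVE everywhere. [folklore] -/
theorem betaFr_nonneg (k : ℕ) (p : Fin (k + 1) → ℝ) : 0 ≤ betaFr k p := by
  rcases k with _ | k
  · rw [betaFr_zero]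
    have h1 := Int.fract_lt_one (1 / (p 0) ^ 2)
    linarith
  · rw [betaFr_succ]
    exact zero_le_one

/-- **Row (i) at EVERY level** for TOY C♭. [folklore] -/
theorem runConstRemainder_betaFr (γ₀ : ℝ) : RunConstRemainder betaFr bFr (1 / 2) γ₀ :=
  fun _ gs _ _ k _ => abs_betaFr_sub_bFr_le k (prefixOf gs k)

/-- **Row (iv) at EVERY level** for TOY C♭, floor `M = 0` (the sign). [folklore] -/
theorem runwisePS_betaFr (γ₀ : ℝ) : ∀ (n : ℕ) (gs : ℕ → ℝ), RGEqH n betaFr gs → Step.InInterval γ₀ n gs →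
    ∀ k, k ≤ n → -(0 : ℝ) ≤ ∑ j ∈ Finset.Ico k n, betaFr j (prefixOf gs j) :=
  fun n gs _ _ k _ => by
    rw [neg_zero]
    exact Finset.sum_nonneg fun j _ => betaFr_nonneg j _

/-- `1∕γ² ≤ 1∕x²` with `x, γ > 0` gives `x ≤ γ`. [folklore] -/
theorem le_of_inv_sq_le {x γ : ℝ} (hx : 0 < x) (hγ : 0 < γ) (h : 1 / γ ^ 2 ≤ 1 / x ^ 2) : x ≤ γ := by
  refine not_lt.mp fun hlt => ?_
  have h2 : γ ^ 2 < x ^ 2 := by nlinarith [mul_pos (sub_pos.mpr hlt) (add_pos hx hγ)]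
  exact absurd h (not_le.mpr (one_div_lt_one_div_of_lt (pow_pos hγ 2) h2))

/-- `solveCoupling (1∕g²) = g` for `g > 0`. [folklore] -/
theorem solveCoupling_inv_sq {g : ℝ} (hg : 0 < g) : FlowStepRuns.solveCoupling (1 / g ^ 2) = g := by
  have hpos : 0 < 1 / g ^ 2 := by positivity
  have h1 := FlowStepRuns.inv_sq_solveCoupling hpos
  have h2 := FlowStepRuns.solveCoupling_pos hpos
  have h3 : (FlowStepRuns.solveCoupling (1 / g ^ 2)) ^ 2 = g ^ 2 := by
    have := congrArg (fun z : ℝ => 1 / z) h1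
    simpa only [one_div_one_div] using this
  rw [← Real.sqrt_sq h2.le, h3, Real.sqrt_sq hg.le]

/-- **Row (C) at NO level** for TOY C♭: for every `γ₀ > 0` the level-0 trace `x ↦ β_1(x) = 2 − fract(1∕x²)` is DIScontinuous ON the survivor set of level `γ₀` (which is `]0, γ₀]` at
scale 0): read through the bare-coupling chart `y ↦ 1∕√y` on `[m − 1∕2, m]` (`m = ⌈1∕γ₀²⌉ + 1`), a continuous trace would make `y ↦ 2 − fract y` continuous there, but its values are
`3∕2` at `m − 1∕2` and `2` at `m` while `7∕4` is never taken (intermediate value theorem). [folklore] -/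
theorem not_survCont_betaFr {γ₀ : ℝ} (hγ₀ : 0 < γ₀) : ¬ SurvCont betaFr γ₀ := by
  intro hsc
  have h0 := hsc 0
  set m : ℕ := ⌈1 / γ₀ ^ 2⌉₊ + 1 with hm
  have hM : 1 / γ₀ ^ 2 + 1 ≤ (m : ℝ) := by
    have hc := Nat.le_ceil (1 / γ₀ ^ 2)
    rw [hm]
    push_cast
    linarith
  have hγ2 : 0 < 1 / γ₀ ^ 2 := by positivity
  have hMpos : 0 < (m : ℝ) - 1 / 2 := by linarith
  have hcont_sc : ContinuousOn FlowStepRuns.solveCoupling (Set.Icc ((m : ℝ) - 1 / 2) m) := by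
    have h1 : ContinuousOn (fun y : ℝ => 1 / Real.sqrt y) (Set.Icc ((m : ℝ) - 1 / 2) m) :=
      continuousOn_const.div Real.continuous_sqrt.continuousOn fun y hy => (Real.sqrt_pos.mpr (hMpos.trans_le hy.1)).ne'
    exact h1.congr fun y hy => by
      show FlowStepRuns.solveCoupling y = 1 / Real.sqrt y
      rw [FlowStepRuns.solveCoupling, if_pos (hMpos.trans_le hy.1)]
  have hmaps : Set.MapsTo FlowStepRuns.solveCoupling (Set.Icc ((m : ℝ) - 1 / 2) m) (Survivors betaFr γ₀ 0) := by
    intro y hy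
    have hy0 : 0 < y := hMpos.trans_le hy.1
    have hx0 := FlowStepRuns.solveCoupling_pos hy0
    have hinv := FlowStepRuns.inv_sq_solveCoupling hy0
    have hge : 1 / γ₀ ^ 2 ≤ 1 / (FlowStepRuns.solveCoupling y) ^ 2 := by
      rw [hinv]
      linarith [hy.1]
    refine ⟨hx0, le_of_inv_sq_le hx0 hγ₀ hge, fun j hj => ?_⟩
    obtain rfl := Nat.le_zero.mp hj
    rw [Y_zero]
    exact hge
  have hcomp : ContinuousOn (fun y : ℝ => 2 - Int.fract y) (Set.Icc ((m : ℝ) - 1 / 2) m) := by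
    refine (h0.comp hcont_sc hmaps).congr fun y hy => ?_
    have hy0 : 0 < y := hMpos.trans_le hy.1
    have hinv := FlowStepRuns.inv_sq_solveCoupling hy0
    have hge : 1 / γ₀ ^ 2 ≤ y := by linarith [hy.1]
    have e1 : clampPrefix betaFr γ₀ 0 (FlowStepRuns.solveCoupling y) 0 = gClamp γ₀ (1 / (FlowStepRuns.solveCoupling y) ^ 2) := rfl
    show 2 - Int.fract y = betaFr 0 (clampPrefix betaFr γ₀ 0 (FlowStepRuns.solveCoupling y))
    rw [betaFr_zero, e1, hinv, inv_sq_gClamp hγ₀ hge]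
  have ha : (m : ℝ) - 1 / 2 ∈ Set.Icc ((m : ℝ) - 1 / 2) m := ⟨le_rfl, by linarith⟩
  have hb : (m : ℝ) ∈ Set.Icc ((m : ℝ) - 1 / 2) m := ⟨by linarith, le_rfl⟩
  have hIVT := isPreconnected_Icc.intermediate_value ha hb hcomp
  have fa : Int.fract ((m : ℝ) - 1 / 2) = 1 / 2 := by
    rw [Int.fract_eq_iff]
    refine ⟨by norm_num, by norm_num, (m : ℤ) - 1, ?_⟩
    push_cast
    ring
  have fb : Int.fract (m : ℝ) = 0 := Int.fract_natCast m
  have hmem : (7 / 4 : ℝ) ∈ (fun y : ℝ => 2 - Int.fract y) '' Set.Icc ((m : ℝ) - 1 / 2) m := by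
    apply hIVT
    show (7 / 4 : ℝ) ∈ Set.Icc (2 - Int.fract ((m : ℝ) - 1 / 2)) (2 - Int.fract (m : ℝ))
    rw [fa, fb]
    constructor <;> norm_num
  obtain ⟨y, hy, hyv⟩ := hmem
  have hfy : Int.fract y = 1 / 4 := by
    have : (2 : ℝ) - Int.fract y = 7 / 4 := hyv
    linarith
  rcases eq_or_lt_of_le hy.2 with h | h
  · rw [h, Int.fract_natCast] at hfy
    norm_num at hfy
  · have hf : Int.fract y = y - ((m : ℝ) - 1) := by
      rw [Int.fract_eq_iff]
      refine ⟨by linarith [hy.1], by linarith, (m : ℤ) - 1, ?_⟩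
      push_cast
      ring
    rw [hf] at hfy
    linarith [hy.1]

/-- **TOY C♭ HAS END** (explicit shooting, no continuity used: for target `1∕g² = T ≥ 1∕γ² + 2` and cutoff `K + 1`, put `t = T + K`, `N = ⌊t⌋`, `u = (t + N + 4)∕2 ∈ [N + 2, N + 5∕2[`,
bare coupling `g_0 = 1∕√u`: then `fract u = u − N − 2`, so `1∕g_1² = u − β_1(g_0) = t` and `1∕g_{j+1}² = t − j ≥ T > 1∕γ²` — the run stays in `]0, γ]` and ends at `g_{K+1} = g`; cutoff
`0` is the target itself). [folklore] -/
theorem endpointExistence_betaFr : EndpointExistence (FlowStepRuns.modelOf betaFr) := by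
  intro m
  refine ⟨1, one_pos, fun γ hγ _ => ?_⟩
  have hT0 : 0 < 1 / γ ^ 2 + 2 := by positivity
  refine ⟨FlowStepRuns.solveCoupling (1 / γ ^ 2 + 2), FlowStepRuns.solveCoupling_pos hT0, fun g hg hgs K => ?_⟩
  have hT : 1 / γ ^ 2 + 2 ≤ 1 / g ^ 2 := by
    have h := one_div_le_one_div_of_le (pow_pos hg 2) (pow_le_pow_left₀ hg.le hgs 2)
    rwa [FlowStepRuns.inv_sq_solveCoupling hT0] at h
  have hgγ : g ≤ γ := le_of_inv_sq_le hg hγ (by linarith)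
  rcases K with _ | K
  · refine ⟨g, fun k hk => ?_, ?_⟩
    · obtain rfl := Nat.le_zero.mp hk
      show 0 < FlowStepRuns.genSeq betaFr g 0 ∧ FlowStepRuns.genSeq betaFr g 0 ≤ γ
      rw [FlowStepRuns.genSeq_zero]
      exact ⟨hg, hgγ⟩
    · show FlowStepRuns.genSeq betaFr g 0 = g
      exact FlowStepRuns.genSeq_zero betaFr g
  · set T : ℝ := 1 / g ^ 2 with hTdef
    have hTpos : 0 < T := by positivity
    set t : ℝ := T + K with htdef
    have hKnn : (0 : ℝ) ≤ K := Nat.cast_nonneg K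
    have ht0 : 0 ≤ t := by linarith
    set N : ℕ := ⌊t⌋₊ with hN
    have hN1 : (N : ℝ) ≤ t := Nat.floor_le ht0
    have hN2 : t < N + 1 := Nat.lt_floor_add_one t
    have hNnn : (0 : ℝ) ≤ N := Nat.cast_nonneg N
    set u : ℝ := (t + N + 4) / 2 with hu
    have hu1 : (N : ℝ) + 2 ≤ u := by rw [hu]; linarith
    have hu2 : u < N + 5 / 2 := by rw [hu]; linarith
    have hupos : 0 < u := by linarith
    have hfract : Int.fract u = u - (N + 2) := by
      rw [Int.fract_eq_iff]
      refine ⟨by linarith, by linarith, (N : ℤ) + 2, ?_⟩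
      push_cast
      ring
    set g0 : ℝ := FlowStepRuns.solveCoupling u with hg0
    have hg0pos : 0 < g0 := FlowStepRuns.solveCoupling_pos hupos
    have hg0inv : 1 / g0 ^ 2 = u := FlowStepRuns.inv_sq_solveCoupling hupos
    have e0 : prefixOf (FlowStepRuns.genSeq betaFr g0) 0 0 = g0 := by
      rw [prefixOf_apply]
      exact FlowStepRuns.genSeq_zero betaFr g0
    -- closed form of the generated run
    have hrun : ∀ i : ℕ, i ≤ K → FlowStepRuns.genSeq betaFr g0 (i + 1) = FlowStepRuns.solveCoupling (t - i) := by
      intro i hi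
      induction i with
      | zero =>
        rw [FlowStepRuns.genSeq_succ, FlowStepRuns.genSeq_zero]
        congr 1
        rw [betaFr_zero, e0, hg0inv, hfract, hu]
        push_cast
        ring
      | succ i ih =>
        have hi' : i ≤ K := Nat.le_of_succ_le hi
        have hic : (i : ℝ) + 1 ≤ K := by exact_mod_cast hi
        have hpos : 0 < t - i := by linarith
        rw [FlowStepRuns.genSeq_succ, ih hi', betaFr_succ, FlowStepRuns.inv_sq_solveCoupling hpos]
        congr 1
        push_cast
        ring
    have htK : t - (K : ℝ) = T := by rw [htdef]; ring
    refine ⟨g0, fun k hk => ?_, ?_⟩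
    · show 0 < FlowStepRuns.genSeq betaFr g0 k ∧ FlowStepRuns.genSeq betaFr g0 k ≤ γ
      rcases k with _ | i
      · rw [FlowStepRuns.genSeq_zero]
        refine ⟨hg0pos, le_of_inv_sq_le hg0pos hγ ?_⟩
        rw [hg0inv]
        linarith
      · have hi : i ≤ K := Nat.succ_le_succ_iff.mp hk
        have hic : (i : ℝ) ≤ K := by exact_mod_cast hi
        have hpos : 0 < t - i := by linarith
        rw [hrun i hi]
        refine ⟨FlowStepRuns.solveCoupling_pos hpos, le_of_inv_sq_le (FlowStepRuns.solveCoupling_pos hpos) hγ ?_⟩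
        rw [FlowStepRuns.inv_sq_solveCoupling hpos]
        linarith
    · show FlowStepRuns.genSeq betaFr g0 (K + 1) = g
      rw [hrun K le_rfl, htK, hTdef]
      exact solveCoupling_inv_sq hg

/-- ★★ **K1⁸'s RUN-ROWS CONJUNCT IS NOT END-NECESSARY — its (C) row is END-SURPLUS AT EVERY LEVEL.**  TOY C♭ has END for its canonical construction and rows (i) ∧ (iv) at EVERY window
`γ₀` (reference `bFr`, radius `1∕2`, floor `0`), yet survivor continuity at NO window `γ₀ > 0`; in particular `¬ RunRowsShape betaFr` while `EndpointExistence (modelOf betaFr)`.  So the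
deciding crux asserts at its witness, beyond R4's END binder (which node n24 ∕ K2⁸ derive FROM the rows), a continuity row that END does not force and that no re-choice of the rows'
window repairs — the price «K1⁸ STRONGER than END at the witness» (plan g84 rev 26ᴿ) LOCATED and kernel-certain for the (C) row: K1⁸ is refutable by a discontinuity of `β_θ`'s
survivor traces at every witness even where END holds.  (The (iv) row's END-surplus is the gaps cell's AF-1 model §12 — HOME kernel `XreadEndWindowModel_plan2`, cited in the header of
`Gaps/EndRunwiseWitness`, NOT a tree file — not re-typed here; the converse «END ∧ other letters ⇏ spare (C) on the roads» is `Gaps/EndContLetterWitness` ∕ N-18.)  A statement about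
HYPOTHESIS SHAPES on a toy family; NOTHING about Bałaban's β-functions, whose continuity in the coupling [I] section 1 asserts without proof. [folklore] -/
theorem runRows_not_necessary_for_end :
    EndpointExistence (FlowStepRuns.modelOf betaFr) ∧ (∀ γ₀ : ℝ, RunConstRemainder betaFr bFr (1 / 2) γ₀) ∧
      (∀ (γ₀ : ℝ) (n : ℕ) (gs : ℕ → ℝ), RGEqH n betaFr gs → Step.InInterval γ₀ n gs → ∀ k, k ≤ n → -(0 : ℝ) ≤ ∑ j ∈ Finset.Ico k n, betaFr j (prefixOf gs j)) ∧
      (∀ γ₀ : ℝ, 0 < γ₀ → ¬ SurvCont betaFr γ₀) ∧ ¬ RunRowsShape betaFr :=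
  ⟨endpointExistence_betaFr, runConstRemainder_betaFr, runwisePS_betaFr, fun _ h => not_survCont_betaFr h,
    fun ⟨_, _, _, _, hγ₀, _, _, hsc⟩ => not_survCont_betaFr hγ₀ hsc⟩

/-- COROLLARY (the direction table under rev 26ᴿ∕27): ROWS ⟹ END at every forward-generated construction (node n24 ∕ K2⁸), END ⇏ ROWS even at the canonical one — the implication the
route now displays at K1⁸'s witness is ONE-WAY. [folklore] -/
theorem runRows_strictly_stronger_than_end :
    (∀ β : HBeta, RunRowsShape β → EndpointExistence (FlowStepRuns.modelOf β)) ∧ ¬ (∀ β : HBeta, EndpointExistence (FlowStepRuns.modelOf β) → RunRowsShape β) :=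
  ⟨fun β h => endpointExistence_of_runRowsShape (FlowStepRuns.modelOf_forwardGenerated β) h,
    fun h => runRows_not_necessary_for_end.2.2.2.2 (h betaFr endpointExistence_betaFr)⟩

end RowsSurplus

/-! ## §7 (EDITION 3.1) THE LETTER-COLLAPSE OF K1⁸'s ROWS: modulo node U2∕U3's history letters (`HistLipschitz` + `FadingMemory` — two of U3ᴷ's three; N17's rate NOT needed) rows (i)
and (C) hold at EVERY small window relative to the CORNER numbers, so K1⁸'s rows conjunct ⟺ the run-wise partial-sum floor (iv) ALONE; and 2ᶜᴰ alone (no (190)-chain stub 1ᶜᴿ)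
buys the rows — hence {K1⁷, U3ᴷ, 2ᶜᴰ} ⟹ K1⁸ BY NAME.  So under rev 26ᴿ∕27 the inversion reads, on letter tuples: K1⁸ − K1⁷ = (iv) = «END-surplus on the boundary {b_∞ = 0}» (T8′ ∕ §6),
and §6's (C)-surplus is exactly the NON-letter part (TOY C♭ is not history-Lipschitz). -/

section LetterCollapse

open Summit.QuantumFields.YangMills.Theorems.BalabanUVNodesK2NamedJetsRunRemAt (RunConstRemainder SurvCont Survivors runwisePS_of_drift_runConstRemainder)
open YMDAG.N18.CornerBandOfKernelLetters (abs_sub_le_sum_of_anchor_of_histLipschitz abs_sub_le_band_of_fadingMemory)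
open Literature.MathematicalPhysics.QuantumFieldTheory.Balaban1983to89.T4BetaStationary (betaContH_of_histLipschitz)

variable {β : HBeta} {b : ℕ → ℝ}

/-- The prefix of an in-window run is a punctured-box history. [folklore] -/
theorem prefixOf_mem_histBox_of_inInterval {γ₀ : ℝ} {n : ℕ} {gs : ℕ → ℝ} (hI : Step.InInterval γ₀ n gs) {k : ℕ} (hk : k ≤ n) :
    prefixOf gs k ∈ HistBox γ₀ k :=
  fun i => by
    rw [prefixOf_apply]
    exact hI i ((Nat.le_of_lt_succ i.isLt).trans hk)

/-- **ROW (i) FROM THE LETTERS, AT EVERY WINDOW `γ₀ ≤ γ`**: `HistLipschitz Λ γ β` + `FadingMemory C ρ Λ` (`0 ≤ ρ < 1`) + the anchor `b` (= the corner numbers) ⟹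
`RunConstRemainder β b (C(1−ρ)⁻¹·γ₀) γ₀` — dag-n18-w1's corner band (`abs_sub_le_sum_of_anchor_of_histLipschitz`, `abs_sub_le_band_of_fadingMemory`) BY NAME, read along runs.
The radius SHRINKS with the window.  CONDITIONAL on the letters; nothing of Bałaban asserted. [cite: Balaban1987RG1, (2.12)-(2.14) p.268 and section 5 p.298] -/
theorem runConstRemainder_of_histLipschitz_fadingMemory {Λ : ℕ → ℕ → ℝ} {C ρ γ : ℝ} (hL : HistLipschitz Λ γ β) (hΛ : FadingMemory C ρ Λ) (hρ0 : 0 ≤ ρ) (hρ1 : ρ < 1)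
    (hb : ScaleAnchor β b) {γ₀ : ℝ} (hle : γ₀ ≤ γ) : RunConstRemainder β b (C * (1 - ρ)⁻¹ * γ₀) γ₀ :=
  fun _ _ _ hI k hk =>
    abs_sub_le_band_of_fadingMemory (fun k _ hp => abs_sub_le_sum_of_anchor_of_histLipschitz hL hb k hp) hΛ hρ0 hρ1 hle k
      (prefixOf_mem_histBox_of_inInterval hI hk)

/-- **ROW (C) FROM THE LETTERS, AT EVERY WINDOW `0 < γ₀ ≤ γ`**: `HistLipschitz Λ γ β` ⟹ (C) on the boxes (`T4BetaStationary.betaContH_of_histLipschitz`), restricted to the sub-box,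
⟹ survivor continuity (DEF-1's `SurvCont.of_betaContH`, over `Gaps.EndSurvivorCensus.survCont_of_betaContH`).  CONDITIONAL on the letter. [cite: Balaban1987RG1, section 1 pp.263-264 and section 5 p.298] -/
theorem survCont_of_histLipschitz {Λ : ℕ → ℕ → ℝ} {γ : ℝ} (hL : HistLipschitz Λ γ β) {γ₀ : ℝ} (hγ₀ : 0 < γ₀) (hle : γ₀ ≤ γ) : SurvCont β γ₀ :=
  Summit.QuantumFields.YangMills.Theorems.BalabanUVNodesK2NamedJetsRunRemAt.SurvCont.of_betaContH hγ₀ fun k => (betaContH_of_histLipschitz hL k).mono fun _ hp =>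
    mem_box.2 fun i => ⟨(mem_box.1 hp i).1, (mem_box.1 hp i).2.trans hle⟩

/-- **T10 ★★ THE LETTER-COLLAPSE OF K1⁸'s ROWS CONJUNCT**: under `HistLipschitz Λ γ β` + `FadingMemory C ρ Λ` (`0 ≤ ρ < 1`, `0 < γ`) — rows (i) and (C) being free at every
window `≤ γ` — `RunRowsShape β` ⟺ «SOME window carries the run-wise partial-sum floor (iv)».  So on letter tuples the deciding crux's displayed rows are ONE row, (iv); by T8′ it is
END-necessary only through `0 ≤ s`, and §6's (C)-surplus lives entirely OFF the letters.  CONDITIONAL on the letters; nothing of Bałaban asserted.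
[cite: Balaban1987RG1, Thm 3 p.264, (2.12)-(2.14) p.268 and section 5 p.298] -/
theorem runRowsShape_iff_runwisePS_of_letters {Λ : ℕ → ℕ → ℝ} {C ρ γ : ℝ} (hγ : 0 < γ) (hL : HistLipschitz Λ γ β) (hΛ : FadingMemory C ρ Λ)
    (hρ0 : 0 ≤ ρ) (hρ1 : ρ < 1) :
    RunRowsShape β ↔ ∃ (γ₀ M : ℝ), 0 < γ₀ ∧
      ∀ (n : ℕ) (gs : ℕ → ℝ), RGEqH n β gs → Step.InInterval γ₀ n gs → ∀ k, k ≤ n → -M ≤ ∑ j ∈ Finset.Ico k n, β j (prefixOf gs j) := by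
  constructor
  · rintro ⟨b, r, γ₀, M, hγ₀, -, hps, -⟩
    exact ⟨γ₀, M, hγ₀, hps⟩
  · rintro ⟨γ₀, M, hγ₀, hps⟩
    obtain ⟨b, hb⟩ := exists_scaleAnchor_of_histLipschitz hγ hL
    have hmin : 0 < min γ₀ γ := lt_min hγ₀ hγ
    refine ⟨b, C * (1 - ρ)⁻¹ * min γ₀ γ, min γ₀ γ, M, hmin,
      runConstRemainder_of_histLipschitz_fadingMemory hL hΛ hρ0 hρ1 hb (min_le_right _ _), ?_, survCont_of_histLipschitz hL hmin (min_le_right _ _)⟩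
    intro n gs hrg hI k hk
    exact hps n gs hrg (fun j hj => ⟨(hI j hj).1, (hI j hj).2.trans (min_le_left _ _)⟩) k hk

/-- **T11 ★★ ON LETTER TUPLES 2ᶜᴰ ALONE BUYS THE ROWS** (no (190)-chain stub 1ᶜᴿ, no N17 rate): `HistLipschitz` + `FadingMemory` + an anchored corner sequence `b` drifting at a slope
`s > 0` ⟹ `RunRowsShape β` — window `γ₀ := min γ (s ∕ (C(1−ρ)⁻¹ + 1))` so that the letter radius `C(1−ρ)⁻¹γ₀ ≤ s`, floor `2A` by DEF-1's `runwisePS_of_drift_runConstRemainder`, (C) by the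
letters.  The rows analogue of PORT-1 INTENT-3's `EndpointGivenBR13SepCoPH_of_u3K_cornerDriftPosK` (END without 1ᶜᴿ).  CONDITIONAL on hypothesis shapes; nothing of Bałaban asserted.
[cite: Balaban1987RG1, Thm 3 p.264, (1.3) p.260, (2.12)-(2.14) p.268 and (5.10) p.293] -/
theorem runRowsShape_of_letters_cornerDriftPos {Λ : ℕ → ℕ → ℝ} {C ρ γ s A : ℝ} (hγ : 0 < γ) (hL : HistLipschitz Λ γ β) (hΛ : FadingMemory C ρ Λ)
    (hρ0 : 0 ≤ ρ) (hρ1 : ρ < 1) (hb : ScaleAnchor β b) (hdrift : OneLoopDrift s A b) (hs : 0 < s) : RunRowsShape β := by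
  have hC : 0 ≤ C := by
    have h := hΛ 0 0 le_rfl
    simpa using h.1.trans h.2
  have hx0 : 0 ≤ C * (1 - ρ)⁻¹ := mul_nonneg hC (inv_nonneg.2 (by linarith))
  have hx1 : 0 < C * (1 - ρ)⁻¹ + 1 := by linarith
  have hγ₀pos : 0 < min γ (s / (C * (1 - ρ)⁻¹ + 1)) := lt_min hγ (div_pos hs hx1)
  have hle : min γ (s / (C * (1 - ρ)⁻¹ + 1)) ≤ γ := min_le_left _ _
  have hr : C * (1 - ρ)⁻¹ * min γ (s / (C * (1 - ρ)⁻¹ + 1)) ≤ s := by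
    have h1 : min γ (s / (C * (1 - ρ)⁻¹ + 1)) ≤ s / (C * (1 - ρ)⁻¹ + 1) := min_le_right _ _
    have h2 : C * (1 - ρ)⁻¹ * (s / (C * (1 - ρ)⁻¹ + 1)) ≤ s := by
      rw [← mul_div_assoc, div_le_iff₀ hx1]
      nlinarith
    exact (mul_le_mul_of_nonneg_left h1 hx0).trans h2
  have hrem := runConstRemainder_of_histLipschitz_fadingMemory hL hΛ hρ0 hρ1 hb hle
  exact ⟨b, _, _, 2 * A, hγ₀pos, hrem, runwisePS_of_drift_runConstRemainder hdrift hrem hr, survCont_of_histLipschitz hL hγ₀pos hle⟩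

/-- **T12 ★★ AT THE RECORD, K-keyed: U3ᴷ + 2ᶜᴰ ⟹ THE ∀θ ROWS PROGRAMME** — at every prefixed Stage-13 tuple carrying the window, the K3⁷-type letters and the registered corner stub's
text give K1⁸'s rows conjunct for `β_θ` (plan g84's `RowsContAll`, here as `RunRowsShape (Node00.betaOfRecord₁₃ F 2 θ.toStage13Params)`): an4 INTENT-4's bridge
`rowsContAllK_of_cornerPairK` with 1ᶜᴿ REPLACED by U3ᴷ (zero private content, K3⁷-shared).  CONDITIONAL on two hypothesis shapes; 2ᶜᴰ ∕ U3ᴷ inhabited at no θ here; nothing of Bałaban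
asserted. [cite: Balaban1987RG1, Thm 3 p.264, (1.3) p.260, (1.20)-(1.22) p.264 and (2.12)-(2.14) p.268] -/
theorem runRowsAll_of_u3K_cornerDriftPos (hU3 : U3K) (hCD : CornerDriftPos) :
    ∀ (F : T4Family) (θ : Node00.Stage13HParams F 2) (hP : θ.Provisos₁₃SepCoPH F 2), (θ.ZhUnity F 2 ∧ θ.SlotsNondegenerate₁₃ F 2) → θ.Admissible F 2 →
      B16.EndStatementBPrinted (Node00.datumOfRecord₁₃SepCoPH F 2 θ hP).C → Window13 F θ hP →
      RunRowsShape (Node00.betaOfRecord₁₃ F 2 θ.toStage13Params) := by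
  intro F θ hP hU hθ hB hwin
  obtain ⟨c, C, ρ, Λ, -, hρ0, hρ1, -, hL, hΛ⟩ := hU3 F θ hP hU hθ hB hwin
  obtain ⟨b, s, A, hb, hs, hdrift⟩ := hCD F θ hP hU hθ hB hwin
  exact runRowsShape_of_letters_cornerDriftPos hθ.toStage12.toStage9.gamma_pos hL hΛ hρ0.le hρ1 hb hdrift hs

/-- **T13 ★★★ {K1⁷, U3ᴷ, 2ᶜᴰ} ⟹ K1⁸ BY NAME**: the `aside` crux K1⁷ `StabilityBAtRecordR13SepCoPH` (stmt-20542: a witness with unity ∧ slots, admissibility, (B), window) + the K3⁷-type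
letters U3ᴷ + the registered corner stub 2ᶜᴰ give the DECIDING crux K1⁸ `StabilityBRunRowsAtRecordR13SepCoPH` (stmt-26907) — the same witness, its rows by T12.  A supplier LINE for
K1⁸ WITHOUT the (190)-chain stub 1ᶜᴿ: on the v7ᴿ skeleton, given K3⁷'s letters, 1ᶜᴿ is redundant for K1⁸ as it was for K2⁷ (PORT-1 INTENT-3).  CONDITIONAL on THREE hypothesis shapes,
none inhabited here; K1⁸ is NOT proved; nothing of Bałaban asserted. [cite: Balaban1987RG1, Thm 2 p.259 (first sentence), Thm 3 p.264, (1.3) p.260 and (2.12)-(2.14) p.268] -/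
theorem k1R8_of_k1R7_u3K_cornerDriftPos (hK17 : Summit.QuantumFields.YangMills.Theses.BalabanUVNodes.StabilityBAtRecordR13SepCoPH) (hU3 : U3K) (hCD : CornerDriftPos) :
    Summit.QuantumFields.YangMills.Theses.BalabanUVNodes.StabilityBRunRowsAtRecordR13SepCoPH := by
  intro F hF
  obtain ⟨θ, hP, hU, hθ, hB, hwin⟩ := hK17 F hF
  exact ⟨θ, hP, hU, hθ, hB, hwin, runRowsAll_of_u3K_cornerDriftPos hU3 hCD F θ hP hU hθ hB hwin⟩

/-- **T14 — THE DIRECTION TABLE ON LETTER TUPLES** (generic β; letters `HistLipschitz` + `FadingMemory`, `0 < γ`, plus N17's rate for the necessity column): for an anchored corner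
sequence drifting at slope `s`, `0 < s` ⟹ ROWS (T11) ⟹ END (node n24) ⟹ `0 ≤ s` (§1) — the rows sit BETWEEN the strict and the weak corner sign, i.e. K1⁸'s displayed rows cost, beyond
END, at most the boundary `{s = 0}` (where TOY A has them and TOY B, not a letter tuple for (iv)… has neither).  CONDITIONAL. [cite: Balaban1987RG1, (1.3) p.260, (2.12)-(2.14) p.268 and section 5 p.298] -/
theorem rows_between_corner_signs {Λ : ℕ → ℕ → ℝ} {c C ρ γ s A : ℝ} (hγ : 0 < γ) (hss : ScaleShiftRate c ρ γ β) (hL : HistLipschitz Λ γ β) (hΛ : FadingMemory C ρ Λ)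
    (hρ0 : 0 ≤ ρ) (hρ1 : ρ < 1) (hb : ScaleAnchor β b) (hdrift : OneLoopDrift s A b) :
    (0 < s → RunRowsShape β) ∧ (RunRowsShape β → EndpointExistence (FlowStepRuns.modelOf β)) ∧ (EndpointExistence (FlowStepRuns.modelOf β) → 0 ≤ s) :=
  ⟨fun hs => runRowsShape_of_letters_cornerDriftPos hγ hL hΛ hρ0 hρ1 hb hdrift hs,
    fun h => endpointExistence_of_runRowsShape (FlowStepRuns.modelOf_forwardGenerated β) h,
    fun hE => slope_nonneg_of_endpointExistence (FlowStepRuns.modelOf_forwardGenerated β) hγ hρ0 hρ1 hss hb hdrift hE⟩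

end LetterCollapse

/-! ## §8 (EDITION 3.2) TWO CONSEQUENCES FOR THE DECIDING CRUX'S REGISTERED SKELETON v7ᴿ (stmt-26907: `stub_nodes13PWS`, `stub_runRows13PWS`, `stub_cont13`) and THE BOUNDARY TOY D.
(8a) v7ᴿ's (C)-stub 3 has ZERO private content modulo node U2∕U3's history-Lipschitz letter: `HistLipschitz` at every provisos-admissible tuple ⟹ plan g84's ∀θ letter `Cont13All` (text
verbatim below) — a FOURTH supplier road for `stub_cont13` (plan's docstring lists `Cont13All`, `RunRemAt`'s (C) conjunct, 1ᶜᴿ's last conjunct).  (8b) TOY D `betaOsc`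
(`β_{k+1}(g_0,…,g_k) = g_k · sin(π log g_k)`): carries ALL THREE U3 letters (N17 rate `c = 0`, moduli `5·δ_{ik}`, fading), the anchor `b ≡ 0`, the drift at slope `s = 0`, AND END — yet NOT
the rows: on letter tuples the END-surplus of K1⁸'s rows conjunct (= (iv) by T10) is NONEMPTY and sits exactly on T14's boundary `{s = 0}`. -/

section StubContOfLetters

open Summit.QuantumFields.YangMills.Theorems.BalabanUVNodesK2NamedJetsRunRemAt (RunConstRemainder SurvCont Survivors)

/-- Plan g84's ∀θ (C) LETTER `Cont13All` — TEXT VERBATIM from the registered v7ᴿ skeleton `K1Skeleton13SepCoPHv7R2.lean` :259 (d90044cd05ffffb9; there a `def` in the plan's folder, not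
importable): run-wise survivor continuity of the record's β at EVERY admissible Stage-13 tuple with provisos and EVERY level `0 < γ₀ ≤ θ.γ`.  In v7ᴿ, `stubCont13_of_cont13All : Cont13All →
stub 3` (kernel, plan's file).  Hypothesis shape; nothing of Bałaban asserted. [cite: Balaban1987RG1, section 1 pp.263-264 (statement shape only)] -/
def Cont13AllText : Prop :=
  ∀ (F : T4Family) (θ : Node00.Stage13HParams F 2), θ.Provisos₁₃SepCoPH F 2 → θ.Admissible F 2 →
    ∀ γ₀ : ℝ, 0 < γ₀ → γ₀ ≤ θ.γ → SurvCont (Node00.betaOfRecord₁₃ F 2 θ.toStage13Params) γ₀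

/-- The U2∕U3 HISTORY-LIPSCHITZ LETTER at every provisos-admissible Stage-13 tuple (the `HistLipschitz` conjunct of U3ᴷ ∕ of K3⁷'s NE9-type letters, with NO (U∧S) ∕ (B) ∕ window
antecedent — the letter is a property of the record's β alone).  Hypothesis shape; inhabited at no θ here. [cite: Balaban1987RG1, section 5 p.298 and (2.12)-(2.14) p.268] -/
def HistLipschitzAll13 : Prop :=
  ∀ (F : T4Family) (θ : Node00.Stage13HParams F 2), θ.Provisos₁₃SepCoPH F 2 → θ.Admissible F 2 →
    ∃ Λ : ℕ → ℕ → ℝ, HistLipschitz Λ θ.γ (Node00.betaOfRecord₁₃ F 2 θ.toStage13Params)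

/-- **T15 ★★ v7ᴿ's (C)-STUB 3 IS LETTER-COVERED**: the history-Lipschitz letter at every tuple ⟹ `Cont13All` (hence `stub_cont13` by plan's `stubCont13_of_cont13All`) — §7's
`survCont_of_histLipschitz` at each tuple and level.  So of v7ᴿ's three stubs only `stub_runRows13PWS`'s floor (iv) (and its ceiling match) and the XL node stub carry content beyond
node U2∕U3's letters.  CONDITIONAL on the letter; nothing of Bałaban asserted. [cite: Balaban1987RG1, section 1 pp.263-264 and section 5 p.298] -/
theorem cont13All_of_histLipschitzAll13 (hL : HistLipschitzAll13) : Cont13AllText := by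
  intro F θ hP hθ γ₀ hγ₀ hle
  obtain ⟨Λ, hΛ⟩ := hL F θ hP hθ
  exact survCont_of_histLipschitz hΛ hγ₀ hle

end StubContOfLetters

section LetterToy

open Summit.QuantumFields.YangMills.Theorems.BalabanUVNodesK2NamedJetsRunRemAt (RunConstRemainder SurvCont Survivors)

/-- TOY D's one-variable profile `h(p) = p · sin(π log p)`: `|h(p)| ≤ p`, zeros at `p = e^{−n}` accumulating at `0`, `5`-Lipschitz on `]0, ∞[`. [folklore] -/
def hOsc (p : ℝ) : ℝ := p * Real.sin (Real.pi * Real.log p)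

/-- TOY D: `β_{k+1}(g_0,…,g_k) := h(g_k)` — AUTONOMOUS, current-coupling-only, sign-changing at every scale. [folklore] -/
def betaOsc : HBeta := fun k p => hOsc (p (Fin.last k))

/-- TOY D's moduli: only the last coupling matters, with weight `5`. [folklore] -/
def lamOsc : ℕ → ℕ → ℝ := fun k i => if i = k then 5 else 0

/-- `|h(p)| ≤ p` for `p ≥ 0`. [folklore] -/
theorem abs_hOsc_le {p : ℝ} (hp : 0 ≤ p) : |hOsc p| ≤ p := by
  unfold hOsc
  rw [abs_mul, abs_of_nonneg hp]
  exact mul_le_of_le_one_right hp (Real.abs_sin_le_one _)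

/-- The zeros `h(e^{−n}) = 0`. [folklore] -/
theorem hOsc_exp_neg_nat (n : ℕ) : hOsc (Real.exp (-(n : ℝ))) = 0 := by
  unfold hOsc
  rw [Real.log_exp, mul_neg, Real.sin_neg, mul_comm Real.pi, Real.sin_nat_mul_pi]
  simp

/-- One-sided Lipschitz estimate: for `0 < q ≤ p`, `|h(p) − h(q)| ≤ 5 (p − q)` (`|sin| ≤ 1`, `sin` 1-Lipschitz, `q·log(p∕q) ≤ p − q`, `π ≤ 4`). [folklore] -/
theorem hOsc_sub_le_aux {p q : ℝ} (hq : 0 < q) (hqp : q ≤ p) : |hOsc p - hOsc q| ≤ 5 * (p - q) := by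
  have hp : 0 < p := hq.trans_le hqp
  have h1 : hOsc p - hOsc q = (p - q) * Real.sin (Real.pi * Real.log p) +
      q * (Real.sin (Real.pi * Real.log p) - Real.sin (Real.pi * Real.log q)) := by
    unfold hOsc; ring
  have hlog0 : 0 ≤ Real.log p - Real.log q := sub_nonneg.2 (Real.log_le_log hq hqp)
  have hlog : q * (Real.log p - Real.log q) ≤ p - q := by
    have h := Real.log_le_sub_one_of_pos (div_pos hp hq)
    rw [Real.log_div hp.ne' hq.ne'] at h
    have h' := mul_le_mul_of_nonneg_left h hq.le
    have e : q * (p / q - 1) = p - q := by field_simp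
    linarith
  have hsin : |Real.sin (Real.pi * Real.log p) - Real.sin (Real.pi * Real.log q)| ≤ Real.pi * (Real.log p - Real.log q) := by
    refine (Real.abs_sin_sub_sin_le _ _).trans ?_
    rw [← mul_sub, abs_mul, abs_of_pos Real.pi_pos, abs_of_nonneg hlog0]
  have hA : |(p - q) * Real.sin (Real.pi * Real.log p)| ≤ p - q := by
    rw [abs_mul, abs_of_nonneg (sub_nonneg.2 hqp)]
    exact mul_le_of_le_one_right (sub_nonneg.2 hqp) (Real.abs_sin_le_one _)
  have hB : |q * (Real.sin (Real.pi * Real.log p) - Real.sin (Real.pi * Real.log q))| ≤ Real.pi * (p - q) := by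
    rw [abs_mul, abs_of_pos hq]
    calc q * |Real.sin (Real.pi * Real.log p) - Real.sin (Real.pi * Real.log q)|
        ≤ q * (Real.pi * (Real.log p - Real.log q)) := mul_le_mul_of_nonneg_left hsin hq.le
      _ = Real.pi * (q * (Real.log p - Real.log q)) := by ring
      _ ≤ Real.pi * (p - q) := mul_le_mul_of_nonneg_left hlog Real.pi_pos.le
  calc |hOsc p - hOsc q| ≤ |(p - q) * Real.sin (Real.pi * Real.log p)| +
        |q * (Real.sin (Real.pi * Real.log p) - Real.sin (Real.pi * Real.log q))| := by rw [h1]; exact abs_add_le _ _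
    _ ≤ (p - q) + Real.pi * (p - q) := add_le_add hA hB
    _ ≤ 5 * (p - q) := by nlinarith [Real.pi_le_four, sub_nonneg.2 hqp]

/-- `h` is `5`-Lipschitz on `]0, ∞[`. [folklore] -/
theorem abs_hOsc_sub_le {p q : ℝ} (hp : 0 < p) (hq : 0 < q) : |hOsc p - hOsc q| ≤ 5 * |p - q| := by
  rcases le_total q p with h | h
  · rw [abs_of_nonneg (sub_nonneg.2 h)]
    exact hOsc_sub_le_aux hq h
  · rw [abs_sub_comm (hOsc p) (hOsc q), abs_sub_comm p q, abs_of_nonneg (sub_nonneg.2 h)]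
    exact hOsc_sub_le_aux hp h

/-- `h` is continuous on `]0, ∞[`. [folklore] -/
theorem continuousOn_hOsc : ContinuousOn hOsc (Set.Ioi 0) := by
  unfold hOsc
  exact continuousOn_id.mul (Real.continuous_sin.comp_continuousOn
    (continuousOn_const.mul (Real.continuousOn_log.mono fun x hx => ne_of_gt hx)))

/-- **TOY D CARRIES EVERY LETTER OF THE CORNER ROAD, ON THE BOUNDARY `s = 0`**: N17's rate with `c = 0` (autonomous), the history moduli `lamOsc` (`5`-Lipschitz in the last coupling)
with `FadingMemory 5 (1∕2)`, the anchor `b ≡ 0` (`|h(p)| ≤ p`), and the drift of `b ≡ 0` at slope `0` with deviation `0`. [folklore] -/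
theorem letters_betaOsc (γ : ℝ) :
    ScaleShiftRate 0 (1 / 2) γ betaOsc ∧ HistLipschitz lamOsc γ betaOsc ∧ FadingMemory 5 (1 / 2) lamOsc ∧
      ScaleAnchor betaOsc (fun _ => 0) ∧ OneLoopDrift 0 0 (fun _ => (0 : ℝ)) := by
  refine ⟨?_, ?_, ?_, ?_, fun k => by simp⟩
  · intro k w _
    have h2 : Fin.tail w (Fin.last k) = w (Fin.last (k + 1)) := by
      simp only [Fin.tail, Fin.succ_last]
    show |hOsc (w (Fin.last (k + 1))) - hOsc (Fin.tail w (Fin.last k))| ≤ 0 * (1 / 2) ^ k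
    rw [h2]
    simp
  · intro k p q hp hq
    have hp1 : 0 < p (Fin.last k) := ((FlowStep.mem_box.mp hp) (Fin.last k)).1
    have hq1 : 0 < q (Fin.last k) := ((FlowStep.mem_box.mp hq) (Fin.last k)).1
    show |hOsc (p (Fin.last k)) - hOsc (q (Fin.last k))| ≤ _
    rw [Finset.sum_eq_single (Fin.last k)]
    · simpa [lamOsc] using abs_hOsc_sub_le hp1 hq1
    · intro i _ hi
      have hne : (i : ℕ) ≠ k := fun h => hi (Fin.ext (by simp [h]))
      simp [lamOsc, hne]
    · intro h
      exact absurd (Finset.mem_univ _) h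
  · intro k i _
    unfold lamOsc
    split_ifs with h
    · subst h
      simp
    · exact ⟨le_rfl, by positivity⟩
  · intro k δ hδ
    refine ⟨δ, hδ, fun p hp => ?_⟩
    show |hOsc (p (Fin.last k)) - 0| ≤ δ
    rw [sub_zero]
    exact (abs_hOsc_le (hp (Fin.last k)).1.le).trans (hp (Fin.last k)).2

/-- `1 ∕ (e^{−u})² = e^{2u}`. [folklore] -/
theorem one_div_exp_neg_sq (u : ℝ) : 1 / (Real.exp (-u)) ^ 2 = Real.exp (2 * u) := by
  rw [sq, ← Real.exp_add, one_div, ← Real.exp_neg]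
  congr 1
  ring

/-- BACKWARD STEP (IVT): below a zero `ζ ≤ 1` of `h`, every target `0 < g' ≤ ζ` has a pre-image `g ∈ [g'∕2, ζ]` under the (0.20) step: `1∕g² − h(g) = 1∕g'²`. [folklore] -/
theorem backward_step_hOsc {ζ g' : ℝ} (hζ : hOsc ζ = 0) (hg' : 0 < g') (hg'ζ : g' ≤ ζ) (hζ1 : ζ ≤ 1) :
    ∃ g : ℝ, g' / 2 ≤ g ∧ g ≤ ζ ∧ 1 / g ^ 2 - hOsc g = 1 / g' ^ 2 := by
  have hε : 0 < g' / 2 := by positivity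
  have hle : g' / 2 ≤ ζ := by linarith
  have hg'0 : g' ≠ 0 := hg'.ne'
  have hcont : ContinuousOn (fun g : ℝ => 1 / g ^ 2 - hOsc g) (Set.Icc (g' / 2) ζ) := by
    have hsub : Set.Icc (g' / 2) ζ ⊆ Set.Ioi 0 := fun x hx => hε.trans_le hx.1
    refine ContinuousOn.sub ?_ (continuousOn_hOsc.mono hsub)
    exact continuousOn_const.div (continuousOn_id.pow 2) fun x hx => pow_ne_zero 2 (hε.trans_le hx.1).ne'
  have hφζ : 1 / ζ ^ 2 - hOsc ζ ≤ 1 / g' ^ 2 := by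
    rw [hζ, sub_zero]
    exact one_div_le_one_div_of_le (pow_pos hg' 2) (pow_le_pow_left₀ hg'.le hg'ζ 2)
  have hφε : 1 / g' ^ 2 ≤ 1 / (g' / 2) ^ 2 - hOsc (g' / 2) := by
    have h1 : 1 / (g' / 2) ^ 2 = 4 * (1 / g' ^ 2) := by
      field_simp
      ring
    have h2 : hOsc (g' / 2) ≤ g' / 2 := (le_abs_self _).trans (abs_hOsc_le hε.le)
    have h3 : 1 ≤ 1 / g' ^ 2 := by
      rw [le_div_iff₀ (pow_pos hg' 2), one_mul]
      exact pow_le_one₀ hg'.le (hg'ζ.trans hζ1)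
    rw [h1]
    nlinarith
  obtain ⟨g, ⟨hg1, hg2⟩, hg⟩ := intermediate_value_Icc' hle hcont ⟨hφζ, hφε⟩
  exact ⟨g, hg1, hg2, hg⟩

/-- BACKWARD RUNS OF EVERY LENGTH below a zero `ζ ≤ 1` of `h`, ending EXACTLY at any prescribed `0 < g ≤ ζ`, staying in `]0, ζ]`. [folklore] -/
theorem backward_run_hOsc {ζ : ℝ} (hζ : hOsc ζ = 0) (hζ1 : ζ ≤ 1) :
    ∀ (K : ℕ) (g : ℝ), 0 < g → g ≤ ζ → ∃ gs : ℕ → ℝ, gs K = g ∧ (∀ j, j ≤ K → 0 < gs j ∧ gs j ≤ ζ) ∧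
      ∀ j, j < K → 1 / (gs j) ^ 2 - hOsc (gs j) = 1 / (gs (j + 1)) ^ 2 := by
  intro K
  induction K with
  | zero =>
    intro g hg hgζ
    exact ⟨fun _ => g, rfl, fun j _ => ⟨hg, hgζ⟩, fun j hj => absurd hj (Nat.not_lt_zero _)⟩
  | succ K ih =>
    intro g hg hgζ
    obtain ⟨g₁, hg₁l, hg₁ζ, hstep⟩ := backward_step_hOsc hζ hg hgζ hζ1
    have hg₁ : 0 < g₁ := by linarith
    obtain ⟨gs, hK, hbox, hrec⟩ := ih g₁ hg₁ hg₁ζ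
    refine ⟨fun j => if j ≤ K then gs j else g, by simp, fun j hj => ?_, fun j hj => ?_⟩
    · by_cases hjK : j ≤ K
      · simp only [if_pos hjK]
        exact hbox j hjK
      · simp only [if_neg hjK]
        exact ⟨hg, hgζ⟩
    · rcases Nat.lt_succ_iff_lt_or_eq.mp hj with hlt | rfl
      · simp only [if_pos hlt.le, if_pos (Nat.succ_le_of_lt hlt)]
        exact hrec j hlt
      · simp only [if_pos le_rfl, if_neg (Nat.not_succ_le_self j), hK]
        exact hstep

/-- A positive sequence obeying the (0.20) step with `h` IS the run generated by `betaOsc` from its start. [folklore] -/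
theorem genSeq_betaOsc_eq {gs : ℕ → ℝ} {K : ℕ} (hpos : ∀ j, j ≤ K → 0 < gs j)
    (hrec : ∀ j, j < K → 1 / (gs j) ^ 2 - hOsc (gs j) = 1 / (gs (j + 1)) ^ 2) :
    ∀ j, j ≤ K → FlowStepRuns.genSeq betaOsc (gs 0) j = gs j := by
  intro j
  induction j with
  | zero =>
    intro _
    exact FlowStepRuns.genSeq_zero _ _
  | succ j ih =>
    intro hj
    have hj' : j < K := hj
    have e : betaOsc j (prefixOf (FlowStepRuns.genSeq betaOsc (gs 0)) j) = hOsc (gs j) := by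
      show hOsc (prefixOf (FlowStepRuns.genSeq betaOsc (gs 0)) j (Fin.last j)) = hOsc (gs j)
      rw [prefixOf_apply, Fin.val_last, ih hj'.le]
    rw [FlowStepRuns.genSeq_succ, e, ih hj'.le, hrec j hj', solveCoupling_inv_sq (hpos (j + 1) hj)]

/-- **TOY D HAS END** (shooting backwards below a zero of `h`): for a window `γ ≤ 1` take the zero `ζ = e^{−⌈1∕γ⌉} ≤ γ` and `g⋆ := ζ`; every `g ≤ ζ` is reached EXACTLY at every cutoff `K` by a run
inside `]0, ζ] ⊂ ]0, γ]` (`backward_run_hOsc`), which is the run `modelOf betaOsc` generates from its start (`genSeq_betaOsc_eq`). [folklore] -/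
theorem endpointExistence_betaOsc : EndpointExistence (FlowStepRuns.modelOf betaOsc) := by
  intro m
  refine ⟨1, one_pos, fun γ hγ hγ1 => ?_⟩
  have hζγ : Real.exp (-(⌈1 / γ⌉₊ : ℝ)) ≤ γ := by
    have h1 : 1 / γ ≤ (⌈1 / γ⌉₊ : ℝ) := Nat.le_ceil _
    have h2 : (⌈1 / γ⌉₊ : ℝ) + 1 ≤ Real.exp (⌈1 / γ⌉₊ : ℝ) := Real.add_one_le_exp _
    rw [Real.exp_neg, inv_le_comm₀ (Real.exp_pos _) hγ, ← one_div]
    linarith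
  have hζ1 : Real.exp (-(⌈1 / γ⌉₊ : ℝ)) ≤ 1 := hζγ.trans hγ1
  have hζ0 : hOsc (Real.exp (-(⌈1 / γ⌉₊ : ℝ))) = 0 := hOsc_exp_neg_nat _
  refine ⟨Real.exp (-(⌈1 / γ⌉₊ : ℝ)), Real.exp_pos _, fun g hg hgζ K => ?_⟩
  obtain ⟨gs, hK, hbox, hrec⟩ := backward_run_hOsc hζ0 hζ1 K g hg hgζ
  have hgen := genSeq_betaOsc_eq (fun j hj => (hbox j hj).1) hrec
  refine ⟨gs 0, fun k hk => ?_, ?_⟩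
  · show 0 < FlowStepRuns.genSeq betaOsc (gs 0) k ∧ FlowStepRuns.genSeq betaOsc (gs 0) k ≤ γ
    rw [hgen k hk]
    exact ⟨(hbox k hk).1, (hbox k hk).2.trans hζγ⟩
  · show FlowStepRuns.genSeq betaOsc (gs 0) K = g
    rw [hgen K le_rfl, hK]

/-- THE NEGATIVE BAND: for `p ∈ [e^{−(2n+1∕2)}, e^{−(2n+1∕6)}]` one has `sin(π log p) ≤ −1∕2`, so `h(p) ≤ −p∕2`. [folklore] -/
theorem hOsc_le_of_mem_band (n : ℕ) {p : ℝ} (h1 : Real.exp (-(2 * n + 1 / 2)) ≤ p) (h2 : p ≤ Real.exp (-(2 * n + 1 / 6))) :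
    hOsc p ≤ -(p / 2) := by
  have hp : 0 < p := (Real.exp_pos _).trans_le h1
  have hl1 : -(2 * n + 1 / 2) ≤ Real.log p := by
    have := Real.log_le_log (Real.exp_pos _) h1
    rwa [Real.log_exp] at this
  have hl2 : Real.log p ≤ -(2 * n + 1 / 6) := by
    have := Real.log_le_log hp h2
    rwa [Real.log_exp] at this
  -- t := π (−log p − 2n) ∈ [π/6, π/2] and sin (π log p) = − sin t
  have ht1 : Real.pi / 6 ≤ Real.pi * (-Real.log p - 2 * n) := by nlinarith [Real.pi_pos]
  have ht2 : Real.pi * (-Real.log p - 2 * n) ≤ Real.pi / 2 := by nlinarith [Real.pi_pos]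
  have hsin : Real.sin (Real.pi * Real.log p) = -Real.sin (Real.pi * (-Real.log p - 2 * n)) := by
    have e : Real.pi * Real.log p = -(Real.pi * (-Real.log p - 2 * n)) + -((n : ℝ) * (2 * Real.pi)) := by ring
    have h := Real.sin_add_nat_mul_two_pi (-(Real.pi * (-Real.log p - 2 * n)) + -((n : ℝ) * (2 * Real.pi))) n
    rw [e, ← h, ← Real.sin_neg]
    congr 1
    ring
  have hge : 1 / 2 ≤ Real.sin (Real.pi * (-Real.log p - 2 * n)) := by
    rw [← Real.sin_pi_div_six]
    exact Real.sin_le_sin_of_le_of_le_pi_div_two (by linarith [Real.pi_pos]) ht2 ht1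
  unfold hOsc
  rw [hsin]
  nlinarith

/-- **TOY D HAS NO RUN-WISE PARTIAL-SUM FLOOR AT ANY WINDOW** (the forward climb): in every window `]0, γ₀]` the run started at the top `e^{−(2n+1∕6)}` of a deep negative band
(`n ≥ max M γ₀⁻¹`) gains at least `e^{−(2n+1∕2)}∕2` in `1∕g²` per step while inside the band, so it leaves the band downward in `g` after finitely many steps, having accumulated
`Σ β = 1∕g_0² − 1∕g_n² < e^{4n+1∕3} − e^{4n+1} ≤ −M`. [folklore] -/
theorem not_runwiseFloor_betaOsc {γ₀ M : ℝ} (hγ₀ : 0 < γ₀)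
    (hps : ∀ (n : ℕ) (gs : ℕ → ℝ), RGEqH n betaOsc gs → Step.InInterval γ₀ n gs →
      ∀ k, k ≤ n → -M ≤ ∑ j ∈ Finset.Ico k n, betaOsc j (prefixOf gs j)) : False := by
  -- the band
  set n : ℕ := ⌈max M (1 / γ₀)⌉₊ + 1 with hn
  have hnM : M ≤ n := by
    have h1 : M ≤ (⌈max M (1 / γ₀)⌉₊ : ℝ) := (le_max_left _ _).trans (Nat.le_ceil _)
    rw [hn]; push_cast; linarith
  have hnγ : 1 / γ₀ ≤ n := by
    have h1 : 1 / γ₀ ≤ (⌈max M (1 / γ₀)⌉₊ : ℝ) := (le_max_right _ _).trans (Nat.le_ceil _)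
    rw [hn]; push_cast; linarith
  have hn0 : (0 : ℝ) ≤ n := Nat.cast_nonneg n
  set pa : ℝ := Real.exp (-(2 * n + 1 / 2)) with hpa
  set pb : ℝ := Real.exp (-(2 * n + 1 / 6)) with hpb
  have hpa0 : 0 < pa := Real.exp_pos _
  have hpb0 : 0 < pb := Real.exp_pos _
  have hab : pa ≤ pb := Real.exp_le_exp.2 (by linarith)
  have hpbγ : pb ≤ γ₀ := by
    have h2 : (n : ℝ) + 1 ≤ Real.exp n := Real.add_one_le_exp _
    have h3 : pb ≤ Real.exp (-(n : ℝ)) := Real.exp_le_exp.2 (by linarith)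
    refine h3.trans ?_
    rw [Real.exp_neg, inv_le_comm₀ (Real.exp_pos _) hγ₀, ← one_div]
    linarith
  have hxa : 1 / pb ^ 2 = Real.exp (4 * n + 1 / 3) := by rw [hpb, one_div_exp_neg_sq]; congr 1; ring
  have hxb : 1 / pa ^ 2 = Real.exp (4 * n + 1) := by rw [hpa, one_div_exp_neg_sq]; congr 1; ring
  have hgap : M ≤ 1 / pa ^ 2 - 1 / pb ^ 2 := by
    rw [hxa, hxb]
    have e1 : Real.exp (4 * n + 1) = Real.exp (4 * n + 1 / 3) * Real.exp (2 / 3) := by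
      rw [← Real.exp_add]; congr 1; ring
    have e2 : (2 / 3 : ℝ) + 1 ≤ Real.exp (2 / 3) := Real.add_one_le_exp _
    have e3 : 4 * (n : ℝ) + 1 / 3 + 1 ≤ Real.exp (4 * n + 1 / 3) := Real.add_one_le_exp _
    have e4 : (4 * (n : ℝ) + 1 / 3 + 1) * (2 / 3) ≤ Real.exp (4 * n + 1 / 3) * (Real.exp (2 / 3) - 1) :=
      mul_le_mul e3 (by linarith) (by norm_num) (Real.exp_pos _).le
    nlinarith
  -- the forward run from the top of the band
  set gs : ℕ → ℝ := FlowStepRuns.genSeq betaOsc pb with hgs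
  have hgs0 : gs 0 = pb := FlowStepRuns.genSeq_zero _ _
  -- invariant while inside the band
  have claim : ∀ j : ℕ, (∀ i, i < j → pa ≤ gs i) →
      0 < gs j ∧ 1 / pb ^ 2 + j * (pa / 2) ≤ 1 / (gs j) ^ 2 ∧ RGEqH j betaOsc gs := by
    intro j
    induction j with
    | zero =>
      intro _
      refine ⟨by rw [hgs0]; exact hpb0, by rw [hgs0]; simp, fun k hk => absurd hk (Nat.not_lt_zero _)⟩
    | succ j ih =>
      intro hband
      obtain ⟨hpos, hx, hrg⟩ := ih fun i hi => hband i (Nat.lt_succ_of_lt hi)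
      have hlo : pa ≤ gs j := hband j (Nat.lt_succ_self j)
      have hhi : gs j ≤ pb := by
        refine le_of_inv_sq_le hpos hpb0 ?_
        have : (0 : ℝ) ≤ j * (pa / 2) := by positivity
        linarith
      have hh : hOsc (gs j) ≤ -(gs j / 2) := hOsc_le_of_mem_band n hlo hhi
      have hβ : betaOsc j (prefixOf gs j) = hOsc (gs j) := by
        show hOsc (prefixOf gs j (Fin.last j)) = hOsc (gs j)
        rw [prefixOf_apply, Fin.val_last]
      have harg : 0 < 1 / (gs j) ^ 2 - betaOsc j (prefixOf gs j) := by
        rw [hβ]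
        have : 0 < 1 / (gs j) ^ 2 := by positivity
        linarith
      have hsucc : gs (j + 1) = FlowStepRuns.solveCoupling (1 / (gs j) ^ 2 - betaOsc j (prefixOf gs j)) := by
        rw [hgs, FlowStepRuns.genSeq_succ]
      have hpos' : 0 < gs (j + 1) := by rw [hsucc]; exact FlowStepRuns.solveCoupling_pos harg
      have hinv : 1 / (gs (j + 1)) ^ 2 = 1 / (gs j) ^ 2 - betaOsc j (prefixOf gs j) := by
        rw [hsucc, FlowStepRuns.inv_sq_solveCoupling harg]
      refine ⟨hpos', ?_, fun k hk => ?_⟩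
      · rw [hinv, hβ]
        push_cast
        nlinarith
      · rcases Nat.lt_succ_iff_lt_or_eq.mp hk with hlt | rfl
        · exact hrg k hlt
        · rw [hinv]
          ring
  -- the run leaves the band
  have hex : ∃ j, gs j < pa := by
    by_contra hno
    have hall : ∀ i, pa ≤ gs i := fun i => not_lt.mp fun h => hno ⟨i, h⟩
    set N : ℕ := ⌈(1 / pa ^ 2 - 1 / pb ^ 2) / (pa / 2)⌉₊ + 1 with hN
    obtain ⟨hposN, hxN, -⟩ := claim N fun i _ => hall i
    have h1 : 1 / (gs N) ^ 2 ≤ 1 / pa ^ 2 := one_div_le_one_div_of_le (pow_pos hpa0 2) (pow_le_pow_left₀ hpa0.le (hall N) 2)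
    have h2 : (1 / pa ^ 2 - 1 / pb ^ 2) / (pa / 2) < N := by
      have := Nat.lt_floor_add_one ((1 / pa ^ 2 - 1 / pb ^ 2) / (pa / 2))
      have h' : (⌊(1 / pa ^ 2 - 1 / pb ^ 2) / (pa / 2)⌋₊ : ℝ) ≤ ⌈(1 / pa ^ 2 - 1 / pb ^ 2) / (pa / 2)⌉₊ := by
        exact_mod_cast Nat.floor_le_ceil _
      rw [hN]; push_cast; linarith
    have h3 : 1 / pa ^ 2 - 1 / pb ^ 2 < N * (pa / 2) := by
      rwa [div_lt_iff₀ (by positivity)] at h2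
    linarith
  classical
  let nx := Nat.find hex
  have hnx : gs nx < pa := Nat.find_spec hex
  have hmin : ∀ i, i < nx → pa ≤ gs i := fun i hi => not_lt.mp (Nat.find_min hex hi)
  obtain ⟨hposx, hxx, hrgx⟩ := claim nx hmin
  have hI : Step.InInterval γ₀ nx gs := by
    intro k hk
    obtain ⟨hposk, hxk, -⟩ := claim k fun i hi => hmin i (lt_of_lt_of_le hi hk)
    refine ⟨hposk, (le_of_inv_sq_le hposk hpb0 ?_).trans hpbγ⟩
    have : (0 : ℝ) ≤ k * (pa / 2) := by positivity
    linarith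
  have hsum := hps nx gs hrgx hI 0 (Nat.zero_le _)
  have htel := inv_sq_telescopeH hrgx (Nat.zero_le nx) le_rfl
  have hbig : 1 / pa ^ 2 < 1 / (gs nx) ^ 2 := one_div_lt_one_div_of_lt (pow_pos hposx 2) (pow_lt_pow_left₀ hnx hposx.le two_ne_zero)
  rw [hgs0] at htel
  linarith

/-- **TOY D IS NOT A ROWS TUPLE**: no `RunRowsShape betaOsc` — the floor (iv) fails at every window (`not_runwiseFloor_betaOsc`). [folklore] -/
theorem not_runRowsShape_betaOsc : ¬ RunRowsShape betaOsc := by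
  rintro ⟨b, r, γ₀, M, hγ₀, -, hps, -⟩
  exact not_runwiseFloor_betaOsc hγ₀ hps

/-- **T16 ★★★ THE END-SURPLUS OF K1⁸'s ROWS IS NONEMPTY ON LETTER TUPLES, AND SITS ON THE BOUNDARY `s = 0`** — TOY D `betaOsc` carries every U3 letter (N17 rate `c = 0`, moduli `5·δ_{ik}` with
`FadingMemory 5 (1∕2)`), the anchor `b ≡ 0`, the drift at slope `0`, AND END, and is NOT a rows tuple.  With T10∕T14: on letter tuples `0 < s ⟹ rows ⟹ END ⟹ 0 ≤ s`, the boundary `{s = 0}`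
carries TOY A (END ∧ rows), TOY B (¬END) and TOY D (END ∧ ¬rows) — K1⁸'s displayed row (iv) is GENUINE CONTENT beyond END even for history-Lipschitz, fading, scale-stationary β.  A statement about
the TOY; nothing of Bałaban asserted; K1⁸ NOT proved or refuted. [folklore] -/
theorem letters_end_not_rows (γ : ℝ) :
    ScaleShiftRate 0 (1 / 2) γ betaOsc ∧ HistLipschitz lamOsc γ betaOsc ∧ FadingMemory 5 (1 / 2) lamOsc ∧ ScaleAnchor betaOsc (fun _ => 0) ∧
      OneLoopDrift 0 0 (fun _ => (0 : ℝ)) ∧ EndpointExistence (FlowStepRuns.modelOf betaOsc) ∧ ¬ RunRowsShape betaOsc :=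
  let h := letters_betaOsc γ
  ⟨h.1, h.2.1, h.2.2.1, h.2.2.2.1, h.2.2.2.2, endpointExistence_betaOsc, not_runRowsShape_betaOsc⟩

/-- **T16′ — LETTERS + END ⇏ ROWS** (so T11's `0 < s` cannot be weakened to `0 ≤ s`, and T10's right-hand side (iv) is not implied by END on letter tuples). [folklore] -/
theorem not_rows_of_letters_end :
    ¬ ∀ (β : HBeta) (Λ : ℕ → ℕ → ℝ) (c C ρ γ : ℝ) (b : ℕ → ℝ) (A : ℝ), 0 < γ → 0 ≤ ρ → ρ < 1 →
      ScaleShiftRate c ρ γ β → HistLipschitz Λ γ β → FadingMemory C ρ Λ → ScaleAnchor β b → OneLoopDrift 0 A b →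
        EndpointExistence (FlowStepRuns.modelOf β) → RunRowsShape β := by
  intro h
  obtain ⟨h1, h2, h3, h4, h5, h6, h7⟩ := letters_end_not_rows 1
  exact h7 (h betaOsc lamOsc 0 5 (1 / 2) 1 (fun _ => 0) 0 one_pos (by norm_num) (by norm_num) h1 h2 h3 h4 h5 h6)

end LetterToy

/-! ## §9 (EDITION 3.3, g12) THE MEMORY-LETTER INVERSION — run the dependency of T11∕T13 BACKWARDS through the letters: which part of U3ᴷ do K1⁸'s rows actually consume?
ANSWER (kernel-checked below): of `FadingMemory C ρ Λ` only the k-UNIFORM ROW SUM `Σ_i |Λ k i| ≤ L` (no geometric profile, no rate `ρ`), and of N17's `ScaleShiftRate` NOTHING.  So T11∕T12∕T13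
factor through the F-E-SAFE re-cut U3ᴷ♭ := «history moduli with bounded row sums» (T11♭∕T12♭∕T13♭, `u3KFlat_of_u3K`).  WHY THIS MATTERS NOW (CRIT-2 ADDENDUM-2 H_FE′ ∕ idea-5 g12 BN-N ∕ CRIT-1 g6
O-1): modulo first-entry-only β (what H_FE′ makes of the tree's free-history object) BOTH registered U3 rate letters force GEOMETRIC RIGIDITY of `β_k` in the initial coupling — idea-5's
`geomRigid_of_firstEntryOnly_fading` for the fading pair, and ★ `geomRigid_of_firstEntryOnly_scaleShiftRate` below for N17's `ScaleShiftRate` (it compares `β (k+1) w`, which reads `w 0`, with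
`β k (Fin.tail w)`, which reads `w 1`, at INDEPENDENT box arguments) — while the one-loop marginal transport has only algebraic decay (idea-5 `marginalTransport_not_geomFading`); so CRIT-1's
recommended re-key U3ᴷ⁻ = {ScaleShiftRate, HistLipschitz} inherits BN-N exactly as U3ᴷ does.  U3ᴷ♭ does NOT: TOY F `betaMT` (one-loop value `1` plus a (1.22)-size remainder read at the
coupling transported `k` marginal steps, `β_{k+1}(g_0,…) = 1 + g_0²∕(1 + k g_0²)`) is first-entry-only, carries U3ᴷ♭ (moduli `2γ·δ_{i0}`, row sum `2γ`), the anchor `b ≡ 1`, the drift at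
slope `1 > 0`, (C), the ROWS (by T11♭ itself) and END — and carries NEITHER N17's rate letter (for any `c`, `ρ < 1`) NOR any fading-compatible moduli.  TOY E `betaSq`
(`β_{k+1}(g_0,…) = 1 + (k+1)² g_0`): history-Lipschitz (row sum `(k+1)²`, unbounded), anchored at `1`, drifting at slope `1`, (C) — and NO ROWS at any window (row (i) fails along explicit
in-window runs): in T11♭ the row-sum letter is LOAD-BEARING, first-entry currency or not.  Plus ROUND-6 nits N-a∕N-b: T13♭ keyed by the TREE names `…K2V7Defs.CornerDriftPos` (2ᶜᴰ, `Iff.rfl`)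
and T15 stated for DEF-1's `…K1R8RowsDefs.Cont13All` (`Iff.rfl`; tree twin of T15 = PORT-1 p620216 `…K2CornerRoadRows.cont13All_of_histModuliK`, of T13 = its
`stabilityBRunRowsAtRecordR13SepCoPH_of_k17_u3K_cornerDriftPosK`, which consumes `ScaleShiftRate` + `HistLipschitz` — the other two letters; T13♭ consumes `HistLipschitz` + row sums only). -/

section MemoryInversion

open Summit.QuantumFields.YangMills.Theorems.BalabanUVNodesK2NamedJetsRunRemAt (RunConstRemainder SurvCont Survivors runwisePS_of_drift_runConstRemainder)
open YMDAG.N18.CornerBandOfKernelLetters (abs_sub_le_sum_of_anchor_of_histLipschitz abs_sub_le_mul_of_band sum_abs_moduli_le_of_fadingMemory)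

variable {β : HBeta} {b : ℕ → ℝ}

/-- HYPOTHESIS SHAPE (never a fact): **ROW-SUM MEMORY** — the TOTAL history modulus of scale `k`, `Σ_{i ≤ k} |Λ k i|`, is bounded by `L` UNIFORMLY in `k`.  The part of node U3's
`FadingMemory C ρ Λ` (`Λ k i ≤ C ρ^{k−i}`: a geometric PROFILE) that K1⁸'s row (i) consumes; no profile, no rate.  For a first-entry-only β it says: `β_{k+1}` is `L`-Lipschitz in the
initial coupling `g_0`, uniformly in `k` — NON-GROWTH of the memory, not its fading. [cite: Balaban1987RG1, section 5 p.298 and (2.12)-(2.14) p.268] -/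
def RowSumMemory (L : ℝ) (Λ : ℕ → ℕ → ℝ) : Prop :=
  ∀ k : ℕ, ∑ i : Fin (k + 1), |Λ k i| ≤ L

/-- A row-sum bound is `≥ 0`. [folklore] -/
theorem RowSumMemory.nonneg {L : ℝ} {Λ : ℕ → ℕ → ℝ} (h : RowSumMemory L Λ) : 0 ≤ L := by
  have h0 : (0 : ℝ) ≤ ∑ i : Fin (0 + 1), |Λ 0 i| := Finset.sum_nonneg fun i _ => abs_nonneg _
  exact h0.trans (h 0)

/-- **FADING ⟹ ROW SUMS** (`0 ≤ ρ < 1`): `FadingMemory C ρ Λ → RowSumMemory (C(1−ρ)⁻¹) Λ` — dag-n18-w1's `sum_abs_moduli_le_of_fadingMemory` BY NAME.  The converse fails (TOY F's moduli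
`2γ·δ_{i0}`: row sum `2γ`, entry-0 modulus NOT `≤ Cρ^k`). [folklore] -/
theorem rowSumMemory_of_fadingMemory {C ρ : ℝ} {Λ : ℕ → ℕ → ℝ} (hΛ : FadingMemory C ρ Λ) (hρ0 : 0 ≤ ρ) (hρ1 : ρ < 1) :
    RowSumMemory (C * (1 - ρ)⁻¹) Λ :=
  fun k => sum_abs_moduli_le_of_fadingMemory hΛ hρ0 hρ1 k

/-- **ROW (i) FROM THE MODULI WITH BOUNDED ROW SUMS, AT EVERY WINDOW `γ₀ ≤ γ`**: `HistLipschitz Λ γ β` + `RowSumMemory L Λ` + the anchor `b` ⟹ `RunConstRemainder β b (L·γ₀) γ₀`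
(dag-n18-w1's linear band `|β_k(p) − b_k| ≤ Σ_i |Λ k i|·p_i` BY NAME, read along runs).  §7's `runConstRemainder_of_histLipschitz_fadingMemory` is this ∘ `rowSumMemory_of_fadingMemory`.
CONDITIONAL on the letters; nothing of Bałaban asserted. [cite: Balaban1987RG1, (2.12)-(2.14) p.268, Thm 3 p.264 and section 5 p.298] -/
theorem runConstRemainder_of_histLipschitz_rowSum {Λ : ℕ → ℕ → ℝ} {L γ : ℝ} (hL : HistLipschitz Λ γ β) (hS : RowSumMemory L Λ) (hb : ScaleAnchor β b)
    {γ₀ : ℝ} (hle : γ₀ ≤ γ) : RunConstRemainder β b (L * γ₀) γ₀ :=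
  fun _ _ _ hI k hk => by
    have hγ₀ : 0 ≤ γ₀ := (hI 0 (Nat.zero_le _)).1.le.trans (hI 0 (Nat.zero_le _)).2
    exact (abs_sub_le_mul_of_band (fun k _ hp => abs_sub_le_sum_of_anchor_of_histLipschitz hL hb k hp) hle k
      (prefixOf_mem_histBox_of_inInterval hI hk)).trans (mul_le_mul_of_nonneg_right (hS k) hγ₀)

/-- **T10♭ — THE LETTER-COLLAPSE WITH ROW SUMS IN PLACE OF FADING**: under `HistLipschitz Λ γ β` + `RowSumMemory L Λ` (`0 < γ`) rows (i) and (C) are free at every window `≤ γ`, so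
`RunRowsShape β` ⟺ «some window carries (iv)».  CONDITIONAL. [cite: Balaban1987RG1, Thm 3 p.264, (2.12)-(2.14) p.268 and section 5 p.298] -/
theorem runRowsShape_iff_runwisePS_of_histLipschitz_rowSum {Λ : ℕ → ℕ → ℝ} {L γ : ℝ} (hγ : 0 < γ) (hL : HistLipschitz Λ γ β) (hS : RowSumMemory L Λ) :
    RunRowsShape β ↔ ∃ (γ₀ M : ℝ), 0 < γ₀ ∧
      ∀ (n : ℕ) (gs : ℕ → ℝ), RGEqH n β gs → Step.InInterval γ₀ n gs → ∀ k, k ≤ n → -M ≤ ∑ j ∈ Finset.Ico k n, β j (prefixOf gs j) := by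
  constructor
  · rintro ⟨b, r, γ₀, M, hγ₀, -, hps, -⟩
    exact ⟨γ₀, M, hγ₀, hps⟩
  · rintro ⟨γ₀, M, hγ₀, hps⟩
    obtain ⟨b, hb⟩ := exists_scaleAnchor_of_histLipschitz hγ hL
    have hmin : 0 < min γ₀ γ := lt_min hγ₀ hγ
    refine ⟨b, L * min γ₀ γ, min γ₀ γ, M, hmin, runConstRemainder_of_histLipschitz_rowSum hL hS hb (min_le_right _ _), ?_,
      survCont_of_histLipschitz hL hmin (min_le_right _ _)⟩
    intro n gs hrg hI k hk
    exact hps n gs hrg (fun j hj => ⟨(hI j hj).1, (hI j hj).2.trans (min_le_left _ _)⟩) k hk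

/-- **T11♭ ★★ 2ᶜᴰ + MODULI WITH BOUNDED ROW SUMS BUY THE ROWS** (no fading profile, no N17 rate, no (190)-chain): `HistLipschitz Λ γ β` + `RowSumMemory L Λ` + an anchored corner sequence `b`
drifting at a slope `s > 0` ⟹ `RunRowsShape β` — window `γ₀ := min γ (s∕(L+1))` so that the band `L·γ₀ ≤ s`, floor `2A` by DEF-1's `runwisePS_of_drift_runConstRemainder`, (C) from the moduli.
T11 = T11♭ ∘ `rowSumMemory_of_fadingMemory`.  The row-sum letter is LOAD-BEARING (TOY E below).  CONDITIONAL on hypothesis shapes; nothing of Bałaban asserted.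
[cite: Balaban1987RG1, Thm 3 p.264, (1.3) p.260, (2.12)-(2.14) p.268 and (5.10) p.293] -/
theorem runRowsShape_of_histLipschitz_rowSum_cornerDriftPos {Λ : ℕ → ℕ → ℝ} {L γ s A : ℝ} (hγ : 0 < γ) (hL : HistLipschitz Λ γ β) (hS : RowSumMemory L Λ)
    (hb : ScaleAnchor β b) (hdrift : OneLoopDrift s A b) (hs : 0 < s) : RunRowsShape β := by
  have hL0 : 0 ≤ L := hS.nonneg
  have hx1 : 0 < L + 1 := by linarith
  have hγ₀pos : 0 < min γ (s / (L + 1)) := lt_min hγ (div_pos hs hx1)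
  have hle : min γ (s / (L + 1)) ≤ γ := min_le_left _ _
  have hr : L * min γ (s / (L + 1)) ≤ s := by
    have h1 : min γ (s / (L + 1)) ≤ s / (L + 1) := min_le_right _ _
    have h2 : L * (s / (L + 1)) ≤ s := by
      rw [← mul_div_assoc, div_le_iff₀ hx1]
      nlinarith
    exact (mul_le_mul_of_nonneg_left h1 hL0).trans h2
  have hrem := runConstRemainder_of_histLipschitz_rowSum hL hS hb hle
  exact ⟨b, _, _, 2 * A, hγ₀pos, hrem, runwisePS_of_drift_runConstRemainder hdrift hrem hr, survCont_of_histLipschitz hL hγ₀pos hle⟩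

/-- HYPOTHESIS SHAPE U3ᴷ♭ — **THE F-E-SAFE RE-CUT OF U3ᴷ**: at every tuple of the crux's prefix, history moduli of the datum's β on `]0, θ.γ]` WITH BOUNDED ROW SUMS — `HistLipschitz Λ θ.γ`
∧ `RowSumMemory L Λ`.  No N17 rate, no fading profile.  Implied by U3ᴷ (`u3KFlat_of_u3K`); NOT conversely (TOY F).  Never a fact; inhabited at no θ here.
[cite: Balaban1987RG1, section 5 p.298, (2.12)-(2.14) p.268 and (1.20)-(1.22) p.264] -/
def U3KFlat : Prop :=
  ∀ (F : T4Family) (θ : Node00.Stage13HParams F 2) (hP : θ.Provisos₁₃SepCoPH F 2), (θ.ZhUnity F 2 ∧ θ.SlotsNondegenerate₁₃ F 2) → θ.Admissible F 2 →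
    B16.EndStatementBPrinted (Node00.datumOfRecord₁₃SepCoPH F 2 θ hP).C → Window13 F θ hP →
    ∃ (L : ℝ) (Λ : ℕ → ℕ → ℝ), HistLipschitz Λ θ.γ (Node00.datumOfRecord₁₃SepCoPH F 2 θ hP).βfun ∧ RowSumMemory L Λ

/-- U3ᴷ ⟹ U3ᴷ♭ (drop N17's rate, flatten the fading profile to its row sums). [folklore] -/
theorem u3KFlat_of_u3K (h : U3K) : U3KFlat := by
  intro F θ hP hU hθ hB hwin
  obtain ⟨c, C, ρ, Λ, -, hρ0, hρ1, -, hL, hΛ⟩ := h F θ hP hU hθ hB hwin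
  exact ⟨_, Λ, hL, rowSumMemory_of_fadingMemory hΛ hρ0.le hρ1⟩

/-- **T12♭ ★★ AT THE RECORD: U3ᴷ♭ + 2ᶜᴰ ⟹ THE ∀θ ROWS PROGRAMME** (T12 with the re-cut letters; T12 = T12♭ ∘ `u3KFlat_of_u3K`).  CONDITIONAL on two hypothesis shapes; nothing of
Bałaban asserted. [cite: Balaban1987RG1, Thm 3 p.264, (1.3) p.260 and (2.12)-(2.14) p.268] -/
theorem runRowsAll_of_u3KFlat_cornerDriftPos (hU3 : U3KFlat) (hCD : CornerDriftPos) :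
    ∀ (F : T4Family) (θ : Node00.Stage13HParams F 2) (hP : θ.Provisos₁₃SepCoPH F 2), (θ.ZhUnity F 2 ∧ θ.SlotsNondegenerate₁₃ F 2) → θ.Admissible F 2 →
      B16.EndStatementBPrinted (Node00.datumOfRecord₁₃SepCoPH F 2 θ hP).C → Window13 F θ hP →
      RunRowsShape (Node00.betaOfRecord₁₃ F 2 θ.toStage13Params) := by
  intro F θ hP hU hθ hB hwin
  obtain ⟨L, Λ, hL, hS⟩ := hU3 F θ hP hU hθ hB hwin
  obtain ⟨b, s, A, hb, hs, hdrift⟩ := hCD F θ hP hU hθ hB hwin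
  exact runRowsShape_of_histLipschitz_rowSum_cornerDriftPos hθ.toStage12.toStage9.gamma_pos hL hS hb hdrift hs

/-- **T13♭ ★★★ {K1⁷, U3ᴷ♭, 2ᶜᴰ} ⟹ K1⁸ BY NAME** — the supplier line of T13 with U3ᴷ RE-CUT to the moduli-with-row-sums letter: no N17 rate, no fading profile, no (190)-chain stub.
CONDITIONAL on THREE hypothesis shapes, none inhabited here; K1⁸ (stmt-26907) NOT proved; nothing of Bałaban asserted.
[cite: Balaban1987RG1, Thm 2 p.259 (first sentence), Thm 3 p.264, (1.3) p.260 and (2.12)-(2.14) p.268] -/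
theorem k1R8_of_k1R7_u3KFlat_cornerDriftPos (hK17 : Summit.QuantumFields.YangMills.Theses.BalabanUVNodes.StabilityBAtRecordR13SepCoPH) (hU3 : U3KFlat)
    (hCD : CornerDriftPos) : Summit.QuantumFields.YangMills.Theses.BalabanUVNodes.StabilityBRunRowsAtRecordR13SepCoPH := by
  intro F hF
  obtain ⟨θ, hP, hU, hθ, hB, hwin⟩ := hK17 F hF
  exact ⟨θ, hP, hU, hθ, hB, hwin, runRowsAll_of_u3KFlat_cornerDriftPos hU3 hCD F θ hP hU hθ hB hwin⟩

/-- T13 RE-DERIVED as T13♭ ∘ `u3KFlat_of_u3K` (same statement as §7's `k1R8_of_k1R7_u3K_cornerDriftPos`): the N17 and fading conjuncts of U3ᴷ are IDLE for K1⁸'s rows. [folklore] -/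
theorem k1R8_of_k1R7_u3K_cornerDriftPos_viaFlat (hK17 : Summit.QuantumFields.YangMills.Theses.BalabanUVNodes.StabilityBAtRecordR13SepCoPH) (hU3 : U3K)
    (hCD : CornerDriftPos) : Summit.QuantumFields.YangMills.Theses.BalabanUVNodes.StabilityBRunRowsAtRecordR13SepCoPH :=
  k1R8_of_k1R7_u3KFlat_cornerDriftPos hK17 (u3KFlat_of_u3K hU3) hCD

/-! ### ROUND-6 nits N-a ∕ N-b: key by the TREE names (DEF-1's `K2V7Defs` ∕ `K1R8RowsDefs`, PORT-1 p620216's twins) -/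

/-- **N-a: §2's `CornerDriftPos` (the registered 2ᶜᴰ text, copied at :225) IS DEF-1's tree name `…Theorems.BalabanUVNodesK2V7Defs.CornerDriftPos`** (`DriftPosOver (ScaleAnchor ∘ βfun)`),
`Iff.rfl` — so every theorem of this file keyed on `CornerDriftPos` is keyed on the tree name of the registered stub `stub_cornerDriftPos13`. [folklore] -/
theorem cornerDriftPos_iff_tree : CornerDriftPos ↔ Summit.QuantumFields.YangMills.Theorems.BalabanUVNodesK2V7Defs.CornerDriftPos :=
  Iff.rfl

/-- **T13♭ BY THE TREE NAMES**: K1⁷ (route decl) + U3ᴷ♭ + `K2V7Defs.CornerDriftPos` ⟹ K1⁸ (route decl).  CONDITIONAL; K1⁸ NOT proved. [cite: Balaban1987RG1, Thm 2 p.259 (first sentence) and Thm 3 p.264] -/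
theorem k1R8_of_k1R7_u3KFlat_cornerDriftPosTree (hK17 : Summit.QuantumFields.YangMills.Theses.BalabanUVNodes.StabilityBAtRecordR13SepCoPH) (hU3 : U3KFlat)
    (hCD : Summit.QuantumFields.YangMills.Theorems.BalabanUVNodesK2V7Defs.CornerDriftPos) :
    Summit.QuantumFields.YangMills.Theses.BalabanUVNodes.StabilityBRunRowsAtRecordR13SepCoPH :=
  k1R8_of_k1R7_u3KFlat_cornerDriftPos hK17 hU3 (cornerDriftPos_iff_tree.2 hCD)

/-- **N-b: §8's `Cont13AllText` IS DEF-1's tree name `…Theorems.BalabanUVNodesK1R8RowsDefs.Cont13All`** (p616926 :74), `Iff.rfl`. [folklore] -/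
theorem cont13AllText_iff_tree : Cont13AllText ↔ Summit.QuantumFields.YangMills.Theorems.BalabanUVNodesK1R8RowsDefs.Cont13All :=
  Iff.rfl

/-- **T15 BY NAME**: the history-Lipschitz letter at every provisos-admissible tuple ⟹ DEF-1's `Cont13All`.  TREE TWIN (same content, hypothesis spelt over `(datumOfRecord₁₃SepCoPH F 2 θ hP).βfun`):
PORT-1 p620216 `…K2CornerRoadRows.cont13All_of_histModuliK` — used here AS the proof (the two hypothesis spellings are definitionally equal). CONDITIONAL. [cite: Balaban1987RG1, section 1 pp.263-264 and section 5 p.298] -/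
theorem cont13AllTree_of_histLipschitzAll13 (hL : HistLipschitzAll13) : Summit.QuantumFields.YangMills.Theorems.BalabanUVNodesK1R8RowsDefs.Cont13All :=
  Summit.QuantumFields.YangMills.Theorems.BalabanUVNodesK2CornerRoadRows.cont13All_of_histModuliK hL

end MemoryInversion

/-! ### §9b FIRST-ENTRY CURRENCY: N17's rate letter inherits BN-N; TOY F (marginal transport) travels the re-cut road with rows and END but carries neither rate letter; TOY E: no row sums, no rows -/

section FirstEntry

open Summit.QuantumFields.YangMills.Theorems.BalabanUVNodesK2NamedJetsRunRemAt (RunConstRemainder SurvCont Survivors)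

variable {β : HBeta}

/-- **FIRST-ENTRY-ONLY shape** — idea-5 g12's `Idea5g12RunCurrencySketch5.FirstEntryOnly` (§11·N :1455) VERBATIM (that crux workfile is not imported; same text): on each punctured box
`β k p` depends on `p 0` alone — what CRIT-2 ADDENDUM-2's H_FE′ makes of the tree's free-history β (print's `β_{k+1}(g_k)` transported along the self-generated run from `g_0`).  Never asserted
of a record. [folklore] -/
def FirstEntryOnly (β : HBeta) (γ₀ : ℝ) : Prop :=
  ∀ (k : ℕ) (p q : Fin (k + 1) → ℝ), p ∈ HistBox γ₀ k → q ∈ HistBox γ₀ k → p 0 = q 0 → β k p = β k q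

/-- Prepending an admissible initial coupling keeps a history in the punctured box. [folklore] -/
theorem cons_mem_histBox {γ : ℝ} {k : ℕ} {x : ℝ} {p : Fin (k + 1) → ℝ} (hx : 0 < x ∧ x ≤ γ) (hp : p ∈ HistBox γ k) :
    (Fin.cons x p : Fin (k + 2) → ℝ) ∈ HistBox γ (k + 1) := fun i => by
  refine Fin.cases ?_ (fun j => ?_) i
  · simpa using hx
  · simpa using hp j

/-- **★★ N17's RATE LETTER INHERITS BN-N — GEOMETRIC RIGIDITY IN THE INITIAL COUPLING FROM `ScaleShiftRate` MODULO FIRST-ENTRY-ONLY (proved).**  `ScaleShiftRate c ρ γ β` bounds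
`|β (k+1) w − β k (Fin.tail w)|` by `c ρ^k` for EVERY `w ∈ ]0,γ]^{k+2}`; but `β (k+1) w` reads `w 0` while `β k (Fin.tail w)` reads `w 1` — INDEPENDENT coordinates.  Prepending the SAME
head `p 0` to two level-`k` histories `p`, `q` makes the two level-`(k+1)` values EQUAL (first-entry-only), whence `|β k p − β k q| ≤ 2 c ρ^k` on the WHOLE box: the dependence of `β_{k+1}` on
the initial coupling dies GEOMETRICALLY — the same rigidity idea-5's `geomRigid_of_firstEntryOnly_fading` derives from the fading pair, now from N17's letter ALONE (no moduli at all).  For the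
tree's object modulo H_FE′ the actual oscillation is ≍ print's remainder at the transported coupling `g_k(γ) ≍ (γ⁻² + b₀k)^{−1∕2}` — ALGEBRAIC in `k` (idea-5 `marginalTransport_not_geomFading`;
TOY F below) — so CRIT-1 g6 O-1's re-key U3ᴷ⁻ = {ScaleShiftRate, HistLipschitz} and the `hss` binder of PORT-1 p620216's road are presumptively uninhabited at the current record for the same
reason U3ᴷ's fading pair is.  A statement about hypothesis SHAPES; nothing of Bałaban asserted. [cite: Balaban1987RG1, (1.20)-(1.22) p.264 and section 5 p.298] -/
theorem geomRigid_of_firstEntryOnly_scaleShiftRate {c ρ γ : ℝ} (hFE : FirstEntryOnly β γ) (hss : ScaleShiftRate c ρ γ β) (k : ℕ) {p q : Fin (k + 1) → ℝ}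
    (hp : p ∈ HistBox γ k) (hq : q ∈ HistBox γ k) : |β k p - β k q| ≤ 2 * (c * ρ ^ k) := by
  have hwm : (Fin.cons (p 0) p : Fin (k + 2) → ℝ) ∈ HistBox γ (k + 1) := cons_mem_histBox (hp 0) hp
  have hw'm : (Fin.cons (p 0) q : Fin (k + 2) → ℝ) ∈ HistBox γ (k + 1) := cons_mem_histBox (hp 0) hq
  have he : β (k + 1) (Fin.cons (p 0) p) = β (k + 1) (Fin.cons (p 0) q) :=
    hFE (k + 1) _ _ hwm hw'm (by simp)
  have h1 : |β (k + 1) (Fin.cons (p 0) p) - β k p| ≤ c * ρ ^ k := by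
    have h := hss k (Fin.cons (p 0) p) (by rw [← histBox_eq_box]; exact hwm)
    rwa [Fin.tail_cons] at h
  have h2 : |β (k + 1) (Fin.cons (p 0) q) - β k q| ≤ c * ρ ^ k := by
    have h := hss k (Fin.cons (p 0) q) (by rw [← histBox_eq_box]; exact hw'm)
    rwa [Fin.tail_cons] at h
  have e : β k p - β k q = (β (k + 1) (Fin.cons (p 0) q) - β k q) - (β (k + 1) (Fin.cons (p 0) p) - β k p) := by
    rw [he]; ring
  rw [e]
  exact (abs_sub _ _).trans (by linarith)

/-- Hence N17's letter cannot hold, for ANY `c` and `ρ < 1` (`0 ≤ ρ`), for a first-entry-only β whose level-`k` oscillation in the initial coupling is not geometrically small: if two box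
histories per level are `≥ e_k` apart in β-value with `e_k` not `O(ρ^k)`, `ScaleShiftRate` fails.  (Use form.) [folklore] -/
theorem not_scaleShiftRate_of_firstEntryOnly_gap {c ρ γ : ℝ} (hFE : FirstEntryOnly β γ)
    (hgap : ∀ K : ℝ, ∃ (k : ℕ) (p q : Fin (k + 1) → ℝ), p ∈ HistBox γ k ∧ q ∈ HistBox γ k ∧ K * ρ ^ k < β k p - β k q) :
    ¬ ScaleShiftRate c ρ γ β := fun hss => by
  obtain ⟨k, p, q, hp, hq, hlt⟩ := hgap (2 * c)
  have h := geomRigid_of_firstEntryOnly_scaleShiftRate hFE hss k hp hq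
  have h' : β k p - β k q ≤ 2 * (c * ρ ^ k) := (le_abs_self _).trans h
  linarith

/-! #### TOY F `betaMT` — the one-loop MARGINAL TRANSPORT toy (BN-N's factor as a β-family): the re-cut road is inhabited, both rate letters fail -/

/-- TOY F: `β_{k+1}(g_0, …, g_k) := 1 + g_0² ∕ (1 + k·g_0²)` — the one-loop number `1` plus a (1.22)-size remainder `g²` read at the coupling TRANSPORTED `k` marginal steps from the initial one
(`g_k² = g_0²∕(1 + k g_0²)` along the toy AF run `1∕g_k² = 1∕g_0² + k`).  First-entry-only by construction.  A TOY, not Bałaban's β. [folklore] -/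
def betaMT : HBeta := fun k p => 1 + (p 0) ^ 2 / (1 + k * (p 0) ^ 2)

/-- TOY F's history moduli on `]0, γ]`: `2γ` at entry `0`, zero elsewhere (row sum `2γ`, NOT fading). [folklore] -/
def lamMT (γ : ℝ) : ℕ → ℕ → ℝ := fun _ i => if i = 0 then 2 * γ else 0

/-- The transported square `x ↦ x²∕(1 + k x²)` is `2γ`-Lipschitz on `]0, γ]` (`k ≥ 0`): `|x²∕(1+kx²) − y²∕(1+ky²)| = |x² − y²|∕((1+kx²)(1+ky²)) ≤ |x − y|(x + y)`. [folklore] -/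
theorem abs_mt_sub_mt_le {k : ℝ} (hk : 0 ≤ k) {x y γ : ℝ} (hx : 0 < x ∧ x ≤ γ) (hy : 0 < y ∧ y ≤ γ) :
    |x ^ 2 / (1 + k * x ^ 2) - y ^ 2 / (1 + k * y ^ 2)| ≤ 2 * γ * |x - y| := by
  have hX : 0 < 1 + k * x ^ 2 := by nlinarith [mul_nonneg hk (sq_nonneg x)]
  have hY : 0 < 1 + k * y ^ 2 := by nlinarith [mul_nonneg hk (sq_nonneg y)]
  have hXY : 0 < (1 + k * x ^ 2) * (1 + k * y ^ 2) := mul_pos hX hY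
  rw [div_sub_div _ _ hX.ne' hY.ne', abs_div, abs_of_pos hXY, div_le_iff₀ hXY]
  have en : x ^ 2 * (1 + k * y ^ 2) - (1 + k * x ^ 2) * y ^ 2 = (x - y) * (x + y) := by ring
  rw [en, abs_mul, abs_of_pos (show 0 < x + y by linarith)]
  have h1 : 1 ≤ (1 + k * x ^ 2) * (1 + k * y ^ 2) := by
    nlinarith [mul_nonneg hk (sq_nonneg x), mul_nonneg hk (sq_nonneg y), mul_nonneg (mul_nonneg hk (sq_nonneg x)) (mul_nonneg hk (sq_nonneg y))]
  have h2 : |x - y| * (x + y) ≤ |x - y| * (2 * γ) := mul_le_mul_of_nonneg_left (by linarith) (abs_nonneg _)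
  nlinarith [mul_nonneg (mul_nonneg (by linarith : (0 : ℝ) ≤ 2 * γ) (abs_nonneg (x - y))) (sub_nonneg.2 h1)]

/-- `0 ≤ x²∕(1 + k x²) ≤ x²`. [folklore] -/
theorem mt_nonneg_le (k : ℕ) (x : ℝ) : 0 ≤ x ^ 2 / (1 + k * x ^ 2) ∧ x ^ 2 / (1 + k * x ^ 2) ≤ x ^ 2 := by
  have hD : 1 ≤ 1 + (k : ℝ) * x ^ 2 := by
    have := mul_nonneg (k.cast_nonneg : (0 : ℝ) ≤ k) (sq_nonneg x)
    linarith
  exact ⟨div_nonneg (sq_nonneg x) (by linarith), div_le_self (sq_nonneg x) hD⟩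

/-- TOY F is first-entry-only (at every `γ₀`). [folklore] -/
theorem firstEntryOnly_betaMT (γ₀ : ℝ) : FirstEntryOnly betaMT γ₀ := fun k p q _ _ h => by
  simp only [betaMT, h]

/-- TOY F carries the HISTORY-LIPSCHITZ letter on `]0, γ]` with moduli `lamMT γ` (any `γ`; the boxes are empty unless `γ > 0`). [folklore] -/
theorem histLipschitz_betaMT (γ : ℝ) : HistLipschitz (lamMT γ) γ betaMT := by
  intro k p q hp hq
  have hp0 := (mem_box.1 hp) 0
  have hq0 := (mem_box.1 hq) 0
  have hsum : ∑ i : Fin (k + 1), lamMT γ k i * |p i - q i| = 2 * γ * |p 0 - q 0| := by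
    rw [Finset.sum_eq_single (0 : Fin (k + 1)) (fun i _ hi => by simp [lamMT, hi]) (by simp)]
    simp [lamMT]
  rw [hsum]
  show |1 + p 0 ^ 2 / (1 + k * p 0 ^ 2) - (1 + q 0 ^ 2 / (1 + k * q 0 ^ 2))| ≤ 2 * γ * |p 0 - q 0|
  rw [add_sub_add_left_eq_sub]
  exact abs_mt_sub_mt_le (k.cast_nonneg) hp0 hq0

/-- … with ROW SUMS `2γ` (`0 ≤ γ`). [folklore] -/
theorem rowSumMemory_lamMT {γ : ℝ} (hγ : 0 ≤ γ) : RowSumMemory (2 * γ) (lamMT γ) := fun k => by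
  rw [Finset.sum_eq_single (0 : Fin (k + 1)) (fun i _ hi => by simp [lamMT, hi]) (by simp)]
  simp [lamMT, abs_of_nonneg (by linarith : (0 : ℝ) ≤ 2 * γ)]

/-- TOY F is ANCHORED at the one-loop numbers `b ≡ 1` (radius `min 1 δ`: `g_0²∕(1+kg_0²) ≤ g_0² ≤ g_0 ≤ δ`). [folklore] -/
theorem scaleAnchor_betaMT : ScaleAnchor betaMT (fun _ => 1) := by
  intro k δ hδ
  refine ⟨min 1 δ, lt_min one_pos hδ, fun p hp => ?_⟩
  have h := mt_nonneg_le k (p 0)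
  have hp0 := hp 0
  have e : betaMT k p - 1 = (p 0) ^ 2 / (1 + k * (p 0) ^ 2) := by
    simp only [betaMT]; ring
  rw [e, abs_of_nonneg h.1]
  calc (p 0) ^ 2 / (1 + k * (p 0) ^ 2) ≤ (p 0) ^ 2 := h.2
    _ ≤ p 0 * 1 := by rw [sq]; exact mul_le_mul_of_nonneg_left (hp0.2.trans (min_le_left _ _)) hp0.1.le
    _ ≤ δ := by rw [mul_one]; exact hp0.2.trans (min_le_right _ _)

/-- The constant one-loop numbers drift at slope `1` with deviation `0`. [folklore] -/
theorem oneLoopDrift_const_one : OneLoopDrift 1 0 (fun _ => (1 : ℝ)) := fun k => by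
  simp

/-- **TOY F HAS THE ROWS — BY T11♭** (moduli on `]0,1]` with row sum `2`, anchor `1`, drift slope `1 > 0`). [folklore] -/
theorem runRowsShape_betaMT : RunRowsShape betaMT :=
  runRowsShape_of_histLipschitz_rowSum_cornerDriftPos one_pos (histLipschitz_betaMT 1) (rowSumMemory_lamMT zero_le_one) scaleAnchor_betaMT
    oneLoopDrift_const_one one_pos

/-- **TOY F HAS END** (rows ⟹ END, node n24 by name, at the canonical construction). [folklore] -/
theorem endpointExistence_betaMT : EndpointExistence (FlowStepRuns.modelOf betaMT) :=
  endpointExistence_of_runRowsShape (FlowStepRuns.modelOf_forwardGenerated betaMT) runRowsShape_betaMT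

/-- TOY F has run-wise (C) at every level. [folklore] -/
theorem survCont_betaMT {γ₀ : ℝ} (hγ₀ : 0 < γ₀) : SurvCont betaMT γ₀ :=
  survCont_of_histLipschitz (histLipschitz_betaMT γ₀) hγ₀ le_rfl

/-- THE LEVEL-`k` GAP of TOY F between the initial couplings `γ` and `γ∕2` (any later entries): `3γ²∕(4(1+kγ²)(1+kγ²∕4))`. [folklore] -/
theorem betaMT_gap (k : ℕ) (γ : ℝ) {p q : Fin (k + 1) → ℝ} (hp : p 0 = γ) (hq : q 0 = γ / 2) :
    betaMT k p - betaMT k q = 3 * γ ^ 2 / (4 * ((1 + k * γ ^ 2) * (1 + k * (γ / 2) ^ 2))) := by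
  have hA : (1 + (k : ℝ) * γ ^ 2) ≠ 0 := by
    have := mul_nonneg (k.cast_nonneg : (0 : ℝ) ≤ k) (sq_nonneg γ); linarith
  have hB : (1 + (k : ℝ) * (γ / 2) ^ 2) ≠ 0 := by
    have := mul_nonneg (k.cast_nonneg : (0 : ℝ) ≤ k) (sq_nonneg (γ / 2)); linarith
  simp only [betaMT, hp, hq]
  field_simp
  ring

/-- THE GAP IS NOT GEOMETRICALLY SMALL: no `K`, `0 ≤ ρ < 1` with `gap_k ≤ K ρ^k` for all `k` (`γ > 0`) — `ρ^k (1 + kγ²)² → 0`. [folklore] -/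
theorem betaMT_gap_not_geometric {γ K ρ : ℝ} (hγ : 0 < γ) (hρ0 : 0 ≤ ρ) (hρ1 : ρ < 1)
    (h : ∀ k : ℕ, 3 * γ ^ 2 / (4 * ((1 + k * γ ^ 2) * (1 + k * (γ / 2) ^ 2))) ≤ K * ρ ^ k) : False := by
  -- per level: 3γ²/4 ≤ K ρ^k (2 + 2γ⁴k²)
  have step : ∀ k : ℕ, 3 * γ ^ 2 / 4 ≤ K * ρ ^ k * (2 + 2 * γ ^ 4 * (k : ℝ) ^ 2) := by
    intro k
    have hk0 : (0 : ℝ) ≤ k := k.cast_nonneg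
    have ha : 1 ≤ 1 + (k : ℝ) * γ ^ 2 := by nlinarith [mul_nonneg hk0 (sq_nonneg γ)]
    have ha' : 1 ≤ 1 + (k : ℝ) * (γ / 2) ^ 2 := by nlinarith [mul_nonneg hk0 (sq_nonneg (γ / 2))]
    have hprod : 0 < 4 * ((1 + k * γ ^ 2) * (1 + k * (γ / 2) ^ 2)) := by positivity
    have h1 : 3 * γ ^ 2 ≤ K * ρ ^ k * (4 * ((1 + k * γ ^ 2) * (1 + k * (γ / 2) ^ 2))) := (div_le_iff₀ hprod).1 (h k)
    have hKρ : 0 ≤ K * ρ ^ k := by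
      have hpos : 0 < 3 * γ ^ 2 / (4 * ((1 + k * γ ^ 2) * (1 + k * (γ / 2) ^ 2))) := by positivity
      exact le_trans hpos.le (h k) |>.trans_eq rfl
    have h2 : 4 * ((1 + k * γ ^ 2) * (1 + k * (γ / 2) ^ 2)) ≤ 4 * (2 + 2 * γ ^ 4 * (k : ℝ) ^ 2) := by
      have hle : 1 + (k : ℝ) * (γ / 2) ^ 2 ≤ 1 + k * γ ^ 2 := by nlinarith [mul_nonneg hk0 (sq_nonneg γ)]
      nlinarith [mul_le_mul_of_nonneg_left hle (by linarith : (0 : ℝ) ≤ 1 + k * γ ^ 2), sq_nonneg (1 - (k : ℝ) * γ ^ 2)]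
    nlinarith [mul_le_mul_of_nonneg_left h2 hKρ]
  -- the right side tends to 0
  have t1 : Tendsto (fun k : ℕ => ρ ^ k) atTop (𝓝 0) := tendsto_pow_atTop_nhds_zero_of_lt_one hρ0 hρ1
  have t2 : Tendsto (fun k : ℕ => (k : ℝ) ^ 2 * ρ ^ k) atTop (𝓝 0) :=
    tendsto_pow_const_mul_const_pow_of_abs_lt_one 2 (abs_lt.2 ⟨by linarith, hρ1⟩)
  have t : Tendsto (fun k : ℕ => K * ρ ^ k * (2 + 2 * γ ^ 4 * (k : ℝ) ^ 2)) atTop (𝓝 0) := by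
    have t3 := (t1.const_mul (2 * K)).add (t2.const_mul (2 * K * γ ^ 4))
    rw [mul_zero, mul_zero, add_zero] at t3
    refine t3.congr' (Eventually.of_forall fun k => ?_)
    ring
  have hγ2 : 0 < 3 * γ ^ 2 / 4 := by positivity
  obtain ⟨k, hk⟩ := (t.eventually (gt_mem_nhds hγ2)).exists
  exact absurd (step k) (not_le.2 hk)

/-- **★ TOY F CARRIES N17's RATE LETTER FOR NO `c`, NO `ρ < 1`** (`0 ≤ ρ`, `0 < γ`): by the first-entry rigidity the gap would be `≤ 2cρ^k`. [folklore] -/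
theorem not_scaleShiftRate_betaMT {c ρ γ : ℝ} (hρ0 : 0 ≤ ρ) (hρ1 : ρ < 1) (hγ : 0 < γ) : ¬ ScaleShiftRate c ρ γ betaMT := fun hss =>
  betaMT_gap_not_geometric (K := 2 * c) hγ hρ0 hρ1 fun k => by
    have hp : (fun _ : Fin (k + 1) => γ) ∈ HistBox γ k := fun _ => ⟨hγ, le_rfl⟩
    have hq : (fun _ : Fin (k + 1) => γ / 2) ∈ HistBox γ k := fun _ => ⟨by linarith, by linarith⟩
    have h := geomRigid_of_firstEntryOnly_scaleShiftRate (firstEntryOnly_betaMT γ) hss k hp hq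
    rw [← betaMT_gap k γ (p := fun _ => γ) (q := fun _ => γ / 2) rfl rfl]
    calc _ ≤ |betaMT k (fun _ => γ) - betaMT k (fun _ => γ / 2)| := le_abs_self _
      _ ≤ 2 * (c * ρ ^ k) := h
      _ = 2 * c * ρ ^ k := by ring

/-- **★ TOY F CARRIES NO FADING-COMPATIBLE MODULI** (`0 < γ`): if `HistLipschitz Λ γ betaMT` and `FadingMemory C ρ Λ` (`0 ≤ ρ < 1`) then, comparing the constant history `γ` with its
entry-0 update to `γ∕2`, the gap would be `≤ Λ k 0 · γ∕2 ≤ Cρ^k γ∕2`.  So TOY F is a U3ᴷ♭ tuple that is NOT a U3ᴷ tuple (neither conjunct it drops holds), yet has rows and END. [folklore] -/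
theorem not_histLipschitz_fadingMemory_betaMT {γ : ℝ} (hγ : 0 < γ) :
    ¬ ∃ (Λ : ℕ → ℕ → ℝ) (C ρ : ℝ), 0 ≤ ρ ∧ ρ < 1 ∧ HistLipschitz Λ γ betaMT ∧ FadingMemory C ρ Λ := by
  rintro ⟨Λ, C, ρ, hρ0, hρ1, hL, hF⟩
  refine betaMT_gap_not_geometric (K := C * (γ / 2)) hγ hρ0 hρ1 fun k => ?_
  set p : Fin (k + 1) → ℝ := fun _ => γ with hpdef
  set q : Fin (k + 1) → ℝ := Function.update p 0 (γ / 2) with hqdef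
  have hp : p ∈ Box γ k := mem_box.2 fun _ => ⟨hγ, le_rfl⟩
  have hq : q ∈ Box γ k := mem_box.2 fun i => by
    by_cases hi : i = 0
    · subst hi; simp [hqdef]; constructor <;> linarith
    · simp [hqdef, Function.update_of_ne hi, hpdef, hγ]
  have hq0 : q 0 = γ / 2 := by simp [hqdef]
  have h1 := hL k p q hp hq
  have hsum : ∑ i : Fin (k + 1), Λ k i * |p i - q i| = Λ k 0 * (γ / 2) := by
    rw [Finset.sum_eq_single (0 : Fin (k + 1)) (fun i _ hi => by simp [hqdef, Function.update_of_ne hi]) (by simp)]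
    have e0 : p 0 - q 0 = γ / 2 := by
      simp only [hq0, hpdef]; ring
    rw [e0, abs_of_pos (half_pos hγ), Fin.val_zero]
  have hΛ0 : Λ k 0 ≤ C * ρ ^ k := by
    have h := (hF k 0 (Nat.zero_le k)).2
    simpa using h
  rw [← betaMT_gap k γ (p := p) (q := q) rfl hq0]
  calc betaMT k p - betaMT k q ≤ |betaMT k p - betaMT k q| := le_abs_self _
    _ ≤ Λ k 0 * (γ / 2) := h1.trans_eq hsum
    _ ≤ C * ρ ^ k * (γ / 2) := mul_le_mul_of_nonneg_right hΛ0 (by linarith)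
    _ = C * (γ / 2) * ρ ^ k := by ring

/-- **T17 ★★★ THE RE-CUT ROAD IS INHABITED BY THE BN-N TOY — WITH ROWS AND END, WITHOUT EITHER RATE LETTER.**  TOY F (`0 < γ`): first-entry-only; U3ᴷ♭'s letters (`HistLipschitz`, row
sum `2γ`); the anchor `b ≡ 1`; the drift at slope `1`; (C) at level `γ`; K1⁸'s rows shape; END for `modelOf betaMT` — and NOT `ScaleShiftRate c ρ γ` for any `c`, `0 ≤ ρ < 1`, and NO moduli
`Λ` with `HistLipschitz Λ γ` ∧ `FadingMemory C ρ Λ`.  So: (a) the hypotheses of T11♭∕T13♭ are jointly satisfiable by a β of the marginal-transport type that BN-N says the record's β (mod H_FE′)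
resembles, while those of T11∕T13 (fading) and of PORT-1 p620216 ∕ CRIT-1 O-1's U3ᴷ⁻ (N17 rate) are not; (b) at the generic level U3ᴷ♭ + 2ᶜᴰ-data ⇏ N17's letter and ⇏ the fading pair.
A statement about TOYS and hypothesis SHAPES; nothing of Bałaban asserted; no record tuple is claimed to be of TOY F's type. [folklore] -/
theorem recut_inhabited_rateLetters_fail {γ : ℝ} (hγ : 0 < γ) :
    FirstEntryOnly betaMT γ ∧ HistLipschitz (lamMT γ) γ betaMT ∧ RowSumMemory (2 * γ) (lamMT γ) ∧ ScaleAnchor betaMT (fun _ => 1) ∧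
      OneLoopDrift 1 0 (fun _ => (1 : ℝ)) ∧ SurvCont betaMT γ ∧ RunRowsShape betaMT ∧ EndpointExistence (FlowStepRuns.modelOf betaMT) ∧
      (∀ c ρ : ℝ, 0 ≤ ρ → ρ < 1 → ¬ ScaleShiftRate c ρ γ betaMT) ∧
      ¬ ∃ (Λ : ℕ → ℕ → ℝ) (C ρ : ℝ), 0 ≤ ρ ∧ ρ < 1 ∧ HistLipschitz Λ γ betaMT ∧ FadingMemory C ρ Λ :=
  ⟨firstEntryOnly_betaMT γ, histLipschitz_betaMT γ, rowSumMemory_lamMT hγ.le, scaleAnchor_betaMT, oneLoopDrift_const_one, survCont_betaMT hγ,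
    runRowsShape_betaMT, endpointExistence_betaMT, fun _ _ hρ0 hρ1 => not_scaleShiftRate_betaMT hρ0 hρ1 hγ, not_histLipschitz_fadingMemory_betaMT hγ⟩

/-- **T17′ — U3ᴷ♭ + THE CORNER DATA DO NOT GIVE BACK N17's LETTER** (generic level): it is NOT the case that every history-Lipschitz β with bounded row sums, an anchor and a positive drift
carries `ScaleShiftRate c ρ γ` for some `c`, `0 ≤ ρ < 1`.  (So T5∕T6∕T8's necessity column, which consumes N17, is NOT available on the re-cut road; the sufficiency column T11♭–T13♭ is.) [folklore] -/
theorem not_scaleShiftRate_of_recut :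
    ¬ ∀ (β : HBeta) (Λ : ℕ → ℕ → ℝ) (L γ : ℝ) (b : ℕ → ℝ) (s A : ℝ), 0 < γ → HistLipschitz Λ γ β → RowSumMemory L Λ → ScaleAnchor β b → OneLoopDrift s A b → 0 < s →
      ∃ c ρ : ℝ, 0 ≤ ρ ∧ ρ < 1 ∧ ScaleShiftRate c ρ γ β := by
  intro h
  obtain ⟨c, ρ, hρ0, hρ1, hss⟩ := h betaMT (lamMT 1) 2 1 (fun _ => 1) 1 0 one_pos (histLipschitz_betaMT 1)
    (by simpa using rowSumMemory_lamMT zero_le_one) scaleAnchor_betaMT oneLoopDrift_const_one one_pos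
  exact not_scaleShiftRate_betaMT hρ0 hρ1 one_pos hss

/-! #### TOY E `betaSq` — history-Lipschitz WITHOUT bounded row sums: anchor, drift, (C), and NO rows -/

/-- TOY E: `β_{k+1}(g_0, …, g_k) := 1 + (k+1)²·g_0` — first-entry-only, history-Lipschitz with entry-0 modulus `(k+1)²` (row sums UNBOUNDED), anchored at `b ≡ 1`, drifting at slope `1`.
A TOY, not Bałaban's β. [folklore] -/
def betaSq : HBeta := fun k p => 1 + ((k : ℝ) + 1) ^ 2 * p 0

/-- TOY E's moduli: `(k+1)²` at entry `0`, zero elsewhere. [folklore] -/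
def lamSq : ℕ → ℕ → ℝ := fun k i => if i = 0 then ((k : ℝ) + 1) ^ 2 else 0

/-- TOY E is first-entry-only. [folklore] -/
theorem firstEntryOnly_betaSq (γ₀ : ℝ) : FirstEntryOnly betaSq γ₀ := fun k p q _ _ h => by
  simp only [betaSq, h]

/-- TOY E carries the HISTORY-LIPSCHITZ letter (any `γ`) with moduli `lamSq` — with equality. [folklore] -/
theorem histLipschitz_betaSq (γ : ℝ) : HistLipschitz lamSq γ betaSq := by
  intro k p q _ _
  have hsum : ∑ i : Fin (k + 1), lamSq k i * |p i - q i| = ((k : ℝ) + 1) ^ 2 * |p 0 - q 0| := by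
    rw [Finset.sum_eq_single (0 : Fin (k + 1)) (fun i _ hi => by simp [lamSq, hi]) (by simp)]
    simp [lamSq]
  rw [hsum]
  have e : betaSq k p - betaSq k q = ((k : ℝ) + 1) ^ 2 * (p 0 - q 0) := by
    simp only [betaSq]; ring
  rw [e, abs_mul, abs_of_nonneg (sq_nonneg _)]

/-- TOY E is ANCHORED at `b ≡ 1` (radius `δ∕(k+1)²` at scale `k`). [folklore] -/
theorem scaleAnchor_betaSq : ScaleAnchor betaSq (fun _ => 1) := by
  intro k δ hδ
  have hk : (0 : ℝ) < ((k : ℝ) + 1) ^ 2 := by positivity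
  refine ⟨δ / (((k : ℝ) + 1) ^ 2), div_pos hδ hk, fun p hp => ?_⟩
  have hp0 := hp 0
  have e : betaSq k p - 1 = ((k : ℝ) + 1) ^ 2 * p 0 := by
    simp only [betaSq]; ring
  rw [e, abs_of_nonneg (mul_nonneg hk.le hp0.1.le)]
  calc ((k : ℝ) + 1) ^ 2 * p 0 ≤ ((k : ℝ) + 1) ^ 2 * (δ / ((k : ℝ) + 1) ^ 2) := mul_le_mul_of_nonneg_left hp0.2 hk.le
    _ = δ := mul_div_cancel₀ δ hk.ne'

/-- TOY E has run-wise (C) at every level. [folklore] -/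
theorem survCont_betaSq {γ₀ : ℝ} (hγ₀ : 0 < γ₀) : SurvCont betaSq γ₀ :=
  survCont_of_histLipschitz (histLipschitz_betaSq γ₀) hγ₀ le_rfl

/-- **TOY E ADMITS NO MODULI WITH BOUNDED ROW SUMS** on any `]0, γ]`, `γ > 0`: comparing the constant history `γ` with its entry-0 update to `γ∕2` forces `Λ k 0 ≥ (k+1)²`. [folklore] -/
theorem not_rowSum_betaSq {γ : ℝ} (hγ : 0 < γ) : ¬ ∃ (Λ : ℕ → ℕ → ℝ) (L : ℝ), HistLipschitz Λ γ betaSq ∧ RowSumMemory L Λ := by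
  rintro ⟨Λ, L, hL, hS⟩
  set k : ℕ := ⌈L⌉₊ with hkdef
  have hkL : L < ((k : ℝ) + 1) ^ 2 := by
    have h1 : L ≤ (k : ℝ) := Nat.le_ceil L
    nlinarith [(k.cast_nonneg : (0 : ℝ) ≤ k)]
  set p : Fin (k + 1) → ℝ := fun _ => γ with hpdef
  set q : Fin (k + 1) → ℝ := Function.update p 0 (γ / 2) with hqdef
  have hp : p ∈ Box γ k := mem_box.2 fun _ => ⟨hγ, le_rfl⟩
  have hq : q ∈ Box γ k := mem_box.2 fun i => by
    by_cases hi : i = 0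
    · subst hi; simp [hqdef]; constructor <;> linarith
    · simp [hqdef, Function.update_of_ne hi, hpdef, hγ]
  have hq0 : q 0 = γ / 2 := by simp [hqdef]
  have h1 := hL k p q hp hq
  have hsum : ∑ i : Fin (k + 1), Λ k i * |p i - q i| = Λ k 0 * (γ / 2) := by
    rw [Finset.sum_eq_single (0 : Fin (k + 1)) (fun i _ hi => by simp [hqdef, Function.update_of_ne hi]) (by simp)]
    have e0 : p 0 - q 0 = γ / 2 := by
      simp only [hq0, hpdef]; ring
    rw [e0, abs_of_pos (half_pos hγ), Fin.val_zero]
  have hgap : betaSq k p - betaSq k q = ((k : ℝ) + 1) ^ 2 * (γ / 2) := by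
    simp only [betaSq, hqdef, hpdef, Function.update_self]
    ring
  have h2 : ((k : ℝ) + 1) ^ 2 * (γ / 2) ≤ Λ k 0 * (γ / 2) := by
    rw [← hgap, ← hsum]
    exact (le_abs_self _).trans h1
  have h3 : ((k : ℝ) + 1) ^ 2 ≤ Λ k 0 := le_of_mul_le_mul_right h2 (half_pos hγ)
  have h4 : Λ k 0 ≤ L := by
    have h5 : |Λ k 0| ≤ ∑ i : Fin (k + 1), |Λ k i| := by
      have h6 := Finset.single_le_sum (s := Finset.univ) (f := fun i : Fin (k + 1) => |Λ k (i : ℕ)|) (fun i _ => abs_nonneg _)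
        (Finset.mem_univ 0)
      simpa using h6
    exact (le_abs_self _).trans (h5.trans (hS k))
  linarith

/-- THE FORWARD RUN OF TOY E from the initial coupling `a`: `1∕g_j² = 1∕a² − Σ_{i<j} (1 + (i+1)² a)` (solved while positive). [folklore] -/
def ySq (a : ℝ) (j : ℕ) : ℝ := 1 / a ^ 2 - ∑ i ∈ Finset.range j, (1 + ((i : ℝ) + 1) ^ 2 * a)

/-- The couplings of that run. [folklore] -/
def runSq (a : ℝ) (j : ℕ) : ℝ := FlowStepRuns.solveCoupling (ySq a j)

/-- The run starts at `a` (`a > 0`). [folklore] -/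
theorem runSq_zero {a : ℝ} (ha : 0 < a) : runSq a 0 = a := by
  simp only [runSq, ySq, Finset.range_zero, Finset.sum_empty, sub_zero]
  exact solveCoupling_inv_sq ha

/-- `ySq` is non-increasing in `j` for `a ≥ 0` (every increment `1 + (i+1)² a` is positive). [folklore] -/
theorem ySq_anti {a : ℝ} (ha : 0 ≤ a) {j k : ℕ} (hjk : j ≤ k) : ySq a k ≤ ySq a j := by
  simp only [ySq]
  have h : ∑ i ∈ Finset.range j, (1 + ((i : ℝ) + 1) ^ 2 * a) ≤ ∑ i ∈ Finset.range k, (1 + ((i : ℝ) + 1) ^ 2 * a) :=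
    Finset.sum_le_sum_of_subset_of_nonneg (Finset.range_mono hjk) fun i _ _ => by positivity
  linarith

/-- A crude survival bound at level `k` from `a = 1∕(k+1)` or below: `ySq a k ≥ 1∕a² − k − k³·a`. [folklore] -/
theorem ySq_ge {a : ℝ} (ha : 0 ≤ a) (k : ℕ) : 1 / a ^ 2 - k - (k : ℝ) ^ 3 * a ≤ ySq a k := by
  simp only [ySq]
  have h : ∑ i ∈ Finset.range k, (1 + ((i : ℝ) + 1) ^ 2 * a) ≤ ∑ _i ∈ Finset.range k, (1 + (k : ℝ) ^ 2 * a) := by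
    refine Finset.sum_le_sum fun i hi => ?_
    have hi' : (i : ℝ) + 1 ≤ k := by exact_mod_cast Nat.succ_le_of_lt (Finset.mem_range.1 hi)
    have hi0 : (0 : ℝ) ≤ (i : ℝ) + 1 := by positivity
    nlinarith [mul_le_mul hi' hi' hi0 (k.cast_nonneg), mul_nonneg (sub_nonneg.2 (mul_le_mul hi' hi' hi0 (k.cast_nonneg))) ha]
  rw [Finset.sum_const, Finset.card_range, nsmul_eq_mul] at h
  nlinarith

/-- **THE IN-WINDOW RUN OF TOY E AT LEVEL `k` FROM `a`**: if `0 < a`, `0 < γ₀` and `1∕γ₀² ≤ ySq a k` (which forces `a ≤ γ₀`), then `runSq a` solves (0.20) with `betaSq` up to `k`, stays in `]0, γ₀]`, starts at `a`, and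
reads `β_k = 1 + (k+1)² a` at level `k`. [folklore] -/
theorem runSq_inWindow {a γ₀ : ℝ} (ha : 0 < a) (hγ₀ : 0 < γ₀) {k : ℕ} (hk : 1 / γ₀ ^ 2 ≤ ySq a k) :
    RGEqH k betaSq (runSq a) ∧ Step.InInterval γ₀ k (runSq a) ∧ betaSq k (prefixOf (runSq a) k) = 1 + ((k : ℝ) + 1) ^ 2 * a := by
  have hpos : ∀ j, j ≤ k → 0 < ySq a j := fun j hj =>
    lt_of_lt_of_le (by positivity) (hk.trans (ySq_anti ha.le hj))
  have hinv : ∀ j, j ≤ k → 1 / (runSq a j) ^ 2 = ySq a j := fun j hj => FlowStepRuns.inv_sq_solveCoupling (hpos j hj)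
  have hg0 : runSq a 0 = a := runSq_zero ha
  have hβ : ∀ j, betaSq j (prefixOf (runSq a) j) = 1 + ((j : ℝ) + 1) ^ 2 * a := fun j => by
    simp only [betaSq, prefixOf_apply, Fin.val_zero, hg0]
  refine ⟨fun j hj => ?_, fun j hj => ?_, hβ k⟩
  · rw [hinv j hj.le, hinv (j + 1) hj, hβ j]
    simp only [ySq, Finset.sum_range_succ]
    ring
  · have hy := hpos j hj
    refine ⟨FlowStepRuns.solveCoupling_pos hy, le_of_inv_sq_le (FlowStepRuns.solveCoupling_pos hy) hγ₀ ?_⟩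
    rw [hinv j hj]
    exact hk.trans (ySq_anti ha.le hj)

/-- **★ TOY E HAS NO RUN ROWS AT ANY WINDOW** — row (i) fails: at a deep level `k` (`k + 1 ≥ 1∕γ₀² + 1∕γ₀`, `k > 2r`) the runs from `a = 1∕(k+1)` and `a′ = 1∕(k+1)²` both stay in `]0, γ₀]` up to
level `k` (crude bound `ySq ≥ 1∕a² − k − k³a`), where they read `β_k = k + 2` and `β_k = 2`: no sequence `b` is within a fixed `r` of both. [folklore] -/
theorem not_runRowsShape_betaSq : ¬ RunRowsShape betaSq := by
  rintro ⟨b, r, γ₀, M, hγ₀, hrem, -, -⟩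
  -- the level
  set k : ℕ := ⌈1 / γ₀ ^ 2 + 1 / γ₀ + 2 * |r|⌉₊ + 1 with hkdef
  have hceil : 1 / γ₀ ^ 2 + 1 / γ₀ + 2 * |r| ≤ (⌈1 / γ₀ ^ 2 + 1 / γ₀ + 2 * |r|⌉₊ : ℝ) := Nat.le_ceil _
  have hkR : (k : ℝ) = (⌈1 / γ₀ ^ 2 + 1 / γ₀ + 2 * |r|⌉₊ : ℝ) + 1 := by rw [hkdef]; push_cast; ring
  have hig : 0 < 1 / γ₀ := by positivity
  have hig2 : 0 < 1 / γ₀ ^ 2 := by positivity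
  have hk1 : 1 / γ₀ ^ 2 ≤ (k : ℝ) + 1 := by linarith [abs_nonneg r]
  have hk3 : 2 * r < (k : ℝ) := by linarith [le_abs_self r]
  have hk0 : (0 : ℝ) < (k : ℝ) + 1 := by positivity
  have hkk : (1 : ℝ) ≤ (k : ℝ) + 1 := by linarith [(k.cast_nonneg : (0 : ℝ) ≤ k)]
  -- the two initial couplings
  set a : ℝ := 1 / ((k : ℝ) + 1) with hadef
  set a' : ℝ := 1 / ((k : ℝ) + 1) ^ 2 with ha'def
  have ha : 0 < a := by positivity
  have ha' : 0 < a' := by positivity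
  have ha'a : a' ≤ a := by
    rw [ha'def, hadef]
    exact one_div_le_one_div_of_le hk0 (by nlinarith)
  -- survival at level k
  have hsurv : ∀ c : ℝ, 0 < c → c ≤ a → 1 / γ₀ ^ 2 ≤ ySq c k := by
    intro c hc hca
    refine le_trans ?_ (ySq_ge hc.le k)
    have h1 : ((k : ℝ) + 1) ^ 2 ≤ 1 / c ^ 2 := by
      have h2 : c ≤ 1 / ((k : ℝ) + 1) := hca
      have h3 : c * ((k : ℝ) + 1) ≤ 1 := by rwa [le_div_iff₀ hk0] at h2
      rw [le_div_iff₀ (by positivity)]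
      nlinarith [mul_nonneg hc.le hk0.le]
    have h4 : (k : ℝ) ^ 3 * c ≤ (k : ℝ) ^ 2 := by
      have h5 : (k : ℝ) ^ 3 * c ≤ (k : ℝ) ^ 3 * (1 / ((k : ℝ) + 1)) := mul_le_mul_of_nonneg_left hca (by positivity)
      have h6 : (k : ℝ) ^ 3 * (1 / ((k : ℝ) + 1)) ≤ (k : ℝ) ^ 2 := by
        rw [mul_one_div, div_le_iff₀ hk0]; nlinarith [(k.cast_nonneg : (0 : ℝ) ≤ k), sq_nonneg (k : ℝ)]
      exact h5.trans h6
    nlinarith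
  obtain ⟨hrg, hI, hβ⟩ := runSq_inWindow ha hγ₀ (hsurv a ha le_rfl)
  obtain ⟨hrg', hI', hβ'⟩ := runSq_inWindow ha' hγ₀ (hsurv a' ha' ha'a)
  have h1 := hrem k (runSq a) hrg hI k le_rfl
  have h2 := hrem k (runSq a') hrg' hI' k le_rfl
  rw [hβ] at h1
  rw [hβ'] at h2
  have hv : ((k : ℝ) + 1) ^ 2 * a = (k : ℝ) + 1 := by
    rw [hadef, mul_one_div, pow_two, mul_div_assoc, div_self hk0.ne', mul_one]
  have hv' : ((k : ℝ) + 1) ^ 2 * a' = 1 := by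
    rw [ha'def, mul_one_div, div_self (pow_ne_zero 2 hk0.ne')]
  rw [hv] at h1
  rw [hv'] at h2
  have h3 : (k : ℝ) ≤ 2 * r := by
    have e : (k : ℝ) = (1 + ((k : ℝ) + 1) - b k) - (1 + 1 - b k) := by ring
    rw [e]
    exact (le_abs_self _).trans ((abs_sub _ _).trans (by linarith))
  linarith

/-- **T18 ★★ IN T11♭ THE ROW-SUM LETTER IS LOAD-BEARING** — TOY E (`γ > 0`): first-entry-only, history-Lipschitz, anchored at `1`, drifting at slope `1 > 0`, (C) at every level, yet NO moduli
with bounded row sums and NO rows at any window.  With T17: on first-entry tuples the corner data + `HistLipschitz` give the rows iff-ish through the ROW SUMS, not through any rate.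
A statement about a TOY; nothing of Bałaban asserted. [folklore] -/
theorem rowSum_loadBearing {γ : ℝ} (hγ : 0 < γ) :
    FirstEntryOnly betaSq γ ∧ HistLipschitz lamSq γ betaSq ∧ ScaleAnchor betaSq (fun _ => 1) ∧ OneLoopDrift 1 0 (fun _ => (1 : ℝ)) ∧ SurvCont betaSq γ ∧
      (¬ ∃ (Λ : ℕ → ℕ → ℝ) (L : ℝ), HistLipschitz Λ γ betaSq ∧ RowSumMemory L Λ) ∧ ¬ RunRowsShape betaSq :=
  ⟨firstEntryOnly_betaSq γ, histLipschitz_betaSq γ, scaleAnchor_betaSq, oneLoopDrift_const_one, survCont_betaSq hγ, not_rowSum_betaSq hγ, not_runRowsShape_betaSq⟩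

/-- **T18′ — `HistLipschitz` + ANCHOR + STRICT DRIFT ⇏ ROWS** (so T11♭'s `RowSumMemory` cannot be dropped, and T11's fading letter cannot be weakened below its row sums to bare moduli). [folklore] -/
theorem not_rows_of_histLipschitz_anchor_drift :
    ¬ ∀ (β : HBeta) (Λ : ℕ → ℕ → ℝ) (γ : ℝ) (b : ℕ → ℝ) (s A : ℝ), 0 < γ → HistLipschitz Λ γ β → ScaleAnchor β b → OneLoopDrift s A b → 0 < s → RunRowsShape β :=
  fun h => not_runRowsShape_betaSq (h betaSq lamSq 1 (fun _ => 1) 1 0 one_pos (histLipschitz_betaSq 1) scaleAnchor_betaSq oneLoopDrift_const_one one_pos)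

end FirstEntry

/-! ## §9c (EDITION 3.4, g12) ATTRIBUTION ∕ TWINS OF RECORD for §9 — CRIT-2 g3's R-BM (HOME STATUS S.2003, 09:20Z) and PORT-1 g3's p622247 (09:41Z) PRECEDE §9 (written 09:50Z)
§9(a)'s re-cut U3ᴷ♭ («moduli with bounded row sums») IS CRIT-2 g3's located repair **R-BM** («U3ᴷ-lite := HistLipschitz ∧ ∃ M, ∀ k, Σ_{i≤k}|Λ k i| ≤ M», S.2003, addressed to «idea-7 successor ∕
PORT-1 ∕ N18 owners»), and T11♭∕T12♭∕T13♭∕`u3KFlat_of_u3K` are crux-workfile TWINS of PORT-1 g3's Theorems-lane port p622247 `…Theorems.BalabanUVNodesK2CornerRoadRowsMassBand`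
(`constRemainder_of_histLipschitz_massBound_scaleAnchor`, `runRowsCont13_of_moduliMass_scaleAnchor_drift`, `u3LiteK_of_u3K`, ★★ `rowsContAll_of_u3LiteK_cornerDriftPosK`,
★ `stabilityBRunRowsAtRecordR13SepCoPH_of_k17_u3LiteK_cornerDriftPosK`), landed BEFORE ed.3.3 — the objects of record are THEIRS; below, `u3KFlat_iff_u3LiteK` (the two texts differ only in
the order of `∃`) and T13♭ RE-PROVED AS PORT-1's ★ (`k1R8_of_k1R7_u3KFlat_cornerDriftPos_viaPort1`) certify the identity.  Likewise §9b's «N17 inherits BN-N» is the kernel shadow of a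
sentence already on record in prose: CRIT-2 S.2003 E-CRIT2-2 («`ScaleShiftRate c ρ` … osc ≍ 1∕k, not ρ^k») and CRIT-1 g6 S.2022 (1) («scale-shift compares `F_{k+1}(w 0)` with `F_k(w 1)` at
independent box points ⇒ needs osc F_k ≤ 2cρ^{k−1}»); CRIT-1 g6's crux workfile `Crit1ShiftOscToy` (`shiftOsc_not_geom`, S.2055, 10:07Z) is the
sequence-level toy of that sentence (TOY F's `betaMT_gap_not_geometric` ∕ `not_scaleShiftRate_betaMT` are its β-level twins); idea-5 g13 `Idea5g13RunOnlyRoadSketch6` §12 carries S-1 (`firstEntryLip_le_inv_sqrt`, `firstEntryLip_not_geom`) and R-BM's shadow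
(`u3lite_of_firstEntryOnly`, `mass_firstEntry`).  WHAT REMAINS THIS FILE'S OWN in §9: the exact generic-β certificates `geomRigid_of_firstEntryOnly_scaleShiftRate` ∕
`not_scaleShiftRate_of_firstEntryOnly_gap`; TOY F `betaMT` = ONE β carrying first-entry-only + U3ᴷ-lite + anchor + drift + (C) + ROWS + END and provably NEITHER rate letter (T17, T17′);
TOY E `betaSq` = U3ᴷ-lite's MASS conjunct is LOAD-BEARING for the rows (T18, T18′); T10♭ (rows ⟺ (iv) on U3ᴷ-lite tuples). -/

section Twins

/-- PORT-1 p622247's U3ᴷ-lite hypothesis text VERBATIM (`hLite` of `…K2CornerRoadRowsMassBand.rowsContAll_of_u3LiteK_cornerDriftPosK`): CRIT-2 g3's R-BM letter pair at the crux keying.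
HYPOTHESIS SHAPE, never a fact. [cite: Balaban1987RG1, section 5 p.298 and (2.12)-(2.14) p.268] -/
def U3LiteK : Prop :=
  ∀ (F : T4Family) (θ : Node00.Stage13HParams F 2) (hP : θ.Provisos₁₃SepCoPH F 2), (θ.ZhUnity F 2 ∧ θ.SlotsNondegenerate₁₃ F 2) → θ.Admissible F 2 →
    B16.EndStatementBPrinted (Node00.datumOfRecord₁₃SepCoPH F 2 θ hP).C → Window13 F θ hP →
    ∃ (Λ : ℕ → ℕ → ℝ) (M : ℝ), HistLipschitz Λ θ.γ (Node00.datumOfRecord₁₃SepCoPH F 2 θ hP).βfun ∧ ∀ k, ∑ i : Fin (k + 1), |Λ k i| ≤ M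

/-- §9's `U3KFlat` IS PORT-1's U3ᴷ-lite text (up to the order of the two `∃`). [folklore] -/
theorem u3KFlat_iff_u3LiteK : U3KFlat ↔ U3LiteK :=
  ⟨fun h F θ hP hU hθ hB hwin => by
    obtain ⟨L, Λ, hL, hS⟩ := h F θ hP hU hθ hB hwin
    exact ⟨Λ, L, hL, hS⟩,
   fun h F θ hP hU hθ hB hwin => by
    obtain ⟨Λ, M, hL, hM⟩ := h F θ hP hU hθ hB hwin
    exact ⟨M, Λ, hL, hM⟩⟩

/-- **T13♭ HAS PORT-1 p622247's ★ AS ITS TYPE**: this theorem's statement is, binder for binder, `…Theorems.BalabanUVNodesK2CornerRoadRowsMassBand.stabilityBRunRowsAtRecordR13SepCoPH_of_k17_u3LiteK_cornerDriftPosK`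
(K1⁷ + the U3ᴷ-lite text + the inline 2ᶜᴰ text ⟹ K1⁸), proved here through §9's twin chain (the module is cited, not imported: it was not yet built on the farm snapshot at the time of writing).
The object of record is PORT-1's; §9's T13♭ is its crux-workfile twin.  CONDITIONAL; K1⁸ NOT proved. [cite: Balaban1987RG1, Thm 2 p.259 (first sentence) and Thm 3 p.264] -/
theorem k1R8_of_k1R7_u3LiteK_cornerDriftPosInline (h1 : Summit.QuantumFields.YangMills.Theses.BalabanUVNodes.StabilityBAtRecordR13SepCoPH) (hLite : U3LiteK)
    (hCD : ∀ (F : T4Family) (θ : Node00.Stage13HParams F 2) (hP : θ.Provisos₁₃SepCoPH F 2), (θ.ZhUnity F 2 ∧ θ.SlotsNondegenerate₁₃ F 2) → θ.Admissible F 2 →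
      B16.EndStatementBPrinted (Node00.datumOfRecord₁₃SepCoPH F 2 θ hP).C → Window13 F θ hP →
      ∃ (b : ℕ → ℝ) (s A : ℝ), ScaleAnchor (Node00.datumOfRecord₁₃SepCoPH F 2 θ hP).βfun b ∧ 0 < s ∧ OneLoopDrift s A b) :
    Summit.QuantumFields.YangMills.Theses.BalabanUVNodes.StabilityBRunRowsAtRecordR13SepCoPH :=
  k1R8_of_k1R7_u3KFlat_cornerDriftPosTree h1 (u3KFlat_iff_u3LiteK.2 hLite)
    ((Summit.QuantumFields.YangMills.Theorems.BalabanUVNodesK2V7Defs.cornerDriftPos_iff_inline).2 hCD)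

end Twins

/-! ## §10 (EDITION 3.4, g12) THE MASS-BAND ROAD READ BACKWARDS — what K1⁸'s run-wise floor (iv) forces on the McShane corner sequence, N17-FREE and MASS-FREE
On the live supplier road (R-BM ∕ p622247) NODE O owes K1⁸ at the K1 witness {an anchor `b`, a drift of `b` at a slope `s > 0`}; §5–§7's necessity column (T5–T9, T14) cannot price that
road because it consumed N17 (convergence of `b`).  THE INVERSION WITHOUT N17: given ONLY the history moduli `HistLipschitz Λ γ β` (per-scale masses `m_k := Σ_i|Λ k i|`, NO uniform bound)
and a per-scale anchor `b` (which the moduli manufacture — McShane, PORT-1 `exists_scaleAnchor_of_histLipschitz` — and which is unique), K1⁸'s row (iv) at ANY window forces the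
**PARTIAL-SUM FLOOR ON THE CORNER SEQUENCE ITSELF**: `∃ M, ∀ k ≤ n, −M ≤ Σ_{j∈[k,n)} b_j` (T8♭ ★★ `cornerFloor_of_histLipschitz_runwiseFloor`; mechanism: DEEP forward runs — started so small
that all entries stay below `δ` up to level `n` — exist for every `δ`, read (iv), and see `β_j = b_j + O(m_j δ)` by dag-n18's band; let `δ → 0`).  Consequences: (T9♭) if `b` converges (e.g.
`b = θ.cβ·beta0OfJs F κ`, which converges HYPOTHESIS-FREE by gan24∕g1-p3 — `tendsto_beta0OfJs`) its limit is `≥ 0`: the (D1)-SIGN necessity of ed.2∕ed.6 RECOVERED ON THE MASS-BAND ROAD with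
no N17 on the β side (`lim_nonneg_of_windowFloor`, `limJs_nonneg_of_histLipschitz_anchorJets_runwiseFloor`); (T14♭) the N17-free bracket «`OneLoopDrift s A b ∧ 0 < s` (+ bounded mass) ⟹
rows ⟹ floor on `b` ⟸ `OneLoopDrift s A b ∧ 0 ≤ s`», whose seam `s = 0` is inhabited WITH rows (TOY A `betaZero`) and WITHOUT rows (TOY D `betaOsc`: U3ᴷ-lite, anchored at `0`, END, no
rows) — so on the mass-band road the registered 2ᶜᴰ's strict slope over-pays K1⁸ by exactly the seam, as 2ᶜᴰ over-paid K2⁷ in ed.6 (T7), now certified WITHOUT the presumptively-dead N17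
letter; (T9♭ʳ) K1⁸ BY NAME ⟹ at its witness, for every moduli letter and every anchor there, the corner sequence is floored.  Elementary; nothing of Bałaban asserted. -/

section MassBandBackwards

open YMDAG.N18.CornerBandOfKernelLetters (abs_sub_le_sum_of_anchor_of_histLipschitz abs_sub_le_mul_of_band)
open Summit.QuantumFields.YangMills.Theorems.BalabanUVNodesK2JsOfRecord (StepColourData beta0OfJs)

variable {β : HBeta} {b : ℕ → ℝ}

/-- K1⁸'s row (iv) ALONE as a named shape: the run-wise partial-sum floor `−M` at window `γ₀` (second conjunct of `RunRowsShape`, text verbatim). [cite: Balaban1987RG1, Thm 2 p.259 with (0.31)] -/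
def RunwiseFloor (β : HBeta) (γ₀ M : ℝ) : Prop :=
  ∀ (n : ℕ) (gs : ℕ → ℝ), RGEqH n β gs → Step.InInterval γ₀ n gs → ∀ k, k ≤ n → -M ≤ ∑ j ∈ Finset.Ico k n, β j (prefixOf gs j)

/-- Rows ⟹ (iv) at the rows' window. [folklore] -/
theorem runwiseFloor_of_runRowsShape (h : RunRowsShape β) : ∃ γ₀ M : ℝ, 0 < γ₀ ∧ RunwiseFloor β γ₀ M := by
  obtain ⟨-, -, γ₀, M, hγ₀, -, hps, -⟩ := h
  exact ⟨γ₀, M, hγ₀, hps⟩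

/-- (iv) is monotone in the window: a floor at window `γ₀` is a floor at every smaller window. [folklore] -/
theorem RunwiseFloor.mono {γ₀ δ M : ℝ} (h : RunwiseFloor β γ₀ M) (hδ : δ ≤ γ₀) : RunwiseFloor β δ M :=
  fun n gs hrg hI k hk => h n gs hrg (fun j hj => ⟨(hI j hj).1, (hI j hj).2.trans hδ⟩) k hk

/-- **THE DEEP FORWARD RUN.**  If on each punctured box `]0, δ]^{j+1}` (`δ > 0`) the β-function of scale `j` is bounded above by `B_j ≥ 0`, then for every `n` the run generated forward by
(0.20) (`FlowStepRuns.genSeq`) from the bare coupling `g_0` with `1∕g_0² = 1∕δ² + Σ_{j<n} B_j` solves (0.20) up to level `n` and keeps ALL its couplings in `]0, δ]`: `1∕g_j²` can fall by at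
most `B_j` per step while the prefix stays in the box. [cite: Balaban1987RG1, (0.18)-(0.20) pp.255-256] -/
theorem deepRun_exists {δ : ℝ} (hδ : 0 < δ) {B : ℕ → ℝ} (hB0 : ∀ j, 0 ≤ B j) (hB : ∀ (j : ℕ) (p : Fin (j + 1) → ℝ), p ∈ HistBox δ j → β j p ≤ B j) (n : ℕ) :
    ∃ gs : ℕ → ℝ, RGEqH n β gs ∧ Step.InInterval δ n gs := by
  set y0 : ℝ := 1 / δ ^ 2 + ∑ j ∈ Finset.Ico 0 n, B j with hy0
  have hδ2 : 0 < 1 / δ ^ 2 := by positivity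
  have hy0pos : 0 < y0 := by
    have := Finset.sum_nonneg fun j (_ : j ∈ Finset.Ico 0 n) => hB0 j
    linarith
  set g0 : ℝ := FlowStepRuns.solveCoupling y0 with hg0
  set gs : ℕ → ℝ := FlowStepRuns.genSeq β g0 with hgs
  have hgs0 : gs 0 = g0 := FlowStepRuns.genSeq_zero β g0
  -- the invariant up to level j ≤ n
  have key : ∀ j, j ≤ n → (∀ i, i ≤ j → 0 < gs i ∧ gs i ≤ δ) ∧ 1 / δ ^ 2 + ∑ i ∈ Finset.Ico j n, B i ≤ 1 / (gs j) ^ 2 ∧ RGEqH j β gs := by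
    intro j
    induction j with
    | zero =>
      intro _
      have hinv : 1 / (gs 0) ^ 2 = y0 := by rw [hgs0]; exact FlowStepRuns.inv_sq_solveCoupling hy0pos
      have hpos : 0 < gs 0 := by rw [hgs0]; exact FlowStepRuns.solveCoupling_pos hy0pos
      refine ⟨fun i hi => ?_, by rw [hinv], fun k hk => absurd hk (Nat.not_lt_zero _)⟩
      obtain rfl : i = 0 := Nat.le_zero.1 hi
      refine ⟨hpos, le_of_inv_sq_le hpos hδ ?_⟩
      rw [hinv, hy0]
      have := Finset.sum_nonneg fun j (_ : j ∈ Finset.Ico 0 n) => hB0 j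
      linarith
    | succ j ih =>
      intro hj
      obtain ⟨hbox, hlow, hrg⟩ := ih (Nat.le_of_succ_le hj)
      have hjn : j < n := hj
      -- the prefix at level j lies in the δ-box
      have hpre : prefixOf gs j ∈ HistBox δ j := fun i => by
        rw [prefixOf_apply]
        exact hbox i (Nat.le_of_lt_succ i.isLt)
      have hβle : β j (prefixOf gs j) ≤ B j := hB j _ hpre
      have hsplit : ∑ i ∈ Finset.Ico j n, B i = B j + ∑ i ∈ Finset.Ico (j + 1) n, B i := Finset.sum_eq_sum_Ico_succ_bot hjn _
      set y' : ℝ := 1 / (gs j) ^ 2 - β j (prefixOf gs j) with hy'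
      have hy'low : 1 / δ ^ 2 + ∑ i ∈ Finset.Ico (j + 1) n, B i ≤ y' := by
        rw [hy']; linarith
      have hy'pos : 0 < y' := by
        have := Finset.sum_nonneg fun i (_ : i ∈ Finset.Ico (j + 1) n) => hB0 i
        linarith
      have hsucc : gs (j + 1) = FlowStepRuns.solveCoupling y' := by
        rw [hgs, FlowStepRuns.genSeq_succ]
      have hinv : 1 / (gs (j + 1)) ^ 2 = y' := by rw [hsucc]; exact FlowStepRuns.inv_sq_solveCoupling hy'pos
      have hpos : 0 < gs (j + 1) := by rw [hsucc]; exact FlowStepRuns.solveCoupling_pos hy'pos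
      have hle : gs (j + 1) ≤ δ := by
        refine le_of_inv_sq_le hpos hδ ?_
        rw [hinv]
        have := Finset.sum_nonneg fun i (_ : i ∈ Finset.Ico (j + 1) n) => hB0 i
        linarith
      refine ⟨fun i hi => ?_, by rw [hinv]; exact hy'low, fun k hk => ?_⟩
      · rcases Nat.lt_or_eq_of_le hi with h | h
        · exact hbox i (Nat.le_of_lt_succ h)
        · subst h; exact ⟨hpos, hle⟩
      · rcases Nat.lt_or_eq_of_le (Nat.le_of_lt_succ hk) with h | h
        · exact hrg k h
        · subst h
          rw [hinv, hy']
          ring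
  obtain ⟨hbox, -, hrg⟩ := key n le_rfl
  exact ⟨gs, hrg, fun j hj => hbox j hj⟩

/-- **T8♭ ★★ THE CORNER SEQUENCE IS FLOORED — (iv) READ BACKWARDS WITHOUT N17 AND WITHOUT A MASS BOUND.**  History moduli `HistLipschitz Λ γ β` (`γ > 0`), a per-scale anchor `b`, and K1⁸'s
run-wise floor (iv) `−M` at SOME window `γ₀ > 0` ⟹ `∀ k ≤ n, −M ≤ Σ_{j∈[k,n)} b_j` (same constant `M`, window-free).  Proof: for `0 < δ ≤ min γ γ₀` dag-n18's band gives
`|β_j(p) − b_j| ≤ m_j·δ` on `]0,δ]^{j+1}` (`m_j` = scale-`j` mass), so `β_j ≤ |b_j| + m_j δ` there and the DEEP RUN of `deepRun_exists` stays below `δ` to level `n`; (iv) along it and the band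
give `Σ_{[k,n)} b_j ≥ −M − δ·Σ_{[k,n)} m_j`; `δ → 0`.  CONDITIONAL on hypothesis shapes; nothing of Bałaban asserted. [cite: Balaban1987RG1, Thm 2 p.259 with (0.31), (2.12)-(2.14) p.268 and section 5 p.298] -/
theorem cornerFloor_of_histLipschitz_runwiseFloor {Λ : ℕ → ℕ → ℝ} {γ γ₀ M : ℝ} (hγ : 0 < γ) (hL : HistLipschitz Λ γ β) (hb : ScaleAnchor β b)
    (hγ₀ : 0 < γ₀) (hfl : RunwiseFloor β γ₀ M) : ∀ k n : ℕ, k ≤ n → -M ≤ ∑ j ∈ Finset.Ico k n, b j := by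
  intro k n hkn
  have hband : ∀ (j : ℕ) (p : Fin (j + 1) → ℝ), p ∈ Box γ j → |β j p - b j| ≤ ∑ i : Fin (j + 1), |Λ j i| * p i :=
    fun j p hp => abs_sub_le_sum_of_anchor_of_histLipschitz hL hb j hp
  -- masses
  set m : ℕ → ℝ := fun j => ∑ i : Fin (j + 1), |Λ j i| with hm
  have hm0 : ∀ j, 0 ≤ m j := fun j => Finset.sum_nonneg fun i _ => abs_nonneg _
  set S : ℝ := ∑ j ∈ Finset.Ico k n, m j with hS
  have hS0 : 0 ≤ S := Finset.sum_nonneg fun j _ => hm0 j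
  -- the δ-estimate
  have est : ∀ δ : ℝ, 0 < δ → δ ≤ γ → δ ≤ γ₀ → -M - δ * S ≤ ∑ j ∈ Finset.Ico k n, b j := by
    intro δ hδ hδγ hδγ₀
    have hbd : ∀ (j : ℕ) (p : Fin (j + 1) → ℝ), p ∈ HistBox δ j → |β j p - b j| ≤ m j * δ :=
      fun j p hp => abs_sub_le_mul_of_band hband hδγ j hp
    obtain ⟨gs, hrg, hI⟩ := deepRun_exists (β := β) hδ (B := fun j => |b j| + m j * δ) (fun j => by positivity)
      (fun j p hp => by
        have h1 := hbd j p hp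
        have h2 : β j p - b j ≤ m j * δ := (le_abs_self _).trans h1
        linarith [le_abs_self (b j)]) n
    have hfloor := (hfl.mono hδγ₀) n gs hrg hI k hkn
    have hterm : ∀ j ∈ Finset.Ico k n, β j (prefixOf gs j) - m j * δ ≤ b j := by
      intro j hj
      have hjn : j ≤ n := (Finset.mem_Ico.1 hj).2.le
      have h1 := hbd j _ (prefixOf_mem_histBox_of_inInterval hI hjn)
      have h2 : β j (prefixOf gs j) - b j ≤ m j * δ := (le_abs_self _).trans h1
      linarith
    have hsum := Finset.sum_le_sum hterm
    rw [Finset.sum_sub_distrib, ← Finset.sum_mul] at hsum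
    have e : (∑ j ∈ Finset.Ico k n, m j) * δ = δ * S := by rw [hS, mul_comm]
    linarith
  -- δ → 0
  by_contra hlt
  push Not at hlt
  set ε : ℝ := -M - ∑ j ∈ Finset.Ico k n, b j with hε
  have hεpos : 0 < ε := by rw [hε]; linarith
  set δ : ℝ := min (min γ γ₀) (ε / (2 * (S + 1))) with hδdef
  have hδpos : 0 < δ := lt_min (lt_min hγ hγ₀) (by positivity)
  have hδγ : δ ≤ γ := (min_le_left _ _).trans (min_le_left _ _)
  have hδγ₀ : δ ≤ γ₀ := (min_le_left _ _).trans (min_le_right _ _)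
  have hδε : δ ≤ ε / (2 * (S + 1)) := min_le_right _ _
  have h1 := est δ hδpos hδγ hδγ₀
  have h2 : δ * S ≤ ε / (2 * (S + 1)) * S := mul_le_mul_of_nonneg_right hδε hS0
  have h3 : ε / (2 * (S + 1)) * S < ε := by
    rw [div_mul_eq_mul_div, div_lt_iff₀ (by positivity)]
    nlinarith
  linarith

/-- **T8♭ with the anchor supplied by the moduli (McShane)**: `HistLipschitz` + (iv) ⟹ SOME anchoring corner sequence exists and EVERY anchoring sequence is floored. [folklore] -/
theorem cornerFloor_of_histLipschitz_runwiseFloor' {Λ : ℕ → ℕ → ℝ} {γ γ₀ M : ℝ} (hγ : 0 < γ) (hL : HistLipschitz Λ γ β) (hγ₀ : 0 < γ₀) (hfl : RunwiseFloor β γ₀ M) :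
    (∃ b : ℕ → ℝ, ScaleAnchor β b) ∧ ∀ b : ℕ → ℝ, ScaleAnchor β b → ∀ k n : ℕ, k ≤ n → -M ≤ ∑ j ∈ Finset.Ico k n, b j :=
  ⟨exists_scaleAnchor_of_histLipschitz hγ hL, fun _ hb => cornerFloor_of_histLipschitz_runwiseFloor hγ hL hb hγ₀ hfl⟩

/-- **A CONVERGENT SEQUENCE WITH FLOORED WINDOW SUMS HAS LIMIT `≥ 0`**: if `b → L` and `Σ_{[k,n)} b ≥ −M` for all `k ≤ n`, then `0 ≤ L` (else windows deep in the tail have sums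
`≤ (n−k)·L∕2 → −∞`). [folklore] -/
theorem lim_nonneg_of_windowFloor {L M : ℝ} (hb : Tendsto b atTop (𝓝 L)) (hfl : ∀ k n : ℕ, k ≤ n → -M ≤ ∑ j ∈ Finset.Ico k n, b j) : 0 ≤ L := by
  by_contra hL
  push Not at hL
  have hev : ∀ᶠ j in atTop, b j < L / 2 := hb.eventually (Iio_mem_nhds (by linarith))
  obtain ⟨k₀, hk₀⟩ := eventually_atTop.1 hev
  have hM0 : 0 ≤ M := by have := hfl 0 0 le_rfl; simp at this; linarith
  set N : ℕ := ⌈2 * M / (-L)⌉₊ + 1 with hN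
  have hNgt : 2 * M / (-L) < N := by
    have := Nat.le_ceil (2 * M / (-L)); rw [hN]; push_cast; linarith
  have hNL : (N : ℝ) * (L / 2) < -M := by
    have hnegL : 0 < -L := by linarith
    have h1 : 2 * M < N * (-L) := by rwa [div_lt_iff₀ hnegL] at hNgt
    linarith
  have hsum : ∑ j ∈ Finset.Ico k₀ (k₀ + N), b j ≤ N * (L / 2) := by
    have h := Finset.sum_le_card_nsmul (Finset.Ico k₀ (k₀ + N)) b (L / 2) fun j hj => (hk₀ j (Finset.mem_Ico.1 hj).1).le
    rw [Nat.card_Ico, Nat.add_sub_cancel_left, nsmul_eq_mul] at h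
    exact h
  have hfl' := hfl k₀ (k₀ + N) (Nat.le_add_right _ _)
  linarith

/-- **T9♭ — ON THE MASS-BAND ROAD THE LIMIT SIGN OF A CONVERGENT ANCHOR IS STILL NECESSARY (no N17 on the β side)**: moduli + an anchoring `b` that converges to `L` + (iv) ⟹ `0 ≤ L`. [folklore] -/
theorem lim_nonneg_of_histLipschitz_anchor_runwiseFloor {Λ : ℕ → ℕ → ℝ} {γ γ₀ M L : ℝ} (hγ : 0 < γ) (hL : HistLipschitz Λ γ β) (hb : ScaleAnchor β b)
    (hlim : Tendsto b atTop (𝓝 L)) (hγ₀ : 0 < γ₀) (hfl : RunwiseFloor β γ₀ M) : 0 ≤ L :=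
  lim_nonneg_of_windowFloor hlim (cornerFloor_of_histLipschitz_runwiseFloor hγ hL hb hγ₀ hfl)

/-- **T9♭ AT THE NAMED JETS (the (D1)-sign necessity of ed.2∕ed.6 recovered WITHOUT N17)**: at a tuple, if the datum's β carries history moduli on `]0, θ.γ]`, is ANCHORED by the named one-loop
numbers `θ.cβ·beta0OfJs F κ` (`0 < θ.cβ`) and has K1⁸'s floor (iv) at some window, then the tree's HYPOTHESIS-FREE limit of the named numbers (gan24∕g1-p3 via p607079 `tendsto_beta0OfJs`) is
`≥ 0`.  CONDITIONAL on three hypothesis shapes about the record; nothing of Bałaban asserted; no κ is claimed to anchor any record. [cite: Balaban1987RG1, (1.3) p.260, (2.12)-(2.14) p.268 and Thm 2 p.259] -/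
theorem limJs_nonneg_of_histLipschitz_anchorJets_runwiseFloor {F : T4Family} {κ : StepColourData} {θ : Node00.Stage13HParams F 2} {hP : θ.Provisos₁₃SepCoPH F 2}
    {Λ : ℕ → ℕ → ℝ} {γ₀ M : ℝ} (hγ : 0 < θ.γ) (hL : HistLipschitz Λ θ.γ (Node00.datumOfRecord₁₃SepCoPH F 2 θ hP).βfun) (hcβ : 0 < θ.cβ)
    (hb : ScaleAnchor (Node00.datumOfRecord₁₃SepCoPH F 2 θ hP).βfun (fun k => θ.cβ * beta0OfJs F κ k)) (hγ₀ : 0 < γ₀)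
    (hfl : RunwiseFloor (Node00.datumOfRecord₁₃SepCoPH F 2 θ hP).βfun γ₀ M) : 0 ≤ Beta.RateCertificate.CauchyRate.lim (beta0OfJs F κ) := by
  have ht := (Summit.QuantumFields.YangMills.Theorems.BalabanUVNodesK2NamedJetsLimit.tendsto_beta0OfJs F κ).const_mul θ.cβ
  have h := lim_nonneg_of_histLipschitz_anchor_runwiseFloor hγ hL hb ht hγ₀ hfl
  exact nonneg_of_mul_nonneg_right (by simpa [mul_comm] using h) hcβ |> fun h' => h'

/-- **T9♭ʳ ★ K1⁸ BY NAME FLOORS EVERY ANCHORING CORNER SEQUENCE AT ITS WITNESS, GIVEN ONLY THE MODULI THERE** (N17-free, mass-free rewrite of T9): `StabilityBRunRowsAtRecordR13SepCoPH` ⟹ for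
every family with an inhabited prefix there is an admissible tuple with (B) and Window13 at which, for every moduli letter `HistLipschitz Λ θ.γ β_θ` and every anchor `b` of `β_θ`,
`∃ M, ∀ k ≤ n, −M ≤ Σ_{[k,n)} b_j`.  CONDITIONAL (K1⁸ is the hypothesis); K1⁸ NOT proved; nothing of Bałaban asserted. [cite: Balaban1987RG1, Thm 2 p.259 with (0.31) and section 5 p.298] -/
theorem cornerFloor_at_witness_of_K1R8 (hK18 : Summit.QuantumFields.YangMills.Theses.BalabanUVNodes.StabilityBRunRowsAtRecordR13SepCoPH) :
    ∀ F : T4Family, (∃ θ : Node00.Stage13HParams F 2, θ.Provisos₁₃SepCoPH F 2 ∧ (θ.ZhUnity F 2 ∧ θ.SlotsNondegenerate₁₃ F 2) ∧ θ.Admissible F 2) →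
      ∃ (θ : Node00.Stage13HParams F 2) (hP : θ.Provisos₁₃SepCoPH F 2), (θ.ZhUnity F 2 ∧ θ.SlotsNondegenerate₁₃ F 2) ∧ θ.Admissible F 2 ∧
        B16.EndStatementBPrinted (Node00.datumOfRecord₁₃SepCoPH F 2 θ hP).C ∧ Window13 F θ hP ∧
        ∀ (Λ : ℕ → ℕ → ℝ) (b : ℕ → ℝ), HistLipschitz Λ θ.γ (Node00.betaOfRecord₁₃ F 2 θ.toStage13Params) → ScaleAnchor (Node00.betaOfRecord₁₃ F 2 θ.toStage13Params) b →
          ∃ M : ℝ, ∀ k n : ℕ, k ≤ n → -M ≤ ∑ j ∈ Finset.Ico k n, b j := by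
  intro F hF
  obtain ⟨θ, hP, hU, hθ, hB, hwin, hrows⟩ := hK18 F hF
  refine ⟨θ, hP, hU, hθ, hB, hwin, fun Λ b hL hb => ?_⟩
  obtain ⟨γ₀, M, hγ₀, hfl⟩ := runwiseFloor_of_runRowsShape (β := Node00.betaOfRecord₁₃ F 2 θ.toStage13Params) hrows
  exact ⟨M, cornerFloor_of_histLipschitz_runwiseFloor hθ.toStage12.toStage9.gamma_pos hL hb hγ₀ hfl⟩

/-- **T9♭ʳⱽ — THE SAME AT THE REV-28∕29 DECIDING CRUX K1⁹ `StabilityBRunRowsAtRecordR13SepCoPHV` (stmt-QuantumFields-27364; K1⁸ with the VERSION SLOT `v`: (B) and the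
window read at the re-chosen datum `datumOfRecord₁₃SepCoPHV F 2 θ h v`, rows θ-level and slot-free — so §5–§10 apply to its rows conjunct VERBATIM)**: K1⁹ BY NAME ⟹ at its witness
`(θ, h, v)`, for every moduli letter and every anchor of `β_θ`, the corner sequence is floored.  CONDITIONAL (K1⁹ is the hypothesis); K1⁹ NOT proved; nothing of Bałaban asserted.
[cite: Balaban1987RG1, Thm 2 p.259 with (0.31) and section 5 p.298; Balaban1989LargeFieldII, Thm 1 p.355] -/
theorem cornerFloor_at_witness_of_K1R9 (hK19 : Summit.QuantumFields.YangMills.Theses.BalabanUVNodes.StabilityBRunRowsAtRecordR13SepCoPHV) :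
    ∀ F : T4Family, (∃ θ : Node00.Stage13HParams F 2, θ.Provisos₁₃SepCoPH F 2 ∧ (θ.ZhUnity F 2 ∧ θ.SlotsNondegenerate₁₃ F 2) ∧ θ.Admissible F 2) →
      ∃ (θ : Node00.Stage13HParams F 2) (h : θ.Provisos₁₃SepCoPH F 2) (v : Node00.Revision₁₃ F 2 θ h), (θ.ZhUnity F 2 ∧ θ.SlotsNondegenerate₁₃ F 2) ∧ θ.Admissible F 2 ∧
        B16.EndStatementBPrinted (Node00.datumOfRecord₁₃SepCoPHV F 2 θ h v).C ∧
        (∃ γ₁ : ℝ, 0 < γ₁ ∧ ∀ γ : ℝ, 0 < γ → γ ≤ γ₁ → ∃ P : B12.RunParams, 1 ≤ P.K ∧ ((Node00.datumOfRecord₁₃SepCoPHV F 2 θ h v).C P).flow.InInterval γ P.K) ∧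
        ∀ (Λ : ℕ → ℕ → ℝ) (b : ℕ → ℝ), HistLipschitz Λ θ.γ (Node00.betaOfRecord₁₃ F 2 θ.toStage13Params) → ScaleAnchor (Node00.betaOfRecord₁₃ F 2 θ.toStage13Params) b →
          ∃ M : ℝ, ∀ k n : ℕ, k ≤ n → -M ≤ ∑ j ∈ Finset.Ico k n, b j := by
  intro F hF
  obtain ⟨θ, h, v, hU, hθ, hB, hwin, hrows⟩ := hK19 F hF
  refine ⟨θ, h, v, hU, hθ, hB, hwin, fun Λ b hL hb => ?_⟩
  obtain ⟨γ₀, M, hγ₀, hfl⟩ := runwiseFloor_of_runRowsShape (β := Node00.betaOfRecord₁₃ F 2 θ.toStage13Params) hrows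
  exact ⟨M, cornerFloor_of_histLipschitz_runwiseFloor hθ.toStage12.toStage9.gamma_pos hL hb hγ₀ hfl⟩

/-- A drift at a slope `s ≥ 0` floors the window sums of `b` (by `2A`). [folklore] -/
theorem windowFloor_of_oneLoopDrift_nonneg {s A : ℝ} (hdrift : OneLoopDrift s A b) (hs : 0 ≤ s) :
    ∀ k n : ℕ, k ≤ n → -(2 * A) ≤ ∑ j ∈ Finset.Ico k n, b j := by
  intro k n hkn
  have hk := hdrift k
  have hn := hdrift n
  rw [Finset.sum_Ico_eq_sub _ hkn]
  have h1 := (abs_sub_le_iff.1 hk).1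
  have h2 := (abs_sub_le_iff.1 hn).2
  have hkn' : (k : ℝ) ≤ n := by exact_mod_cast hkn
  nlinarith [mul_le_mul_of_nonneg_left hkn' hs]

/-- **T14♭ ★★ THE N17-FREE BRACKET ON THE MASS-BAND ROAD** (generic β with moduli `HistLipschitz Λ γ β`, bounded mass `M`, anchor `b`): «`b` drifts at a slope `s > 0`» ⟹ ROWS ⟹ «`b` has
floored window sums» ⟸ «`b` drifts at a slope `s ≥ 0`» — the two ends differ by the SEAM `s = 0` (and by non-drifting floored `b`), and the seam is inhabited WITH rows (TOY A `betaZero`,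
§5) and WITHOUT rows (TOY D `betaOsc`, §8: U3ᴷ-lite letters, anchored at `b ≡ 0`, END, no rows): on the live road the registered 2ᶜᴰ's strictness over-pays K1⁸ by exactly the seam — ed.6's
T7∕T14 reading, now certified without N17 or `FadingMemory`.  A statement about hypothesis SHAPES; nothing of Bałaban asserted. [cite: Balaban1987RG1, Thm 2 p.259 with (0.31), (1.3) p.260 and (2.12)-(2.14) p.268] -/
theorem massBand_bracket {Λ : ℕ → ℕ → ℝ} {γ L : ℝ} (hγ : 0 < γ) (hL : HistLipschitz Λ γ β) (hM : RowSumMemory L Λ) (hb : ScaleAnchor β b) :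
    (∀ s A : ℝ, OneLoopDrift s A b → 0 < s → RunRowsShape β) ∧
    (RunRowsShape β → ∃ M : ℝ, ∀ k n : ℕ, k ≤ n → -M ≤ ∑ j ∈ Finset.Ico k n, b j) ∧
    (∀ s A : ℝ, OneLoopDrift s A b → 0 ≤ s → ∃ M : ℝ, ∀ k n : ℕ, k ≤ n → -M ≤ ∑ j ∈ Finset.Ico k n, b j) :=
  ⟨fun _ _ hdrift hs => runRowsShape_of_histLipschitz_rowSum_cornerDriftPos hγ hL hM hb hdrift hs,
   fun hrows => by
    obtain ⟨γ₀, M, hγ₀, hfl⟩ := runwiseFloor_of_runRowsShape hrows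
    exact ⟨M, cornerFloor_of_histLipschitz_runwiseFloor hγ hL hb hγ₀ hfl⟩,
   fun _ A hdrift hs => ⟨2 * A, windowFloor_of_oneLoopDrift_nonneg hdrift hs⟩⟩

/-- **THE SEAM IS UNDECIDED ON U3ᴷ-lite TUPLES**: both toys carry the moduli with bounded mass, the anchor `b ≡ 0` (drift slope `0`, floored window sums) — TOY A has the rows, TOY D has END and
no rows. [folklore] -/
theorem massBand_seam_undecided :
    (∃ β : HBeta, (∃ (Λ : ℕ → ℕ → ℝ) (L : ℝ), HistLipschitz Λ 1 β ∧ RowSumMemory L Λ) ∧ ScaleAnchor β (fun _ => 0) ∧ RunRowsShape β) ∧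
    (∃ β : HBeta, (∃ (Λ : ℕ → ℕ → ℝ) (L : ℝ), HistLipschitz Λ 1 β ∧ RowSumMemory L Λ) ∧ ScaleAnchor β (fun _ => 0) ∧
      EndpointExistence (FlowStepRuns.modelOf β) ∧ ¬ RunRowsShape β) := by
  refine ⟨⟨betaZero, ⟨fun _ _ => 0, 0, fun k p q _ _ => by simp [betaZero], fun k => by simp⟩,
    fun k δ hδ => ⟨1, one_pos, fun p _ => by simp [betaZero, hδ.le]⟩, runRowsShape_betaZero⟩, ⟨betaOsc, ?_, (letters_betaOsc 1).2.2.2.1, endpointExistence_betaOsc, not_runRowsShape_betaOsc⟩⟩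
  obtain ⟨-, hL, hF, -, -⟩ := letters_betaOsc 1
  exact ⟨lamOsc, _, hL, rowSumMemory_of_fadingMemory hF (by norm_num) (by norm_num)⟩

end MassBandBackwards

end Summit.QuantumFields.YangMills.Cruxes.EndpointGivenBR13SepCoPH.Idea7V7cCornerNecessity

end
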